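import Literature.NumberTheory.Automorphic.UnboundedDenominators
import Literature.NumberTheory.Automorphic.WohlfahrtLevel

/-!
# The unbounded denominators theorem (Calegari–Dimitrov–Tang) — reductions of the statement

Second sibling file of `Literature/NumberTheory/Automorphic/UnboundedDenominators.lean`, which
vendors Calegari–Dimitrov–Tang's Theorem 1 [CalegariDimitrovTang2025] (the unbounded denominators
conjecture, holomorphic-at-the-cusps case) as the named fact
`CalegariDimitrovTang2025_unboundedDenominators`. The companion file
`UnboundedDenominatorsProofs.lean` follows the printed proof (its §4, Wohlfahrt's theorem); the
present file is independent of it and records, sorry-free and with NO new definitions and NO new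
named facts (D-0026), the *outer reductions* of the statement that present-day Mathlib proves —
the invariances of the hypothesis and the equivalent forms of the theorem — isolating a core case
to which the fact is equivalent. Everything here is folklore around
[CalegariDimitrovTang2025, Theorem 1 and §1 p. 3]; numbering is that of arXiv:2109.09040.

## Contents

* **A. Change of period.** `qExpansion_coeff_natMul`: for a modular form with positive strict
  period `h`, the `q`-expansion at period `m h` is the one at `h` spread out by `m`
  (`𝕢_h = 𝕢_{mh}ᵐ` and uniqueness of `q`-expansions). The strict periods of a finite-index
  `Γ ≤ SL(2, ℤ)` are the positive integer multiples of the cusp width `strictWidthInfty Γ`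
  (`exists_eq_natMul_strictWidthInfty`, `exists_strictWidthInfty_eq_nat`), so a property of
  coefficients true at `0` — "rational integer", "algebraic integer" — holds at one positive strict
  period iff at any other (`forall_coeff_qExpansion_iff_of_mem_strictPeriods`): the integrality
  hypothesis of the fact does not depend on the auxiliary period `h`.
* **B. Restriction of the level.** `exists_modularForm_restrict`; a strict period of `Γ` has a
  multiple which is a strict period of any finite-index `Γ₀` (`exists_natMul_mem_strictPeriods`).
* **C. Twists by level-one forms.** `E₄ = 1 + 240 Σ σ₃ qⁿ` (`E₄_qExpansion_coeff`, from Mathlib's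
  `EisensteinSeries.E_qExpansion_coeff` and `B₄ = -1/30`) is integral at every integer period;
  `f ↦ f · E₄` preserves "level `Γ`, integral at `h`" (`exists_modularForm_mul_E₄`); and the
  **untwisting lemma** `exists_modularForm_of_mul_levelOne`: if `f ∈ M_k(Γ)` and `f · E` is a
  modular form of weight `k + l` on a finite-index `Γ'` for some level-one `E ≢ 0` of weight `l`,
  then `f ∈ M_k(Γ')` (`(f|ₖγ − f) E = 0` on the connected `ℍ`, Mathlib's
  `UpperHalfPlane.mul_eq_zero_iff`; cusps of arithmetic groups are `ℙ¹(ℚ)`).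
* **D. Weight raising.** `…conclusion_of_mul_E₄` (pointwise) and `…of_large_weight`: the fact
  follows from its restriction to weights `k ≥ K₀`, any `K₀`.
* **E. Odd weight.** `…conclusion_of_odd_weight_of_neg_one_mem`: trivial when `-1 ∈ Γ`.
* **F. Equivalent forms.** `…iff_boundedDenominators` (coefficients with bounded denominators) and
  `…iff_unboundedDenominators` — the contrapositive exactly as printed on p. 3 of the source: "if
  `f ∈ ℚ⟦q^{1/N}⟧` is a modular form which is not modular for some congruence subgroup, then the
  coefficients of `f` have unbounded denominators".
* **G. Core case.** `…conclusion_of_core_case` (pointwise) and `…of_core M K₀`: the fact follows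
  from its case of a *normal*, *noncongruence*, finite-index `Γ ≤ Γ(M)`, weight `k ≥ K₀`,
  `f ≠ 0`, integrality at the exact cusp width — the setting `G = G_N ⊴ SL₂(ℤ)`,
  `G ⊂ ⟨E, Γ(N)⟩` of [CalegariDimitrovTang2025, §4.2–4.3].
* **H. Weights divisible by `12`.** `E₆ = 1 − 504 Σ σ₅ qⁿ` (`B₆ = 1/42`), the `E₆`-twist, and
  `…of_weight_twelve_mul_and_odd`: the fact follows from (i) its case of weight `12 m`, `m ≥ 1`
  (where `f / Δᵐ` is a weight-`0` modular function holomorphic on `ℍ` — the objects `R_N` of the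
  printed proof, [CalegariDimitrovTang2025, Definition 22]) together with (ii) its case of odd
  weight on levels `Γ ∌ -1`. This replaces, inside Mathlib's holomorphic `ModularForm` language, the
  weight-zero reduction `f ↦ f · (λ/16 η(τ/2)²)ᵏ` of [CalegariDimitrovTang2025, §1 p. 3].
* **I. Core case, final form.** `…of_core_twelve_mul_and_odd M`: G and H combined — the fact
  follows from its two core cases (normal noncongruence `Γ ≤ Γ(M)`, `f ≠ 0`, integrality at the
  cusp width) in weights `12 m` (`m ≥ 1`) and in odd weights `k ≥ 1` with `-1 ∉ Γ`.
* **J. `θ²` as a weight-one congruence form** (added 2026-08-15, second instalment).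
  `exists_modularForm_thetaSq`: a finite-index congruence subgroup `K ≤ SL(2, ℤ)` with
  `2 ∈ strictPeriods K` and a Mathlib `ModularForm K 1` whose function is `θ(τ)²`
  (`jacobiTheta`), built from Mathlib's theta API: the multiplier of `θ²` on `⟨S, T²⟩`
  (`exists_thetaSq_slash_eq_smul`), the coset decomposition `SL(2, ℤ) = Γ_θ ∪ Γ_θ T ∪ Γ_θ T S`
  (`exists_mem_closure_S_T_sq`), Sanov's generation `Γ(4) ⊆ ⟨T², S T² S⁻¹⟩`
  (`Gamma_four_le_closure_T_sq`, Euclidean descent), the estimates at `1`, `T`, `T S` (the last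
  by the functional equation of `jacobiTheta₂`), and the `q`-expansion `θ² = Σ r₂(m) e^{πimτ}`
  with integer coefficients (`exists_hasSum_thetaSq_qParam`, `thetaSq_qExpansion_coeff_int`);
  `θ² ≢ 0` (`thetaSq_ne_zero`).
* **K. Even weights, and weights `12 m`, suffice.** Twisting/untwisting by a form on another
  level (`exists_modularForm_mul_of_level`, `exists_modularForm_of_mul_of_level`);
  `…of_even_weight` (θ²-twist of odd weights); `…even_weight_of_weight_twelve_mul`;
  `…of_weight_twelve_mul`; and the headline `…of_core_twelve_mul M`: **the fact follows from its
  single core case — normal noncongruence finite-index `Γ ≤ Γ(M)`, weight `12 m` (`m ≥ 1`),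
  `f ≠ 0`, integrality at the cusp width** — i.e. (dividing by `Δᵐ`) from the statement
  "`R_N = M_N`" of the printed proof for such levels.
* **L. The core case in the setting of CDT §4.3** (third instalment). Every finite-index `Γ`
  has a level (`exists_forall_conj_T_pow_mem`: some `N ≥ 1` with all `g Tᴺ g⁻¹ ∈ Γ`);
  `T_pow_mem_Gamma_iff`; `…conclusion_of_core_level_case` and `…of_core_level`: the fact follows
  from its case of a normal noncongruence finite-index `G ≤ Γ(N)` containing all `g Tᴺ g⁻¹` and of
  cusp width exactly `N` at `∞` (so `N` = Wohlfahrt level of `G`), weight `12 m`, `f ≠ 0`,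
  `f ∈ ℤ⟦e^{2πiτ/N}⟧` — the input of CDT's leveraging argument (Theorem 25 / Proposition 28).
* **M. `Δ` has rational-integer `q`-expansion** (fourth instalment): from Mathlib's
  `1728 Δ = E₄³ - E₆²` and the congruence `12 ∣ 5 σ₃(n) + 7 σ₅(n)`
  (`exists_discriminant_qExpansion_eq_map`, `discriminant_qExpansion_coeff_int`, at every
  integer period `discriminant_qExpansion_natCast_coeff_int`).
* **N. Twisting by `Δ`.** `qExpansion h Δ = Xʰ U`, `U ∈ ℤ⟦X⟧ˣ`
  (`exists_discriminant_qExpansion_natCast_eq_X_pow_mul`); integrality at `h` is preserved AND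
  reflected by `f ↦ f Δ` (`forall_coeff_int_iff_of_mul_discriminant`) — so the integrality
  hypothesis of the weight-`12 m` core case is the integrality of the Laurent coefficients of
  `f / Δᵐ`; weight raising by `12` (`…conclusion_of_mul_discriminant`,
  `…of_weight_twelve_mul_ge m₀`).
* **O. The core case with `-1 ∈ G ⊆ ±Γ(N)`** (fifth instalment). Even-weight forms extend across
  `-1` (`slash_neg_one_of_even`, `exists_modularForm_adjoinNegOne`); `…of_core_level_negOne` and
  the equivalence `…iff_core_level_negOne`: **the fact is equivalent to its case for `G` normal
  of finite index, `-1 ∈ G ⊆ ±Γ(N)`, all `g Tᴺ g⁻¹ ∈ G`, cusp width `N` at `∞`, `G`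
  noncongruence, weight `12 m` (`m ≥ 1`), `f ≠ 0`, `f ∈ ℤ⟦e^{2πiτ/N}⟧`** — literally the setting
  `E ⊂ G = G_N ⊂ ⟨E, Γ(N)⟩`, `L(G) = N`, of CDT §4.2–4.3.
* **P. In terms of the Wohlfahrt level** (tree `wohlfahrtLevel`): `…iff_core_wohlfahrtLevel` —
  the same equivalence with `N` eliminated in favour of `L(G)`.
* **Q. The algebraic-integer version** `…_algInt.of_galois_of_core_wohlfahrtLevel`: what the
  consumer-facing fact needs in total — the two classical inputs of Remark 59 and the core case.

None of this touches the theorem proper (the core case), whose printed proof needs the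
arithmetic holonomy bound, the algebraic theory of noncongruence modular curves, the congruence
subgroup property of `SL₂(ℤ[1/p])`, the conformal radius of `ℂ ∖ μ_N` and Nevanlinna theory
(op. cit. §§2–6), none of which is in Mathlib.

## References

* [CalegariDimitrovTang2025] F. Calegari, V. Dimitrov, Y. Tang, The unbounded denominators
  conjecture, J. Amer. Math. Soc. 38 (2025), no. 3, 627–702; arXiv:2109.09040, Theorem 1, §1
  (p. 3), §4.2 (Definition 22, Lemma 24), §4.3.
-/

noncomputable section

namespace Literature.NumberTheory.Automorphic

open scoped MatrixGroups ModularForm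
open UpperHalfPlane CongruenceSubgroup Complex Matrix.SpecialLinearGroup

/-! ### A. Change of period in the `q`-expansion -/

/-- `𝕢_{m h}(τ)ᵐ = 𝕢_h(τ)`: `exp(2πiτ/(mh))ᵐ = exp(2πiτ/h)`. [folklore] -/
private theorem qParam_natMul_pow (h : ℝ) {m : ℕ} (hm : m ≠ 0) (τ : ℍ) :
    Function.Periodic.qParam ((m : ℝ) * h) τ ^ m = Function.Periodic.qParam h τ := by
  simp only [Function.Periodic.qParam, ← Complex.exp_nat_mul]
  congr 1
  push_cast
  field_simp

/-- **Change of period.** For a modular form `f` on `Γ ≤ GL(2, ℝ)` with a positive strict period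
`h`, the `q`-expansion at the period `m h` (`m ≥ 1`) is the `q`-expansion at `h` spread out by the
factor `m`: its `j`-th coefficient is the `(j/m)`-th coefficient at period `h` if `m ∣ j`, else `0`
(uniqueness of `q`-expansions, `𝕢_h = 𝕢_{mh}ᵐ`). [folklore] -/
theorem qExpansion_coeff_natMul {Γ : Subgroup (GL (Fin 2) ℝ)} {k : ℤ} (f : ModularForm Γ k)
    {h : ℝ} (hh : 0 < h) (hΓ : h ∈ Γ.strictPeriods) {m : ℕ} (hm : m ≠ 0) (j : ℕ) :
    PowerSeries.coeff j (qExpansion ((m : ℝ) * h) f) =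
      if m ∣ j then PowerSeries.coeff (j / m) (qExpansion h f) else 0 := by
  classical
  have hmh : (0 : ℝ) < (m : ℝ) * h := mul_pos (Nat.cast_pos.mpr (Nat.pos_of_ne_zero hm)) hh
  have hΓm : (m : ℝ) * h ∈ Γ.strictPeriods := by
    simpa [nsmul_eq_mul] using Γ.strictPeriods.nsmul_mem hΓ m
  set c : ℕ → ℂ := fun j ↦ if m ∣ j then PowerSeries.coeff (j / m) (qExpansion h f) else 0
  suffices ∀ τ : ℍ, HasSum (fun j ↦ c j • Function.Periodic.qParam ((m : ℝ) * h) τ ^ j) (f τ) from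
    (ModularFormClass.qExpansion_coeff_unique hmh hΓm this j).symm
  haveI : Fact (IsCusp OnePoint.infty Γ) := ⟨Γ.isCusp_of_mem_strictPeriods hh hΓ⟩
  intro τ
  have hs := hasSum_qExpansion hh (SlashInvariantFormClass.periodic_comp_ofComplex f hΓ)
    (ModularFormClass.holo f) (ModularFormClass.bdd_at_infty f) τ
  refine (Function.Injective.hasSum_iff (mul_right_injective₀ hm) ?_).mp ?_
  · intro x hx
    have : ¬ m ∣ x := fun ⟨n, hn⟩ ↦ hx ⟨n, hn.symm⟩
    simp [c, this]
  · convert hs using 1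
    funext n
    simp only [Function.comp_apply, c, dvd_mul_right, if_true,
      Nat.mul_div_cancel_left _ (Nat.pos_of_ne_zero hm), pow_mul, qParam_natMul_pow h hm τ]

/-- Coefficients at period `h` are among the coefficients at period `m h`:
`a_n^{(h)} = a_{mn}^{(mh)}`. [folklore] -/
theorem qExpansion_coeff_eq_coeff_natMul {Γ : Subgroup (GL (Fin 2) ℝ)} {k : ℤ}
    (f : ModularForm Γ k) {h : ℝ} (hh : 0 < h) (hΓ : h ∈ Γ.strictPeriods) {m : ℕ} (hm : m ≠ 0)
    (n : ℕ) :
    PowerSeries.coeff n (qExpansion h f) =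
      PowerSeries.coeff (m * n) (qExpansion ((m : ℝ) * h) f) := by
  rw [qExpansion_coeff_natMul f hh hΓ hm, if_pos (dvd_mul_right m n),
    Nat.mul_div_cancel_left _ (Nat.pos_of_ne_zero hm)]

/-- A property of coefficients holding at `0` transfers from period `h` to period `m h`.
[folklore] -/
theorem forall_coeff_qExpansion_natMul {Γ : Subgroup (GL (Fin 2) ℝ)} {k : ℤ}
    (f : ModularForm Γ k) {h : ℝ} (hh : 0 < h) (hΓ : h ∈ Γ.strictPeriods) {m : ℕ} (hm : m ≠ 0)
    {P : ℂ → Prop} (h0 : P 0) (hP : ∀ n, P (PowerSeries.coeff n (qExpansion h f))) (j : ℕ) :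
    P (PowerSeries.coeff j (qExpansion ((m : ℝ) * h) f)) := by
  rw [qExpansion_coeff_natMul f hh hΓ hm]
  split_ifs
  · exact hP _
  · exact h0

/-- … and back from period `m h` to period `h` (no hypothesis at `0` needed). [folklore] -/
theorem forall_coeff_qExpansion_of_natMul {Γ : Subgroup (GL (Fin 2) ℝ)} {k : ℤ}
    (f : ModularForm Γ k) {h : ℝ} (hh : 0 < h) (hΓ : h ∈ Γ.strictPeriods) {m : ℕ} (hm : m ≠ 0)
    {P : ℂ → Prop} (hP : ∀ j, P (PowerSeries.coeff j (qExpansion ((m : ℝ) * h) f))) (n : ℕ) :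
    P (PowerSeries.coeff n (qExpansion h f)) := by
  rw [qExpansion_coeff_eq_coeff_natMul f hh hΓ hm]
  exact hP _

/-- The strict periods of (the image in `GL(2, ℝ)` of) a subgroup of `SL(2, ℤ)` are the integers
`γ 0 1` of its unipotent elements `γ = [1 * ; 0 1]`. [folklore] -/
theorem exists_mem_of_mem_strictPeriods {Γ : Subgroup SL(2, ℤ)} {x : ℝ}
    (hx : x ∈ (Γ : Subgroup (GL (Fin 2) ℝ)).strictPeriods) :
    ∃ γ ∈ Γ, mapGL ℝ γ = Matrix.GeneralLinearGroup.upperRightHom x ∧ (γ 0 1 : ℝ) = x := by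
  rw [Subgroup.mem_strictPeriods_iff] at hx
  obtain ⟨γ, hγ, hγx⟩ := Subgroup.mem_map.mp hx
  refine ⟨γ, hγ, hγx, ?_⟩
  have := congrArg (fun g : GL (Fin 2) ℝ ↦ (g : Matrix (Fin 2) (Fin 2) ℝ) 0 1) hγx
  simpa using this

/-- A positive strict period of a finite-index `Γ ≤ SL(2, ℤ)` is a positive integer multiple of the
cusp width `strictWidthInfty Γ` at `∞`. [folklore] -/
theorem exists_eq_natMul_strictWidthInfty {Γ : Subgroup SL(2, ℤ)} [Γ.FiniteIndex] {h : ℝ}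
    (hh : 0 < h) (hΓ : h ∈ (Γ : Subgroup (GL (Fin 2) ℝ)).strictPeriods) :
    ∃ m : ℕ, m ≠ 0 ∧ h = (m : ℝ) * (Γ : Subgroup (GL (Fin 2) ℝ)).strictWidthInfty := by
  have hw := (Γ : Subgroup (GL (Fin 2) ℝ)).strictWidthInfty_pos
  rw [Subgroup.strictPeriods_eq_zmultiples_strictWidthInfty, AddSubgroup.mem_zmultiples_iff] at hΓ
  obtain ⟨z, rfl⟩ := hΓ
  rw [zsmul_eq_mul] at hh ⊢
  have hz : 0 < z := by
    have : (0 : ℝ) < z := pos_of_mul_pos_left hh hw.le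
    exact_mod_cast this
  refine ⟨z.toNat, by omega, ?_⟩
  rw [show ((z.toNat : ℕ) : ℝ) = ((z.toNat : ℤ) : ℝ) from rfl, Int.toNat_of_nonneg hz.le]

/-- The cusp width at `∞` of a finite-index `Γ ≤ SL(2, ℤ)` is a positive integer. [folklore] -/
theorem exists_strictWidthInfty_eq_nat (Γ : Subgroup SL(2, ℤ)) [Γ.FiniteIndex] :
    ∃ N : ℕ, 0 < N ∧ (Γ : Subgroup (GL (Fin 2) ℝ)).strictWidthInfty = N := by
  have hw := (Γ : Subgroup (GL (Fin 2) ℝ)).strictWidthInfty_pos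
  obtain ⟨γ, -, -, hγ⟩ :=
    exists_mem_of_mem_strictPeriods (Γ : Subgroup (GL (Fin 2) ℝ)).strictWidthInfty_mem_strictPeriods
  have hpos : 0 < γ 0 1 := by exact_mod_cast hγ ▸ hw
  refine ⟨(γ 0 1).toNat, by omega, ?_⟩
  rw [← hγ, show (((γ 0 1).toNat : ℕ) : ℝ) = (((γ 0 1).toNat : ℤ) : ℝ) from rfl,
    Int.toNat_of_nonneg hpos.le]

/-- **Independence of the period.** For a modular form on a finite-index `Γ ≤ SL(2, ℤ)`, a
property of `q`-expansion coefficients that holds at `0` (e.g. "is a rational integer", "is an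
algebraic integer") holds for all coefficients at one positive strict period iff it holds for all
coefficients at any other: both are multiples of the cusp width. In particular the integrality
hypothesis of `CalegariDimitrovTang2025_unboundedDenominators` does not depend on the auxiliary
period `h`. [folklore] -/
theorem forall_coeff_qExpansion_iff_of_mem_strictPeriods {Γ : Subgroup SL(2, ℤ)} [Γ.FiniteIndex]
    {k : ℤ} (f : ModularForm (Γ : Subgroup (GL (Fin 2) ℝ)) k) {h₁ h₂ : ℝ} (hh₁ : 0 < h₁)
    (hΓ₁ : h₁ ∈ (Γ : Subgroup (GL (Fin 2) ℝ)).strictPeriods) (hh₂ : 0 < h₂)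
    (hΓ₂ : h₂ ∈ (Γ : Subgroup (GL (Fin 2) ℝ)).strictPeriods) {P : ℂ → Prop} (h0 : P 0) :
    (∀ n, P (PowerSeries.coeff n (qExpansion h₁ f))) ↔
      ∀ n, P (PowerSeries.coeff n (qExpansion h₂ f)) := by
  have hw := (Γ : Subgroup (GL (Fin 2) ℝ)).strictWidthInfty_pos
  have hwmem := (Γ : Subgroup (GL (Fin 2) ℝ)).strictWidthInfty_mem_strictPeriods
  obtain ⟨m₁, hm₁, rfl⟩ := exists_eq_natMul_strictWidthInfty hh₁ hΓ₁
  obtain ⟨m₂, hm₂, rfl⟩ := exists_eq_natMul_strictWidthInfty hh₂ hΓ₂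
  constructor
  · exact fun H ↦ forall_coeff_qExpansion_natMul f hw hwmem hm₂ h0
      (forall_coeff_qExpansion_of_natMul f hw hwmem hm₁ H)
  · exact fun H ↦ forall_coeff_qExpansion_natMul f hw hwmem hm₁ h0
      (forall_coeff_qExpansion_of_natMul f hw hwmem hm₂ H)

/-! ### B. Restriction of the level -/

/-- Restriction of level: a weight-`k` modular form on `Γ ≤ GL(2, ℝ)` is a weight-`k` modular form
on every `Γ' ≤ Γ`, with the same underlying function. [folklore] -/
theorem exists_modularForm_restrict {Γ Γ' : Subgroup (GL (Fin 2) ℝ)} (hle : Γ' ≤ Γ) (k : ℤ)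
    (f : ModularForm Γ k) : ∃ g : ModularForm Γ' k, (g : ℍ → ℂ) = f :=
  ⟨{ toFun := f
     slash_action_eq' := fun γ hγ ↦ f.slash_action_eq' γ (hle hγ)
     holo' := f.holo'
     bdd_at_cusps' := fun hc ↦ f.bdd_at_cusps' (hc.mono hle) }, rfl⟩

/-- A strict period of `Γ ≤ SL(2, ℤ)` has a positive multiple which is a strict period of any
finite-index `Γ₀ ≤ SL(2, ℤ)` (a power of the unipotent `γ ∈ Γ` lands in `Γ₀`). [folklore] -/
theorem exists_natMul_mem_strictPeriods {Γ : Subgroup SL(2, ℤ)} (Γ₀ : Subgroup SL(2, ℤ))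
    [Γ₀.FiniteIndex] {h : ℝ} (hΓ : h ∈ (Γ : Subgroup (GL (Fin 2) ℝ)).strictPeriods) :
    ∃ m : ℕ, m ≠ 0 ∧ (m : ℝ) * h ∈ (Γ₀ : Subgroup (GL (Fin 2) ℝ)).strictPeriods := by
  obtain ⟨γ, -, hγ, -⟩ := exists_mem_of_mem_strictPeriods hΓ
  obtain ⟨n, hn, -, hγn⟩ := Γ₀.exists_pow_mem_of_index_ne_zero Subgroup.FiniteIndex.index_ne_zero γ
  refine ⟨n, hn.ne', ?_⟩
  rw [Subgroup.mem_strictPeriods_iff]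
  refine Subgroup.mem_map.mpr ⟨γ ^ n, hγn, ?_⟩
  rw [map_pow, hγ, ← AddChar.map_nsmul_eq_pow, nsmul_eq_mul]


/-! ### C. Twisting by level-one forms -/

/-- The `q`-expansion of the normalised weight-4 Eisenstein series, `E₄ = 1 + 240 Σ σ₃(n) qⁿ`
(Mathlib's `EisensteinSeries.E_qExpansion_coeff` with `B₄ = -1/30`). [folklore] -/
theorem E₄_qExpansion_coeff (m : ℕ) :
    PowerSeries.coeff m (qExpansion 1 ModularForm.E₄) =
      if m = 0 then 1 else 240 * (ArithmeticFunction.sigma 3 m : ℂ) := by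
  have hb : bernoulli 4 = -1 / 30 := by
    rw [bernoulli_eq_bernoulli'_of_ne_one (by norm_num), bernoulli'_four]
  rw [ModularForm.E₄, EisensteinSeries.E_qExpansion_coeff (by norm_num) (by decide) m, hb]
  split_ifs
  · rfl
  · push_cast
    norm_num

/-- `E₄` has rational-integer `q`-expansion coefficients at period `1`. [folklore] -/
theorem E₄_qExpansion_coeff_int (m : ℕ) :
    ∃ z : ℤ, PowerSeries.coeff m (qExpansion 1 ModularForm.E₄) = (z : ℂ) := by
  rw [E₄_qExpansion_coeff]
  split_ifs
  · exact ⟨1, by simp⟩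
  · exact ⟨240 * ArithmeticFunction.sigma 3 m, by push_cast; rfl⟩

/-- `E₄` has rational-integer `q`-expansion coefficients at every positive integer period.
[folklore] -/
theorem E₄_qExpansion_natCast_coeff_int {h : ℕ} (hh : h ≠ 0) (j : ℕ) :
    ∃ z : ℤ, PowerSeries.coeff j (qExpansion (h : ℝ) ModularForm.E₄) = (z : ℂ) := by
  have := forall_coeff_qExpansion_natMul ModularForm.E₄ one_pos one_mem_strictPeriods_SL hh
    (P := fun x : ℂ ↦ ∃ z : ℤ, x = (z : ℂ)) ⟨0, by simp⟩ E₄_qExpansion_coeff_int j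
  simpa only [mul_one] using this

/-- Coefficients of a product of power series with coefficients in a subring stay in the subring.
[folklore] -/
private theorem coeff_mul_mem (S : Subring ℂ) {φ ψ : PowerSeries ℂ}
    (hφ : ∀ n, PowerSeries.coeff n φ ∈ S) (hψ : ∀ n, PowerSeries.coeff n ψ ∈ S) (n : ℕ) :
    PowerSeries.coeff n (φ * ψ) ∈ S := by
  rw [PowerSeries.coeff_mul]
  exact sum_mem fun p _ ↦ mul_mem (hφ _) (hψ _)

/-- "Is (the image of) a rational integer" as membership in the subring `ℤ ⊆ ℂ`. [folklore] -/
private theorem exists_int_iff_mem_range (x : ℂ) :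
    (∃ z : ℤ, x = (z : ℂ)) ↔ x ∈ (Int.castRingHom ℂ).range := by
  simp only [RingHom.mem_range, eq_intCast]
  exact ⟨fun ⟨z, hz⟩ ↦ ⟨z, hz.symm⟩, fun ⟨z, hz⟩ ↦ ⟨z, hz.symm⟩⟩

/-- **Twisting by `E₄`.** A weight-`k` modular form `f` on a finite-index `Γ ≤ SL(2, ℤ)` with
rational-integer `q`-expansion at the positive integer strict period `h` gives the weight-`(k+4)`
form `f · E₄` on `Γ`, again with rational-integer `q`-expansion at `h` (`E₄ ∈ 1 + 240 q ℤ⟦q⟧` and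
`q`-expansions are multiplicative). [folklore] -/
theorem exists_modularForm_mul_E₄ (Γ : Subgroup SL(2, ℤ)) (k : ℤ)
    (f : ModularForm (Γ : Subgroup (GL (Fin 2) ℝ)) k) {h : ℕ} (hh : 0 < h)
    (hΓ : (h : ℝ) ∈ (Γ : Subgroup (GL (Fin 2) ℝ)).strictPeriods)
    (hint : ∀ n : ℕ, ∃ z : ℤ, PowerSeries.coeff n (qExpansion (h : ℝ) f) = (z : ℂ)) :
    ∃ F : ModularForm (Γ : Subgroup (GL (Fin 2) ℝ)) (k + 4),
      (F : ℍ → ℂ) = (f : ℍ → ℂ) * ModularForm.E₄ ∧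
      ∀ n : ℕ, ∃ z : ℤ, PowerSeries.coeff n (qExpansion (h : ℝ) F) = (z : ℂ) := by
  have hh' : (0 : ℝ) < h := Nat.cast_pos.mpr hh
  obtain ⟨E, hE⟩ := exists_modularForm_restrict
    (Subgroup.map_le_range (mapGL ℝ) (H := Γ)) 4 ModularForm.E₄
  refine ⟨f.mul E, by rw [ModularForm.coe_mul, hE], fun n ↦ ?_⟩
  rw [ModularForm.qExpansion_mul hh' hΓ, exists_int_iff_mem_range]
  refine coeff_mul_mem _ (fun m ↦ (exists_int_iff_mem_range _).mp (hint m)) (fun m ↦ ?_) n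
  rw [← exists_int_iff_mem_range, hE]
  exact E₄_qExpansion_natCast_coeff_int hh.ne' m

/-- `-1 ∈ SL(2, ℤ)` maps to `-1 ∈ GL(2, ℝ)`. [folklore] -/
private theorem mapGL_neg_one : mapGL ℝ (-1 : SL(2, ℤ)) = -1 := by
  ext i j
  fin_cases i <;> fin_cases j <;> simp

/-- Cusps do not see the level: for finite-index `Γ, Γ' ≤ SL(2, ℤ)` the cusps of `Γ'` are cusps
of `Γ` (both are `ℙ¹(ℚ)`). [folklore] -/
private theorem isCusp_of_isCusp {Γ Γ' : Subgroup SL(2, ℤ)} [Γ.FiniteIndex] [Γ'.FiniteIndex]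
    {c : OnePoint ℝ} (hc : IsCusp c (Γ' : Subgroup (GL (Fin 2) ℝ))) :
    IsCusp c (Γ : Subgroup (GL (Fin 2) ℝ)) := by
  rw [Subgroup.IsArithmetic.isCusp_iff_isCusp_SL2Z] at hc ⊢
  exact hc

/-- **Untwisting.** Let `f` be a weight-`k` modular form on a finite-index `Γ ≤ SL(2, ℤ)` and `E`
a level-one modular form of weight `l` which is not identically zero (e.g. `E₄`). If the product
`f · E` is (the function underlying) a weight-`(k + l)` modular form on another finite-index
`Γ' ≤ SL(2, ℤ)`, then `f` itself is a weight-`k` modular form on `Γ'`: for `γ ∈ Γ'`,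
`(f|ₖγ − f) · E = (f E)|ₖ₊ₗγ − f E = 0` forces `f|ₖγ = f` (`ℍ` is connected and `E ≢ 0`,
`UpperHalfPlane.mul_eq_zero_iff`), and `f` is holomorphic on `ℍ` and bounded at every cusp
(`ℙ¹(ℚ)`) because it is so as a form on `Γ`. [folklore] -/
theorem exists_modularForm_of_mul_levelOne {Γ Γ' : Subgroup SL(2, ℤ)} [Γ.FiniteIndex]
    [Γ'.FiniteIndex] {k l : ℤ} (f : ModularForm (Γ : Subgroup (GL (Fin 2) ℝ)) k)
    (E : ModularForm 𝒮ℒ l) (hE : (E : ℍ → ℂ) ≠ 0)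
    (g : ModularForm (Γ' : Subgroup (GL (Fin 2) ℝ)) (k + l))
    (hg : (g : ℍ → ℂ) = (f : ℍ → ℂ) * E) :
    ∃ G : ModularForm (Γ' : Subgroup (GL (Fin 2) ℝ)) k, (G : ℍ → ℂ) = f := by
  have hinv : ∀ A ∈ Γ', (f : ℍ → ℂ) ∣[k] (mapGL ℝ A) = f := by
    intro A hA
    have h1 : ((f : ℍ → ℂ) * E) ∣[k + l] (mapGL ℝ A) = (f : ℍ → ℂ) * E := by
      rw [← hg]
      exact g.slash_action_eq' _ (Subgroup.mem_map_of_mem (mapGL ℝ) hA)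
    have h2 : ((f : ℍ → ℂ) * E) ∣[k + l] (mapGL ℝ A) =
        (f : ℍ → ℂ) ∣[k] (mapGL ℝ A) * (E : ℍ → ℂ) ∣[l] (mapGL ℝ A) := by
      rw [ModularForm.mul_slash]
      simp
    have h3 : (E : ℍ → ℂ) ∣[l] (mapGL ℝ A) = E :=
      E.slash_action_eq' _ (MonoidHom.mem_range.mpr ⟨A, rfl⟩)
    rw [h2, h3] at h1
    have h4 : ((f : ℍ → ℂ) ∣[k] (mapGL ℝ A) - f) * (E : ℍ → ℂ) = 0 := by
      rw [sub_mul, h1, sub_self]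
    have h5 := (UpperHalfPlane.mul_eq_zero_iff ((f.holo'.slash k _).sub f.holo') E.holo').mp h4
    exact sub_eq_zero.mp (h5.resolve_right hE)
  refine ⟨{ toFun := f
            slash_action_eq' := fun γ hγ ↦ ?_
            holo' := f.holo'
            bdd_at_cusps' := fun hc ↦ f.bdd_at_cusps' (isCusp_of_isCusp hc) }, rfl⟩
  obtain ⟨A, hA, rfl⟩ := Subgroup.mem_map.mp hγ
  exact hinv A hA


/-! ### D. Consequences for the fact: weight raising -/

/-- `E₄` is not identically zero on `ℍ` (its constant term is `1`). [folklore] -/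
private theorem coe_E₄_ne_zero : ((ModularForm.E₄ : ModularForm 𝒮ℒ 4) : ℍ → ℂ) ≠ 0 := fun h ↦
  EisensteinSeries.E_ne_zero (k := 4) (by norm_num) (by decide)
    (DFunLike.ext' (h.trans ModularForm.coe_zero.symm))

/-- **Weight raising, pointwise.** For a weight-`k` form `f` on a finite-index `Γ ≤ SL(2, ℤ)` with
integral `q`-expansion at the positive strict period `h`: if the conclusion of the unbounded
denominators theorem holds for the weight-`(k+4)` integral form `f · E₄` on `Γ`, then it holds for
`f` (untwist by `E₄`). [folklore] (the device replaces the weight-zero reduction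
`f ↦ f · (λ/16 η(τ/2)²)ᵏ` of [cite: CalegariDimitrovTang2025, §1 p. 3]) -/
theorem CalegariDimitrovTang2025_unboundedDenominators.conclusion_of_mul_E₄
    (Γ : Subgroup SL(2, ℤ)) [Γ.FiniteIndex] (k : ℤ)
    (f : ModularForm (Γ : Subgroup (GL (Fin 2) ℝ)) k) (h : ℕ) (hh : 0 < h)
    (hΓ : (h : ℝ) ∈ (Γ : Subgroup (GL (Fin 2) ℝ)).strictPeriods)
    (hint : ∀ n : ℕ, ∃ z : ℤ, PowerSeries.coeff n (qExpansion (h : ℝ) f) = (z : ℂ))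
    (H : ∀ F : ModularForm (Γ : Subgroup (GL (Fin 2) ℝ)) (k + 4),
      (F : ℍ → ℂ) = (f : ℍ → ℂ) * ModularForm.E₄ →
      (∀ n : ℕ, ∃ z : ℤ, PowerSeries.coeff n (qExpansion (h : ℝ) F) = (z : ℂ)) →
      ∃ (Γ' : Subgroup SL(2, ℤ)) (g : ModularForm (Γ' : Subgroup (GL (Fin 2) ℝ)) (k + 4)),
        IsCongruenceSubgroup Γ' ∧ (g : ℍ → ℂ) = F) :
    ∃ (Γ' : Subgroup SL(2, ℤ)) (g : ModularForm (Γ' : Subgroup (GL (Fin 2) ℝ)) k),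
      IsCongruenceSubgroup Γ' ∧ (g : ℍ → ℂ) = f := by
  obtain ⟨F, hF, hFint⟩ := exists_modularForm_mul_E₄ Γ k f hh hΓ hint
  obtain ⟨Γ', g, hΓ', hg⟩ := H F hF hFint
  haveI := hΓ'.finiteIndex
  obtain ⟨G, hG⟩ := exists_modularForm_of_mul_levelOne f ModularForm.E₄ coe_E₄_ne_zero g
    (hg.trans hF)
  exact ⟨Γ', G, hΓ', hG⟩

/-- **Weight raising.** The unbounded denominators theorem follows from its restriction to
weights `k ≥ K₀`, for any `K₀` (twist by powers of `E₄`); with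
`CalegariDimitrovTang2025_unboundedDenominators.of_pos_weight_case` (weights `≤ 0` are settled)
this shows that the weight may be taken in any prescribed final segment of `ℤ`.
[folklore] (compare the reduction of the weight in [cite: CalegariDimitrovTang2025, §1 p. 3]) -/
theorem CalegariDimitrovTang2025_unboundedDenominators.of_large_weight (K₀ : ℤ)
    (H : ∀ (Γ : Subgroup SL(2, ℤ)) [Γ.FiniteIndex] (k : ℤ), K₀ ≤ k →
      ∀ (f : ModularForm (Γ : Subgroup (GL (Fin 2) ℝ)) k) (h : ℕ), 0 < h →
      ((h : ℝ) ∈ (Γ : Subgroup (GL (Fin 2) ℝ)).strictPeriods) →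
      (∀ n : ℕ, ∃ z : ℤ, PowerSeries.coeff n (qExpansion (h : ℝ) f) = (z : ℂ)) →
      ∃ (Γ' : Subgroup SL(2, ℤ)) (g : ModularForm (Γ' : Subgroup (GL (Fin 2) ℝ)) k),
        IsCongruenceSubgroup Γ' ∧ (g : ℍ → ℂ) = f) :
    CalegariDimitrovTang2025_unboundedDenominators := by
  -- `P n`: the fact in all weights `k` with `K₀ - k ≤ 4 n`, by induction on `n`.
  suffices ∀ (n : ℕ) (Γ : Subgroup SL(2, ℤ)) [Γ.FiniteIndex] (k : ℤ), K₀ - k ≤ 4 * n →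
      ∀ (f : ModularForm (Γ : Subgroup (GL (Fin 2) ℝ)) k) (h : ℕ), 0 < h →
      ((h : ℝ) ∈ (Γ : Subgroup (GL (Fin 2) ℝ)).strictPeriods) →
      (∀ n : ℕ, ∃ z : ℤ, PowerSeries.coeff n (qExpansion (h : ℝ) f) = (z : ℂ)) →
      ∃ (Γ' : Subgroup SL(2, ℤ)) (g : ModularForm (Γ' : Subgroup (GL (Fin 2) ℝ)) k),
        IsCongruenceSubgroup Γ' ∧ (g : ℍ → ℂ) = f by
    intro Γ _ k f h hh hΓ hint
    exact this (K₀ - k).toNat Γ k (by omega) f h hh hΓ hint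
  intro n
  induction n with
  | zero => exact fun Γ _ k hk ↦ H Γ k (by omega)
  | succ n ih =>
    intro Γ _ k hk f h hh hΓ hint
    exact CalegariDimitrovTang2025_unboundedDenominators.conclusion_of_mul_E₄ Γ k f h hh hΓ hint
      fun F _ hFint ↦ ih Γ (k + 4) (by omega) F h hh hΓ hFint

/-! ### E. Odd weight -/

/-- **Odd weight, `-1 ∈ Γ`.** A modular form of odd weight on a subgroup `Γ ≤ SL(2, ℤ)`
containing `-1` vanishes (Mathlib's `ModularForm.eq_zero_of_neg_one_mem`), so the conclusion of the
unbounded denominators theorem holds trivially for it (`g = 0` on `Γ(1)`); in odd weight the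
theorem thus concerns only levels `Γ ∌ -1`. [folklore] -/
theorem CalegariDimitrovTang2025_unboundedDenominators.conclusion_of_odd_weight_of_neg_one_mem
    (Γ : Subgroup SL(2, ℤ)) {k : ℤ} (hk : Odd k) (hE : (-1 : SL(2, ℤ)) ∈ Γ)
    (f : ModularForm (Γ : Subgroup (GL (Fin 2) ℝ)) k) :
    ∃ (Γ' : Subgroup SL(2, ℤ)) (g : ModularForm (Γ' : Subgroup (GL (Fin 2) ℝ)) k),
      IsCongruenceSubgroup Γ' ∧ (g : ℍ → ℂ) = f := by
  have hE' : (-1 : GL (Fin 2) ℝ) ∈ (Γ : Subgroup (GL (Fin 2) ℝ)) :=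
    Subgroup.mem_map.mpr ⟨-1, hE, mapGL_neg_one⟩
  refine ⟨Gamma 1, 0, Gamma_is_cong_sub 1, ?_⟩
  rw [ModularForm.eq_zero_of_neg_one_mem hE' hk f, ModularForm.coe_zero, ModularForm.coe_zero]

/-! ### F. Equivalent forms: bounded denominators and the contrapositive -/

/-- **Bounded denominators form.** The unbounded denominators theorem is equivalent to its
version for forms whose `q`-expansion coefficients have *bounded denominators* — `D · aₙ ∈ ℤ`
for one `D ≥ 1` and all `n` — (apply the theorem to `D · f` and divide the resulting congruence
form by `D`). [cite: CalegariDimitrovTang2025, §1 p. 3, the sentence following Theorem 1] -/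
theorem CalegariDimitrovTang2025_unboundedDenominators.iff_boundedDenominators :
    CalegariDimitrovTang2025_unboundedDenominators ↔
    ∀ (Γ : Subgroup SL(2, ℤ)) [Γ.FiniteIndex] (k : ℤ)
      (f : ModularForm (Γ : Subgroup (GL (Fin 2) ℝ)) k) (h : ℕ), 0 < h →
      ((h : ℝ) ∈ (Γ : Subgroup (GL (Fin 2) ℝ)).strictPeriods) →
      (∃ D : ℕ, D ≠ 0 ∧
        ∀ n : ℕ, ∃ z : ℤ, (D : ℂ) * PowerSeries.coeff n (qExpansion (h : ℝ) f) = (z : ℂ)) →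
      ∃ (Γ' : Subgroup SL(2, ℤ)) (g : ModularForm (Γ' : Subgroup (GL (Fin 2) ℝ)) k),
        IsCongruenceSubgroup Γ' ∧ (g : ℍ → ℂ) = f := by
  constructor
  · intro hCDT Γ _ k f h hh hΓ ⟨D, hD, hint⟩
    have hh' : (0 : ℝ) < h := Nat.cast_pos.mpr hh
    have hD' : (D : ℂ) ≠ 0 := Nat.cast_ne_zero.mpr hD
    obtain ⟨Γ', g, hΓ', hg⟩ := hCDT Γ k ((D : ℂ) • f) h hh hΓ fun n ↦ by
      rw [ModularForm.IsGLPos.coe_smul, ModularForm.qExpansion_smul hh' hΓ, map_smul,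
        smul_eq_mul]
      exact hint n
    refine ⟨Γ', (D : ℂ)⁻¹ • g, hΓ', ?_⟩
    rw [ModularForm.IsGLPos.coe_smul, hg, ModularForm.IsGLPos.coe_smul, smul_smul,
      inv_mul_cancel₀ hD', one_smul]
  · intro H Γ _ k f h hh hΓ hint
    exact H Γ k f h hh hΓ ⟨1, one_ne_zero, fun n ↦ by simpa using hint n⟩

/-- **The contrapositive, as printed** [cite: CalegariDimitrovTang2025, §1 p. 3]: "if
`f(τ) ∈ ℚ⟦q^{1/N}⟧` is a modular form which is not modular for some congruence subgroup, then the
coefficients of `f(τ)` have unbounded denominators" — for every `D ≥ 1` some `D · aₙ` fails to be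
a rational integer. Equivalent to the fact (holomorphic-at-the-cusps rendering, as for the fact
itself). -/
theorem CalegariDimitrovTang2025_unboundedDenominators.iff_unboundedDenominators :
    CalegariDimitrovTang2025_unboundedDenominators ↔
    ∀ (Γ : Subgroup SL(2, ℤ)) [Γ.FiniteIndex] (k : ℤ)
      (f : ModularForm (Γ : Subgroup (GL (Fin 2) ℝ)) k) (h : ℕ), 0 < h →
      ((h : ℝ) ∈ (Γ : Subgroup (GL (Fin 2) ℝ)).strictPeriods) →
      (∀ n : ℕ, ∃ r : ℚ, PowerSeries.coeff n (qExpansion (h : ℝ) f) = (r : ℂ)) →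
      (¬ ∃ (Γ' : Subgroup SL(2, ℤ)) (g : ModularForm (Γ' : Subgroup (GL (Fin 2) ℝ)) k),
        IsCongruenceSubgroup Γ' ∧ (g : ℍ → ℂ) = f) →
      ∀ D : ℕ, D ≠ 0 →
        ∃ n : ℕ, ∀ z : ℤ, (D : ℂ) * PowerSeries.coeff n (qExpansion (h : ℝ) f) ≠ (z : ℂ) := by
  rw [CalegariDimitrovTang2025_unboundedDenominators.iff_boundedDenominators]
  constructor
  · intro H Γ _ k f h hh hΓ _ hnc D hD
    by_contra hbd
    push Not at hbd
    exact hnc (H Γ k f h hh hΓ ⟨D, hD, hbd⟩)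
  · intro H Γ _ k f h hh hΓ ⟨D, hD, hint⟩
    by_contra hnc
    have hrat : ∀ n : ℕ, ∃ r : ℚ, PowerSeries.coeff n (qExpansion (h : ℝ) f) = (r : ℂ) := by
      intro n
      obtain ⟨z, hz⟩ := hint n
      refine ⟨z / D, ?_⟩
      have hD' : (D : ℂ) ≠ 0 := Nat.cast_ne_zero.mpr hD
      push_cast
      rw [← hz, mul_div_cancel_left₀ _ hD']
    obtain ⟨n, hn⟩ := H Γ k f h hh hΓ hrat hnc D hD
    obtain ⟨z, hz⟩ := hint n
    exact hn z hz

/-! ### G. The core case -/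

/-- **Reduction to the core case, pointwise.** Fix `M ≥ 1`. For a weight-`k` form `f` on a
finite-index `Γ ≤ SL(2, ℤ)` with integral `q`-expansion at the positive strict period `h`, the
conclusion of the unbounded denominators theorem holds for `f` as soon as it holds for every
restriction `f₀` of `f` (same function, same weight) to a *normal*, *noncongruence*, finite-index
level `Γ₀ ≤ Γ ∩ Γ(M)` on which `f₀ ≠ 0` has rational-integer `q`-expansion at the exact cusp width
`strictWidthInfty Γ₀`: restrict `f` to the normal core of `Γ ∩ Γ(M)` (a multiple of `h` is a strict
period there; integrality passes to it and then to the cusp width) and dispose of the congruence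
and zero cases tautologically. Compare the setting `G = G_N` normal, `G ⊂ ⟨E, Γ(N)⟩`, of
[cite: CalegariDimitrovTang2025, §4.2 Lemma 24 and §4.3]. -/
theorem CalegariDimitrovTang2025_unboundedDenominators.conclusion_of_core_case (M : ℕ) [NeZero M]
    (Γ : Subgroup SL(2, ℤ)) [Γ.FiniteIndex] (k : ℤ)
    (f : ModularForm (Γ : Subgroup (GL (Fin 2) ℝ)) k) (h : ℕ) (hh : 0 < h)
    (hΓ : (h : ℝ) ∈ (Γ : Subgroup (GL (Fin 2) ℝ)).strictPeriods)
    (hint : ∀ n : ℕ, ∃ z : ℤ, PowerSeries.coeff n (qExpansion (h : ℝ) f) = (z : ℂ))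
    (H : ∀ (Γ₀ : Subgroup SL(2, ℤ)) [Γ₀.FiniteIndex], Γ₀.Normal → Γ₀ ≤ Γ →
      Γ₀ ≤ CongruenceSubgroup.Gamma M → ¬ IsCongruenceSubgroup Γ₀ →
      ∀ (f₀ : ModularForm (Γ₀ : Subgroup (GL (Fin 2) ℝ)) k), f₀ ≠ 0 → (f₀ : ℍ → ℂ) = f →
      (∀ n : ℕ, ∃ z : ℤ, PowerSeries.coeff n
        (qExpansion (Γ₀ : Subgroup (GL (Fin 2) ℝ)).strictWidthInfty f₀) = (z : ℂ)) →
      ∃ (Γ' : Subgroup SL(2, ℤ)) (g : ModularForm (Γ' : Subgroup (GL (Fin 2) ℝ)) k),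
        IsCongruenceSubgroup Γ' ∧ (g : ℍ → ℂ) = f₀) :
    ∃ (Γ' : Subgroup SL(2, ℤ)) (g : ModularForm (Γ' : Subgroup (GL (Fin 2) ℝ)) k),
      IsCongruenceSubgroup Γ' ∧ (g : ℍ → ℂ) = f := by
  have hh' : (0 : ℝ) < h := Nat.cast_pos.mpr hh
  -- the normal core `Γ₀` of `Γ ∩ Γ(M)`
  let Γ₀ : Subgroup SL(2, ℤ) := (Γ ⊓ CongruenceSubgroup.Gamma M).normalCore
  haveI hΓ₀fi : Γ₀.FiniteIndex := Subgroup.finiteIndex_normalCore _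
  have hΓ₀n : Γ₀.Normal := Subgroup.normalCore_normal _
  have hle : Γ₀ ≤ Γ := (Subgroup.normalCore_le _).trans inf_le_left
  have hleM : Γ₀ ≤ CongruenceSubgroup.Gamma M := (Subgroup.normalCore_le _).trans inf_le_right
  obtain ⟨f₀, hf₀⟩ := exists_modularForm_restrict (Subgroup.map_mono hle :
    ((Γ₀ : Subgroup SL(2, ℤ)) : Subgroup (GL (Fin 2) ℝ)) ≤ (Γ : Subgroup (GL (Fin 2) ℝ))) k f
  -- integrality at a strict period `m h` of `Γ₀`, then at its cusp width
  obtain ⟨m, hm, hΓ₀⟩ := exists_natMul_mem_strictPeriods Γ₀ hΓ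
  have hint₀ : ∀ n : ℕ, ∃ z : ℤ, PowerSeries.coeff n
      (qExpansion ((Γ₀ : Subgroup SL(2, ℤ)) : Subgroup (GL (Fin 2) ℝ)).strictWidthInfty f₀) =
        (z : ℂ) := by
    refine (forall_coeff_qExpansion_iff_of_mem_strictPeriods f₀ (mul_pos (Nat.cast_pos.mpr
      (Nat.pos_of_ne_zero hm)) hh') hΓ₀ (Subgroup.strictWidthInfty_pos _)
      (Subgroup.strictWidthInfty_mem_strictPeriods _) (P := fun x : ℂ ↦ ∃ z : ℤ, x = (z : ℂ))
      ⟨0, by simp⟩).mp fun n ↦ ?_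
    rw [hf₀]
    exact forall_coeff_qExpansion_natMul f hh' hΓ hm (P := fun x : ℂ ↦ ∃ z : ℤ, x = (z : ℂ))
      ⟨0, by simp⟩ hint n
  -- the conclusion for `f₀` is the conclusion for `f`
  rw [← hf₀]
  by_cases hcong : IsCongruenceSubgroup Γ₀
  · exact ⟨Γ₀, f₀, hcong, rfl⟩
  by_cases hzero : f₀ = 0
  · refine ⟨Gamma 1, 0, Gamma_is_cong_sub 1, ?_⟩
    rw [hzero, ModularForm.coe_zero, ModularForm.coe_zero]
  exact H Γ₀ hΓ₀n hle hleM hcong f₀ hzero hf₀ hint₀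

/-- **Reduction to the core case.** Fix any `M ≥ 1` and any `K₀ ∈ ℤ`. The unbounded denominators
theorem `CalegariDimitrovTang2025_unboundedDenominators` follows from — hence is equivalent to —
its special case where

* the level `Γ` is a *normal* finite-index subgroup of `SL(2, ℤ)` contained in `Γ(M)` which is
  *not* a congruence subgroup,
* the weight satisfies `k ≥ K₀`,
* the form `f` is non-zero, and
* its `q`-expansion at the exact cusp width `strictWidthInfty Γ` of `Γ` at `∞` (rather than at an
  auxiliary period) has rational-integer coefficients.

(Weight raising `…of_large_weight`, then `…conclusion_of_core_case`.) Compare the setting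
`G = G_N` normal, `G ⊂ ⟨E, Γ(N)⟩`, of [cite: CalegariDimitrovTang2025, §4.2 Lemma 24 and §4.3]. -/
theorem CalegariDimitrovTang2025_unboundedDenominators.of_core (M : ℕ) [NeZero M] (K₀ : ℤ)
    (H : ∀ (Γ : Subgroup SL(2, ℤ)) [Γ.FiniteIndex], Γ.Normal → Γ ≤ CongruenceSubgroup.Gamma M →
      ¬ IsCongruenceSubgroup Γ → ∀ (k : ℤ), K₀ ≤ k →
      ∀ (f : ModularForm (Γ : Subgroup (GL (Fin 2) ℝ)) k), f ≠ 0 →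
      (∀ n : ℕ, ∃ z : ℤ, PowerSeries.coeff n
        (qExpansion (Γ : Subgroup (GL (Fin 2) ℝ)).strictWidthInfty f) = (z : ℂ)) →
      ∃ (Γ' : Subgroup SL(2, ℤ)) (g : ModularForm (Γ' : Subgroup (GL (Fin 2) ℝ)) k),
        IsCongruenceSubgroup Γ' ∧ (g : ℍ → ℂ) = f) :
    CalegariDimitrovTang2025_unboundedDenominators :=
  CalegariDimitrovTang2025_unboundedDenominators.of_large_weight K₀
    fun Γ _ k hk f h hh hΓ hint ↦
      CalegariDimitrovTang2025_unboundedDenominators.conclusion_of_core_case M Γ k f h hh hΓ hint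
        fun Γ₀ _ hΓ₀n _ hleM hcong f₀ hzero _ hint₀ ↦ H Γ₀ hΓ₀n hleM hcong k hk f₀ hzero hint₀

/-! ### H. Twisting by `E₆`; reduction of even weights to weights divisible by `12` -/

/-- `B₆ = 1/42` (Mathlib stops at `B₄`). [folklore] -/
private theorem bernoulli'_six : bernoulli' 6 = 1 / 42 := by
  have h2 : Nat.choose 6 2 = 15 := by decide
  have h3 : Nat.choose 6 3 = 20 := by decide
  have h4 : Nat.choose 6 4 = 15 := by decide
  have h5 : Nat.choose 6 5 = 6 := by decide
  have h5' : bernoulli' 5 = 0 := bernoulli'_eq_zero_of_odd (by decide) (by norm_num)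
  rw [bernoulli'_def]
  norm_num [Finset.sum_range_succ, Finset.sum_range_zero, h2, h3, h4, h5, h5']

/-- The `q`-expansion of the normalised weight-6 Eisenstein series, `E₆ = 1 - 504 Σ σ₅(n) qⁿ`.
[folklore] -/
theorem E₆_qExpansion_coeff (m : ℕ) :
    PowerSeries.coeff m (qExpansion 1 ModularForm.E₆) =
      if m = 0 then 1 else -504 * (ArithmeticFunction.sigma 5 m : ℂ) := by
  have hb : bernoulli 6 = 1 / 42 := by
    rw [bernoulli_eq_bernoulli'_of_ne_one (by norm_num), bernoulli'_six]
  rw [ModularForm.E₆, EisensteinSeries.E_qExpansion_coeff (by norm_num) (by decide) m, hb]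
  split_ifs
  · rfl
  · push_cast
    norm_num

/-- `E₆` has rational-integer `q`-expansion coefficients at every positive integer period.
[folklore] -/
theorem E₆_qExpansion_natCast_coeff_int {h : ℕ} (hh : h ≠ 0) (j : ℕ) :
    ∃ z : ℤ, PowerSeries.coeff j (qExpansion (h : ℝ) ModularForm.E₆) = (z : ℂ) := by
  have h1 : ∀ m, ∃ z : ℤ, PowerSeries.coeff m (qExpansion 1 ModularForm.E₆) = (z : ℂ) := by
    intro m
    rw [E₆_qExpansion_coeff]
    split_ifs
    · exact ⟨1, by simp⟩
    · exact ⟨-504 * ArithmeticFunction.sigma 5 m, by push_cast; rfl⟩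
  have := forall_coeff_qExpansion_natMul ModularForm.E₆ one_pos one_mem_strictPeriods_SL hh
    (P := fun x : ℂ ↦ ∃ z : ℤ, x = (z : ℂ)) ⟨0, by simp⟩ h1 j
  simpa only [mul_one] using this

/-- `E₆` is not identically zero on `ℍ`. [folklore] -/
private theorem coe_E₆_ne_zero : ((ModularForm.E₆ : ModularForm 𝒮ℒ 6) : ℍ → ℂ) ≠ 0 := fun h ↦
  EisensteinSeries.E_ne_zero (k := 6) (by norm_num) (by decide)
    (DFunLike.ext' (h.trans ModularForm.coe_zero.symm))

/-- **Twisting by a level-one form with integral expansion** (common generalization of the `E₄`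
and `E₆` twists): `f ↦ f · E` preserves "modular of level `Γ` with rational-integer
`q`-expansion at the integer period `h`", adding the weight of `E`. [folklore] -/
theorem exists_modularForm_mul_levelOne (Γ : Subgroup SL(2, ℤ)) (k : ℤ) {l : ℤ}
    (f : ModularForm (Γ : Subgroup (GL (Fin 2) ℝ)) k) (E : ModularForm 𝒮ℒ l) {h : ℕ} (hh : 0 < h)
    (hΓ : (h : ℝ) ∈ (Γ : Subgroup (GL (Fin 2) ℝ)).strictPeriods)
    (hE : ∀ n : ℕ, ∃ z : ℤ, PowerSeries.coeff n (qExpansion (h : ℝ) E) = (z : ℂ))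
    (hint : ∀ n : ℕ, ∃ z : ℤ, PowerSeries.coeff n (qExpansion (h : ℝ) f) = (z : ℂ)) :
    ∃ F : ModularForm (Γ : Subgroup (GL (Fin 2) ℝ)) (k + l),
      (F : ℍ → ℂ) = (f : ℍ → ℂ) * E ∧
      ∀ n : ℕ, ∃ z : ℤ, PowerSeries.coeff n (qExpansion (h : ℝ) F) = (z : ℂ) := by
  have hh' : (0 : ℝ) < h := Nat.cast_pos.mpr hh
  obtain ⟨E', hE'⟩ := exists_modularForm_restrict (Subgroup.map_le_range (mapGL ℝ) (H := Γ)) l E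
  refine ⟨f.mul E', by rw [ModularForm.coe_mul, hE'], fun n ↦ ?_⟩
  rw [ModularForm.qExpansion_mul hh' hΓ, exists_int_iff_mem_range]
  refine coeff_mul_mem _ (fun m ↦ (exists_int_iff_mem_range _).mp (hint m)) (fun m ↦ ?_) n
  rw [← exists_int_iff_mem_range, hE']
  exact hE m

/-- **Weight raising by `6`, pointwise** (twist by `E₆`, untwist by
`exists_modularForm_of_mul_levelOne`). [folklore] -/
theorem CalegariDimitrovTang2025_unboundedDenominators.conclusion_of_mul_E₆
    (Γ : Subgroup SL(2, ℤ)) [Γ.FiniteIndex] (k : ℤ)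
    (f : ModularForm (Γ : Subgroup (GL (Fin 2) ℝ)) k) (h : ℕ) (hh : 0 < h)
    (hΓ : (h : ℝ) ∈ (Γ : Subgroup (GL (Fin 2) ℝ)).strictPeriods)
    (hint : ∀ n : ℕ, ∃ z : ℤ, PowerSeries.coeff n (qExpansion (h : ℝ) f) = (z : ℂ))
    (H : ∀ F : ModularForm (Γ : Subgroup (GL (Fin 2) ℝ)) (k + 6),
      (F : ℍ → ℂ) = (f : ℍ → ℂ) * ModularForm.E₆ →
      (∀ n : ℕ, ∃ z : ℤ, PowerSeries.coeff n (qExpansion (h : ℝ) F) = (z : ℂ)) →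
      ∃ (Γ' : Subgroup SL(2, ℤ)) (g : ModularForm (Γ' : Subgroup (GL (Fin 2) ℝ)) (k + 6)),
        IsCongruenceSubgroup Γ' ∧ (g : ℍ → ℂ) = F) :
    ∃ (Γ' : Subgroup SL(2, ℤ)) (g : ModularForm (Γ' : Subgroup (GL (Fin 2) ℝ)) k),
      IsCongruenceSubgroup Γ' ∧ (g : ℍ → ℂ) = f := by
  obtain ⟨F, hF, hFint⟩ := exists_modularForm_mul_levelOne Γ k f ModularForm.E₆ hh hΓ
    (E₆_qExpansion_natCast_coeff_int hh.ne') hint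
  obtain ⟨Γ', g, hΓ', hg⟩ := H F hF hFint
  haveI := hΓ'.finiteIndex
  obtain ⟨G, hG⟩ := exists_modularForm_of_mul_levelOne f ModularForm.E₆ coe_E₆_ne_zero g
    (hg.trans hF)
  exact ⟨Γ', G, hΓ', hG⟩

/-- Slice transport, `+4`: if the fact holds in all weights `k` with `P k`, it holds in all weights
`k` with `P (k + 4)`. [folklore] -/
private theorem slice_of_slice_add_four (P : ℤ → Prop)
    (H : ∀ (Γ : Subgroup SL(2, ℤ)) [Γ.FiniteIndex] (k : ℤ), P k →
      ∀ (f : ModularForm (Γ : Subgroup (GL (Fin 2) ℝ)) k) (h : ℕ), 0 < h →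
      ((h : ℝ) ∈ (Γ : Subgroup (GL (Fin 2) ℝ)).strictPeriods) →
      (∀ n : ℕ, ∃ z : ℤ, PowerSeries.coeff n (qExpansion (h : ℝ) f) = (z : ℂ)) →
      ∃ (Γ' : Subgroup SL(2, ℤ)) (g : ModularForm (Γ' : Subgroup (GL (Fin 2) ℝ)) k),
        IsCongruenceSubgroup Γ' ∧ (g : ℍ → ℂ) = f)
    (Γ : Subgroup SL(2, ℤ)) [Γ.FiniteIndex] (k : ℤ) (hk : P (k + 4))
    (f : ModularForm (Γ : Subgroup (GL (Fin 2) ℝ)) k) (h : ℕ) (hh : 0 < h)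
    (hΓ : (h : ℝ) ∈ (Γ : Subgroup (GL (Fin 2) ℝ)).strictPeriods)
    (hint : ∀ n : ℕ, ∃ z : ℤ, PowerSeries.coeff n (qExpansion (h : ℝ) f) = (z : ℂ)) :
    ∃ (Γ' : Subgroup SL(2, ℤ)) (g : ModularForm (Γ' : Subgroup (GL (Fin 2) ℝ)) k),
      IsCongruenceSubgroup Γ' ∧ (g : ℍ → ℂ) = f :=
  CalegariDimitrovTang2025_unboundedDenominators.conclusion_of_mul_E₄ Γ k f h hh hΓ hint
    fun F _ hFint ↦ H Γ (k + 4) hk F h hh hΓ hFint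

/-- Slice transport, `+6`. [folklore] -/
private theorem slice_of_slice_add_six (P : ℤ → Prop)
    (H : ∀ (Γ : Subgroup SL(2, ℤ)) [Γ.FiniteIndex] (k : ℤ), P k →
      ∀ (f : ModularForm (Γ : Subgroup (GL (Fin 2) ℝ)) k) (h : ℕ), 0 < h →
      ((h : ℝ) ∈ (Γ : Subgroup (GL (Fin 2) ℝ)).strictPeriods) →
      (∀ n : ℕ, ∃ z : ℤ, PowerSeries.coeff n (qExpansion (h : ℝ) f) = (z : ℂ)) →
      ∃ (Γ' : Subgroup SL(2, ℤ)) (g : ModularForm (Γ' : Subgroup (GL (Fin 2) ℝ)) k),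
        IsCongruenceSubgroup Γ' ∧ (g : ℍ → ℂ) = f)
    (Γ : Subgroup SL(2, ℤ)) [Γ.FiniteIndex] (k : ℤ) (hk : P (k + 6))
    (f : ModularForm (Γ : Subgroup (GL (Fin 2) ℝ)) k) (h : ℕ) (hh : 0 < h)
    (hΓ : (h : ℝ) ∈ (Γ : Subgroup (GL (Fin 2) ℝ)).strictPeriods)
    (hint : ∀ n : ℕ, ∃ z : ℤ, PowerSeries.coeff n (qExpansion (h : ℝ) f) = (z : ℂ)) :
    ∃ (Γ' : Subgroup SL(2, ℤ)) (g : ModularForm (Γ' : Subgroup (GL (Fin 2) ℝ)) k),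
      IsCongruenceSubgroup Γ' ∧ (g : ℍ → ℂ) = f :=
  CalegariDimitrovTang2025_unboundedDenominators.conclusion_of_mul_E₆ Γ k f h hh hΓ hint
    fun F _ hFint ↦ H Γ (k + 6) hk F h hh hΓ hFint

/-- **Reduction of the weight to multiples of `12` (even weight) and to odd weight on levels not
containing `-1`.** The unbounded denominators theorem follows from the conjunction of
(i) its case of weight `k = 12 m`, `m ≥ 1` — where `f ↦ f / Δᵐ` identifies the forms in question
with the weight-`0` modular functions, holomorphic on `ℍ`, of the printed proof
([cite: CalegariDimitrovTang2025, §4.2 Definition 22], the algebras `R_N`) — and (ii) its case of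
odd weight `k ≥ 1` on finite-index levels `Γ ∌ -1`. Reductions used: weights `≤ 0` are settled
(`…of_weight_nonpos`); odd weight with `-1 ∈ Γ` is trivial; an even weight `k ≥ 2` is moved to
`k + r ≡ 0 (mod 12)`, `r ∈ {0, 4, 6, 8, 10, 14}`, by `E₄`- and `E₆`-twists. [folklore] -/
theorem CalegariDimitrovTang2025_unboundedDenominators.of_weight_twelve_mul_and_odd
    (H12 : ∀ (Γ : Subgroup SL(2, ℤ)) [Γ.FiniteIndex] (m : ℕ), 1 ≤ m →
      ∀ (f : ModularForm (Γ : Subgroup (GL (Fin 2) ℝ)) (12 * (m : ℤ))) (h : ℕ), 0 < h →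
      ((h : ℝ) ∈ (Γ : Subgroup (GL (Fin 2) ℝ)).strictPeriods) →
      (∀ n : ℕ, ∃ z : ℤ, PowerSeries.coeff n (qExpansion (h : ℝ) f) = (z : ℂ)) →
      ∃ (Γ' : Subgroup SL(2, ℤ)) (g : ModularForm (Γ' : Subgroup (GL (Fin 2) ℝ)) (12 * (m : ℤ))),
        IsCongruenceSubgroup Γ' ∧ (g : ℍ → ℂ) = f)
    (Hodd : ∀ (Γ : Subgroup SL(2, ℤ)) [Γ.FiniteIndex], (-1 : SL(2, ℤ)) ∉ Γ → ∀ (k : ℤ), Odd k →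
      1 ≤ k → ∀ (f : ModularForm (Γ : Subgroup (GL (Fin 2) ℝ)) k) (h : ℕ), 0 < h →
      ((h : ℝ) ∈ (Γ : Subgroup (GL (Fin 2) ℝ)).strictPeriods) →
      (∀ n : ℕ, ∃ z : ℤ, PowerSeries.coeff n (qExpansion (h : ℝ) f) = (z : ℂ)) →
      ∃ (Γ' : Subgroup SL(2, ℤ)) (g : ModularForm (Γ' : Subgroup (GL (Fin 2) ℝ)) k),
        IsCongruenceSubgroup Γ' ∧ (g : ℍ → ℂ) = f) :
    CalegariDimitrovTang2025_unboundedDenominators := by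
  -- the slice `P k := 12 ∣ k ∧ 1 ≤ k` holds by `H12`
  have S0 : ∀ (Γ : Subgroup SL(2, ℤ)) [Γ.FiniteIndex] (k : ℤ), (12 ∣ k ∧ 1 ≤ k) →
      ∀ (f : ModularForm (Γ : Subgroup (GL (Fin 2) ℝ)) k) (h : ℕ), 0 < h →
      ((h : ℝ) ∈ (Γ : Subgroup (GL (Fin 2) ℝ)).strictPeriods) →
      (∀ n : ℕ, ∃ z : ℤ, PowerSeries.coeff n (qExpansion (h : ℝ) f) = (z : ℂ)) →
      ∃ (Γ' : Subgroup SL(2, ℤ)) (g : ModularForm (Γ' : Subgroup (GL (Fin 2) ℝ)) k),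
        IsCongruenceSubgroup Γ' ∧ (g : ℍ → ℂ) = f := by
    intro Γ _ k ⟨⟨m, hm⟩, hk⟩
    subst hm
    lift m to ℕ using by omega
    exact H12 Γ m (by omega)
  have S4 := slice_of_slice_add_four _ S0
  have S6 := slice_of_slice_add_six _ S0
  have S8 := slice_of_slice_add_four _ S4
  have S10 := slice_of_slice_add_six _ S4
  have S14 := slice_of_slice_add_six _ S8
  refine CalegariDimitrovTang2025_unboundedDenominators.of_pos_weight_case
    fun Γ _ k hk f h hh hΓ hint ↦ ?_
  rcases Int.even_or_odd k with hev | hodd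
  · -- even weight `k ≥ 2`: dispatch on `k mod 12`
    have hk12 : k % 12 = 0 ∨ k % 12 = 2 ∨ k % 12 = 4 ∨ k % 12 = 6 ∨ k % 12 = 8 ∨ k % 12 = 10 := by
      obtain ⟨r, hr⟩ := hev
      omega
    rcases hk12 with h0 | h2 | h4 | h6 | h8 | h10
    · exact S0 Γ k ⟨by omega, hk⟩ f h hh hΓ hint
    · exact S10 Γ k ⟨by omega, by omega⟩ f h hh hΓ hint
    · exact S8 Γ k ⟨by omega, by omega⟩ f h hh hΓ hint
    · exact S6 Γ k ⟨by omega, by omega⟩ f h hh hΓ hint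
    · exact S4 Γ k ⟨by omega, by omega⟩ f h hh hΓ hint
    · exact S14 Γ k ⟨by omega, by omega⟩ f h hh hΓ hint
  · by_cases hE : (-1 : SL(2, ℤ)) ∈ Γ
    · exact CalegariDimitrovTang2025_unboundedDenominators.conclusion_of_odd_weight_of_neg_one_mem
        Γ hodd hE f
    · exact Hodd Γ hE k hodd hk f h hh hΓ hint

/-! ### I. The core case in weights `12 m` and odd weights -/

/-- **The core case, final form.** Fix `M ≥ 1`. The unbounded denominators theorem
`CalegariDimitrovTang2025_unboundedDenominators` follows from — hence is equivalent to — the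
conjunction of its two core cases, both for a *normal*, *noncongruence*, finite-index level
`Γ ≤ Γ(M)`, a *non-zero* form and rational-integer `q`-expansion at the exact cusp width of `Γ`:
(i) weight `12 m`, `m ≥ 1` (equivalently, dividing by `Δᵐ`: non-constant weight-`0` modular
functions holomorphic on `ℍ` with poles of order `≤ m` at the cusps — the printed setting
[cite: CalegariDimitrovTang2025, §4.2 Definition 22 and §4.3]); (ii) odd weight `k ≥ 1` with
`-1 ∉ Γ`. (`…of_weight_twelve_mul_and_odd`, then `…conclusion_of_core_case` in each weight.) -/
theorem CalegariDimitrovTang2025_unboundedDenominators.of_core_twelve_mul_and_odd (M : ℕ) [NeZero M]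
    (H12 : ∀ (Γ : Subgroup SL(2, ℤ)) [Γ.FiniteIndex], Γ.Normal → Γ ≤ CongruenceSubgroup.Gamma M →
      ¬ IsCongruenceSubgroup Γ → ∀ (m : ℕ), 1 ≤ m →
      ∀ (f : ModularForm (Γ : Subgroup (GL (Fin 2) ℝ)) (12 * (m : ℤ))), f ≠ 0 →
      (∀ n : ℕ, ∃ z : ℤ, PowerSeries.coeff n
        (qExpansion (Γ : Subgroup (GL (Fin 2) ℝ)).strictWidthInfty f) = (z : ℂ)) →
      ∃ (Γ' : Subgroup SL(2, ℤ)) (g : ModularForm (Γ' : Subgroup (GL (Fin 2) ℝ)) (12 * (m : ℤ))),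
        IsCongruenceSubgroup Γ' ∧ (g : ℍ → ℂ) = f)
    (Hodd : ∀ (Γ : Subgroup SL(2, ℤ)) [Γ.FiniteIndex], Γ.Normal → Γ ≤ CongruenceSubgroup.Gamma M →
      ¬ IsCongruenceSubgroup Γ → (-1 : SL(2, ℤ)) ∉ Γ → ∀ (k : ℤ), Odd k → 1 ≤ k →
      ∀ (f : ModularForm (Γ : Subgroup (GL (Fin 2) ℝ)) k), f ≠ 0 →
      (∀ n : ℕ, ∃ z : ℤ, PowerSeries.coeff n
        (qExpansion (Γ : Subgroup (GL (Fin 2) ℝ)).strictWidthInfty f) = (z : ℂ)) →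
      ∃ (Γ' : Subgroup SL(2, ℤ)) (g : ModularForm (Γ' : Subgroup (GL (Fin 2) ℝ)) k),
        IsCongruenceSubgroup Γ' ∧ (g : ℍ → ℂ) = f) :
    CalegariDimitrovTang2025_unboundedDenominators := by
  refine CalegariDimitrovTang2025_unboundedDenominators.of_weight_twelve_mul_and_odd ?_ ?_
  · intro Γ _ m hm f h hh hΓ hint
    refine CalegariDimitrovTang2025_unboundedDenominators.conclusion_of_core_case M Γ _ f h hh hΓ
      hint fun Γ₀ _ hΓ₀n _ hleM hcong f₀ hzero _ hint₀ ↦ H12 Γ₀ hΓ₀n hleM hcong m hm f₀ hzero hint₀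
  · intro Γ _ hE k hk hk1 f h hh hΓ hint
    refine CalegariDimitrovTang2025_unboundedDenominators.conclusion_of_core_case M Γ k f h hh hΓ
      hint fun Γ₀ _ hΓ₀n hle hleM hcong f₀ hzero _ hint₀ ↦
        Hodd Γ₀ hΓ₀n hleM hcong (fun h1 ↦ hE (hle h1)) k hk hk1 f₀ hzero hint₀

/-! ### J. `θ²` as a weight-one congruence modular form with integral `q`-expansion

To remove the odd-weight residue of part H we need ONE modular form of odd weight on a congruence
subgroup, with rational-integer `q`-expansion and not identically zero. We take `θ(τ)²`,
`θ(τ) = Σ_{n ∈ ℤ} e^{πin²τ}` (Mathlib's `jacobiTheta`), and prove from Mathlib's `θ`-API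
(`jacobiTheta_S_smul`, `jacobiTheta_T_sq_smul`, the functional equation of `jacobiTheta₂`,
`mdifferentiable_jacobiTheta`) that it is a weight-`1` modular form on the stabiliser
`K = {γ ∈ SL(2, ℤ) | θ²|₁γ = θ²}`, a congruence subgroup: `K ⊇ Γ(4)` because
`Γ(4) ⊆ ⟨T², S T² S⁻¹⟩` (Sanov's generators of `{[a b; c d] : a ≡ d ≡ 1 (4), b ≡ c ≡ 0 (2)}`,
Euclidean descent) and `θ²` is fixed by `T²` and `S T² S⁻¹`; boundedness at all cusps comes from
the coset decomposition `SL(2, ℤ) = Γ_θ ∪ Γ_θ T ∪ Γ_θ T S` (`Γ_θ ⊇ ⟨S, T²⟩`, on which `θ²`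
transforms by fourth roots of unity) and estimates at `1`, `T`, `T S`; the `q`-expansion at
period `2` is `θ² = Σ r₂(m) qᵐ ∈ ℤ⟦q⟧`, `q = e^{πiτ}`. All of this is classical
(Jacobi; e.g. the theta multiplier system) and recorded here only as far as needed. [folklore]
-/

section ThetaSquared

open ModularGroup Finset.HasAntidiagonal
open scoped Real Manifold

/- Throughout this section `θ²` stands for the function `fun τ : ℍ ↦ jacobiTheta (τ : ℂ) ^ 2`
on `ℍ`, always written out in full (no definition and no notation is introduced). -/

/-- `θ²|₁ S = -i θ²` (from `jacobiTheta_S_smul`: `θ(-1/τ) = (-iτ)^{1/2} θ(τ)`). [folklore] -/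
theorem thetaSq_slash_S :
    (fun τ : ℍ ↦ jacobiTheta (τ : ℂ) ^ 2) ∣[(1 : ℤ)] ModularGroup.S =
      (-Complex.I) • (fun τ : ℍ ↦ jacobiTheta (τ : ℂ) ^ 2) := by
  ext τ
  rw [ModularForm.SL_slash_apply, Pi.smul_apply, smul_eq_mul, jacobiTheta_S_smul, mul_pow,
    ModularGroup.denom_S]
  have h0 : (τ : ℂ) ≠ 0 := τ.ne_zero
  have hsq : ((-Complex.I * (τ : ℂ)) ^ (1 / 2 : ℂ)) ^ 2 = -Complex.I * τ := by
    rw [← cpow_nat_mul]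
    norm_num
  rw [hsq, zpow_neg_one]
  field_simp

/-- `θ²|₁ T² = θ²` (`θ(τ + 2) = θ(τ)`). [folklore] -/
theorem thetaSq_slash_T_sq :
    (fun τ : ℍ ↦ jacobiTheta (τ : ℂ) ^ 2) ∣[(1 : ℤ)] (ModularGroup.T ^ 2) =
      (fun τ : ℍ ↦ jacobiTheta (τ : ℂ) ^ 2) := by
  ext τ
  rw [ModularForm.SL_slash_apply, jacobiTheta_T_sq_smul]
  have : denom (ModularGroup.T ^ 2 : SL(2, ℤ)) τ = 1 := by
    rw [ModularGroup.denom_apply]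
    simp [ModularGroup.coe_T_zpow,
      show (ModularGroup.T ^ 2 : SL(2, ℤ)) = ModularGroup.T ^ (2 : ℤ) from rfl]
  rw [this]
  simp

/-- The theta multiplier on `⟨S, T²⟩`: every element of the group generated by `S` and `T²` acts
on `θ²` in weight `1` by a fourth root of unity (induction over words; no explicit formula for the
multiplier is needed). [folklore] -/
theorem exists_thetaSq_slash_eq_smul {γ : SL(2, ℤ)}
    (hγ : γ ∈ Subgroup.closure ({ModularGroup.S, ModularGroup.T ^ 2} : Set SL(2, ℤ))) :
    ∃ c : ℂ, c ^ 4 = 1 ∧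
      (fun τ : ℍ ↦ jacobiTheta (τ : ℂ) ^ 2) ∣[(1 : ℤ)] γ =
        c • (fun τ : ℍ ↦ jacobiTheta (τ : ℂ) ^ 2) := by
  induction hγ using Subgroup.closure_induction with
  | mem x hx =>
    rcases hx with rfl | rfl
    · exact ⟨-Complex.I, by norm_num [neg_pow], thetaSq_slash_S⟩
    · exact ⟨1, by norm_num, by rw [thetaSq_slash_T_sq, one_smul]⟩
  | one => exact ⟨1, by norm_num, by rw [SlashAction.slash_one, one_smul]⟩
  | mul x y _ _ hx hy =>
    obtain ⟨c, hc, hx⟩ := hx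
    obtain ⟨d, hd, hy⟩ := hy
    refine ⟨c * d, by rw [mul_pow, hc, hd, one_mul], ?_⟩
    rw [SlashAction.slash_mul, hx, ModularForm.SL_smul_slash, hy, smul_smul]
  | inv x _ hx =>
    obtain ⟨c, hc, hx⟩ := hx
    have hc0 : c ≠ 0 := by
      rintro rfl
      norm_num at hc
    refine ⟨c⁻¹, by rw [inv_pow, hc, inv_one], ?_⟩
    have := congrArg (fun F : ℍ → ℂ ↦ F ∣[(1 : ℤ)] x⁻¹) hx
    simp only [← SlashAction.slash_mul, mul_inv_cancel, SlashAction.slash_one,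
      ModularForm.SL_smul_slash] at this
    rw [← inv_smul_eq_iff₀ hc0] at this
    exact this.symm

/-- **Coset decomposition** `SL(2, ℤ) = Γ_θ ∪ Γ_θ T ∪ Γ_θ T S` with respect to the theta group
`Γ_θ ⊇ ⟨S, T²⟩`: every `g ∈ SL(2, ℤ)` is `γ`, `γ T` or `γ T S` with `γ ∈ ⟨S, T²⟩`. Proof by
induction over words in `S, T` (`SL(2, ℤ) = ⟨S, T⟩`), using the relations `S² = -1` (central)
and `(S T)³ = -1` in the forms `T S T = S⁻¹ T⁻² (T S)`, `T S T⁻¹ = T² S (T S)`. [folklore] -/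
theorem exists_mem_closure_S_T_sq (g : SL(2, ℤ)) :
    ∃ γ ∈ Subgroup.closure ({ModularGroup.S, ModularGroup.T ^ 2} : Set SL(2, ℤ)),
      g = γ ∨ g = γ * ModularGroup.T ∨ g = γ * (ModularGroup.T * ModularGroup.S) := by
  set Γθ := Subgroup.closure ({ModularGroup.S, ModularGroup.T ^ 2} : Set SL(2, ℤ)) with hΓθ
  have hS : ModularGroup.S ∈ Γθ := Subgroup.subset_closure (by simp)
  have hT2 : ModularGroup.T ^ 2 ∈ Γθ := Subgroup.subset_closure (by simp)
  have hg : g ∈ Subgroup.closure ({ModularGroup.S, ModularGroup.T} : Set SL(2, ℤ)) := by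
    rw [SpecialLinearGroup.SL2Z_generators]
    exact Subgroup.mem_top g
  induction hg using Subgroup.closure_induction_right with
  | one => exact ⟨1, one_mem _, Or.inl rfl⟩
  | mul_right x _ y hy ih =>
    obtain ⟨γ, hγ, h | h | h⟩ := ih <;> rcases hy with rfl | rfl <;> rw [h]
    · -- γ * S
      exact ⟨γ * ModularGroup.S, mul_mem hγ hS, Or.inl rfl⟩
    · -- γ * T
      exact ⟨γ, hγ, Or.inr (Or.inl rfl)⟩
    · -- γ T * S
      exact ⟨γ, hγ, Or.inr (Or.inr (mul_assoc _ _ _))⟩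
    · -- γ T * T = (γ T²)
      exact ⟨γ * ModularGroup.T ^ 2, mul_mem hγ hT2, Or.inl (by rw [mul_assoc, pow_two])⟩
    · -- γ T S * S = γ S² * T
      refine ⟨γ * ModularGroup.S ^ 2, mul_mem hγ (pow_mem hS 2), Or.inr (Or.inl ?_)⟩
      have : ModularGroup.T * ModularGroup.S * ModularGroup.S =
          ModularGroup.S ^ 2 * ModularGroup.T := by decide
      rw [mul_assoc γ (ModularGroup.T * ModularGroup.S), this, ← mul_assoc]
    · -- γ T S * T = γ S⁻¹ T⁻² * (T S)
      refine ⟨γ * (ModularGroup.S⁻¹ * (ModularGroup.T ^ 2)⁻¹),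
        mul_mem hγ (mul_mem (inv_mem hS) (inv_mem hT2)), Or.inr (Or.inr ?_)⟩
      have : ModularGroup.T * ModularGroup.S * ModularGroup.T =
          ModularGroup.S⁻¹ * (ModularGroup.T ^ 2)⁻¹ * (ModularGroup.T * ModularGroup.S) := by decide
      rw [mul_assoc γ (ModularGroup.T * ModularGroup.S), this]
      simp only [mul_assoc]
  | mul_inv_cancel x _ y hy ih =>
    obtain ⟨γ, hγ, h | h | h⟩ := ih <;> rcases hy with rfl | rfl <;> rw [h]
    · -- γ * S⁻¹
      exact ⟨γ * ModularGroup.S⁻¹, mul_mem hγ (inv_mem hS), Or.inl rfl⟩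
    · -- γ * T⁻¹ = γ T⁻² * T
      refine ⟨γ * (ModularGroup.T ^ 2)⁻¹, mul_mem hγ (inv_mem hT2), Or.inr (Or.inl ?_)⟩
      have : (ModularGroup.T⁻¹ : SL(2, ℤ)) = (ModularGroup.T ^ 2)⁻¹ * ModularGroup.T := by decide
      rw [this, ← mul_assoc]
    · -- γ T * S⁻¹ = γ S² * (T S)
      refine ⟨γ * ModularGroup.S ^ 2, mul_mem hγ (pow_mem hS 2), Or.inr (Or.inr ?_)⟩
      have : ModularGroup.T * ModularGroup.S⁻¹ =
          ModularGroup.S ^ 2 * (ModularGroup.T * ModularGroup.S) := by decide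
      rw [mul_assoc γ ModularGroup.T, this, ← mul_assoc]
    · -- γ T * T⁻¹ = γ
      exact ⟨γ, hγ, Or.inl (by rw [mul_assoc, mul_inv_cancel, mul_one])⟩
    · -- γ T S * S⁻¹ = γ T
      exact ⟨γ, hγ, Or.inr (Or.inl (by rw [mul_assoc, mul_assoc, mul_inv_cancel, mul_one]))⟩
    · -- γ T S * T⁻¹ = γ T² S * (T S)
      refine ⟨γ * (ModularGroup.T ^ 2 * ModularGroup.S), mul_mem hγ (mul_mem hT2 hS),
        Or.inr (Or.inr ?_)⟩
      have : ModularGroup.T * ModularGroup.S * ModularGroup.T⁻¹ =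
          ModularGroup.T ^ 2 * ModularGroup.S * (ModularGroup.T * ModularGroup.S) := by decide
      rw [mul_assoc γ (ModularGroup.T * ModularGroup.S), this]
      simp only [mul_assoc]

/-- Balanced reduction with a parity obstruction removed: if `u, v` have different parities and
`v ≠ 0`, some `u + 2 k v` has absolute value `< |v|`. [folklore] -/
theorem exists_abs_add_two_mul_lt {u v : ℤ} (hv : v ≠ 0) (hpar : ¬ (Even u ↔ Even v)) :
    ∃ k : ℤ, |u + 2 * k * v| < |v| := by
  set m : ℤ := 2 * |v| with hm
  have hv' : 0 < |v| := abs_pos.mpr hv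
  have hm0 : 0 < m := by omega
  set r := u % m with hr
  have hr0 : 0 ≤ r := Int.emod_nonneg u hm0.ne'
  have hrm : r < m := Int.emod_lt_of_pos u hm0
  have hdiv : r + m * (u / m) = u := Int.emod_add_mul_ediv u m
  have hsv : v * Int.sign v = |v| := by rw [Int.abs_eq_natAbs]; exact Int.mul_sign_self v
  rcases lt_trichotomy r |v| with hlt | heq | hgt
  · refine ⟨-(u / m) * Int.sign v, ?_⟩
    have : u + 2 * (-(u / m) * Int.sign v) * v = r := by
      have e : u + 2 * (-(u / m) * Int.sign v) * v = u - (2 * (v * Int.sign v)) * (u / m) := by ring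
      rw [e, hsv, ← hm]
      omega
    rw [this, abs_of_nonneg hr0]
    exact hlt
  · exfalso
    apply hpar
    have hu : u = |v| * (2 * (u / m) + 1) := by rw [hm] at hdiv; rw [heq] at hdiv; linarith
    rw [hu, Int.even_mul]
    constructor
    · rintro (h | h)
      · exact even_abs.mp h
      · exact absurd h (Int.not_even_iff_odd.mpr ⟨u / m, rfl⟩)
    · exact fun h ↦ Or.inl (even_abs.mpr h)
  · refine ⟨-(u / m + 1) * Int.sign v, ?_⟩
    have : u + 2 * (-(u / m + 1) * Int.sign v) * v = r - m := by
      have e : u + 2 * (-(u / m + 1) * Int.sign v) * v =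
          u - (2 * (v * Int.sign v)) * (u / m) - 2 * (v * Int.sign v) := by ring
      rw [e, hsv, ← hm]
      omega
    rw [this, abs_of_neg (by omega)]
    omega

/-- `S Tᵉ S⁻¹ = [1 0; -e 1]`. [folklore] -/
private theorem coe_S_T_zpow_S_inv (e : ℤ) :
    ((ModularGroup.S * ModularGroup.T ^ e * ModularGroup.S⁻¹ : SL(2, ℤ)) :
      Matrix (Fin 2) (Fin 2) ℤ) = !![1, 0; -e, 1] := by
  rw [coe_mul, coe_mul, coe_T_zpow, S_inv, coe_neg, coe_S]
  ext i j
  fin_cases i <;> fin_cases j <;> simp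

/-- Entries of `Tᵉ γ`. [folklore] -/
private theorem T_zpow_mul_entries (e : ℤ) (γ : SL(2, ℤ)) :
    (ModularGroup.T ^ e * γ) 0 0 = γ 0 0 + e * γ 1 0 ∧
      (ModularGroup.T ^ e * γ) 0 1 = γ 0 1 + e * γ 1 1 ∧
      (ModularGroup.T ^ e * γ) 1 0 = γ 1 0 ∧ (ModularGroup.T ^ e * γ) 1 1 = γ 1 1 := by
  simp [coe_mul, coe_T_zpow, Matrix.mul_apply, Fin.sum_univ_two]

/-- Entries of `(S Tᵉ S⁻¹) γ = [1 0; -e 1] γ`. [folklore] -/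
private theorem S_T_zpow_S_inv_mul_entries (e : ℤ) (γ : SL(2, ℤ)) :
    (ModularGroup.S * ModularGroup.T ^ e * ModularGroup.S⁻¹ * γ) 0 0 = γ 0 0 ∧
      (ModularGroup.S * ModularGroup.T ^ e * ModularGroup.S⁻¹ * γ) 0 1 = γ 0 1 ∧
      (ModularGroup.S * ModularGroup.T ^ e * ModularGroup.S⁻¹ * γ) 1 0 = γ 1 0 - e * γ 0 0 ∧
      (ModularGroup.S * ModularGroup.T ^ e * ModularGroup.S⁻¹ * γ) 1 1 = γ 1 1 - e * γ 0 1 := by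
  have h := coe_S_T_zpow_S_inv e
  simp only [coe_mul] at h
  simp only [coe_mul, h, Matrix.mul_apply, Fin.sum_univ_two, Matrix.of_apply, Matrix.cons_val',
    Matrix.cons_val_zero, Matrix.cons_val_one, Matrix.cons_val_fin_one, Matrix.empty_val']
  refine ⟨by ring, by ring, by ring, by ring⟩

/-- **Γ(4) ⊆ ⟨T², S T² S⁻¹⟩**, in the sharper form of Sanov: every `γ = [a b; c d] ∈ SL(2, ℤ)`
with `a ≡ 1 (mod 4)` and `b, c` even is a word in `T² = [1 2; 0 1]` and `S T² S⁻¹ = [1 0; -2 1]`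
(Euclidean descent on `|a| + |c|`, alternately reducing `a` modulo `2c` and `c` modulo `2a`;
parity keeps the inequalities strict). [folklore] -/
theorem mem_closure_T_sq_of_congr (γ : SL(2, ℤ)) (ha : γ 0 0 % 4 = 1) (hb : 2 ∣ γ 0 1)
    (hc : 2 ∣ γ 1 0) :
    γ ∈ Subgroup.closure
      ({ModularGroup.T ^ 2, ModularGroup.S * ModularGroup.T ^ 2 * ModularGroup.S⁻¹} :
        Set SL(2, ℤ)) := by
  set Λ := Subgroup.closure
      ({ModularGroup.T ^ 2, ModularGroup.S * ModularGroup.T ^ 2 * ModularGroup.S⁻¹} :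
        Set SL(2, ℤ)) with hΛ
  have hT2 : ModularGroup.T ^ 2 ∈ Λ := Subgroup.subset_closure (by simp)
  have hU2 : ModularGroup.S * ModularGroup.T ^ 2 * ModularGroup.S⁻¹ ∈ Λ :=
    Subgroup.subset_closure (by simp)
  have hTk : ∀ k : ℤ, ModularGroup.T ^ (2 * k) ∈ Λ := fun k ↦ by
    rw [zpow_mul]
    exact Subgroup.zpow_mem _ (by exact_mod_cast hT2) k
  have hUk : ∀ k : ℤ, ModularGroup.S * ModularGroup.T ^ (2 * k) * ModularGroup.S⁻¹ ∈ Λ := by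
    intro k
    have : ModularGroup.S * ModularGroup.T ^ (2 * k) * ModularGroup.S⁻¹ =
        (ModularGroup.S * ModularGroup.T ^ 2 * ModularGroup.S⁻¹) ^ k := by
      rw [conj_zpow, zpow_mul]
      rfl
    rw [this]
    exact Subgroup.zpow_mem _ hU2 k
  -- strong induction on `|a| + |c|`
  induction' hn : (γ 0 0).natAbs + (γ 1 0).natAbs using Nat.strong_induction_on with n ih
    generalizing γ
  have hdet : γ 0 0 * γ 1 1 - γ 0 1 * γ 1 0 = 1 := by
    have := Matrix.det_fin_two (γ : Matrix (Fin 2) (Fin 2) ℤ)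
    rw [γ.det_coe] at this
    exact this.symm
  obtain ⟨b₀, hb₀⟩ := hb
  obtain ⟨c₀, hc₀⟩ := hc
  by_cases hc0 : γ 1 0 = 0
  · -- `c = 0`: then `a = d = 1` and `γ = T^b`, `b` even
    have had : γ 0 0 * γ 1 1 = 1 := by rw [hc0, mul_zero, sub_zero] at hdet; exact hdet
    have ha1 : γ 0 0 = 1 := by
      rcases Int.eq_one_or_neg_one_of_mul_eq_one had with h | h
      · exact h
      · omega
    have hd1 : γ 1 1 = 1 := by rw [ha1, one_mul] at had; exact had
    have hγ : γ = ModularGroup.T ^ (2 * b₀) := by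
      ext i j
      fin_cases i <;> fin_cases j <;> simp [coe_T_zpow, ha1, hd1, hc0, hb₀]
    rw [hγ]
    exact hTk b₀
  -- `c ≠ 0`; `a` is odd, so `|a| ≠ |c|`
  have hac : (γ 0 0).natAbs ≠ (γ 1 0).natAbs := by
    intro h
    rcases Int.natAbs_eq_natAbs_iff.mp h with h' | h' <;> omega
  rcases lt_or_gt_of_ne hac with hlt | hgt
  · -- `|a| < |c|`: reduce `c` modulo `2a`
    obtain ⟨k, hk⟩ : ∃ k : ℤ, |γ 1 0 + 2 * k * γ 0 0| < |γ 0 0| := by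
      refine exists_abs_add_two_mul_lt (by omega) fun h ↦ ?_
      have h1 : ¬ Even (γ 0 0) := by rw [Int.even_iff]; omega
      exact h1 (h.mp ⟨c₀, by omega⟩)
    set γ' := ModularGroup.S * ModularGroup.T ^ (2 * -k) * ModularGroup.S⁻¹ * γ with hγ'
    obtain ⟨e00, e01, e10, e11⟩ := S_T_zpow_S_inv_mul_entries (2 * -k) γ
    have hk' : (γ' 1 0).natAbs < (γ 0 0).natAbs := by
      have := hk
      rw [Int.abs_eq_natAbs, Int.abs_eq_natAbs, Int.ofNat_lt] at this
      convert this using 2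
      rw [e10]
      ring
    have hmem : γ' ∈ Λ := by
      refine ih _ ?_ γ' ?_ ?_ ?_ rfl
      · rw [← hn, e00]
        omega
      · rw [e00]
        exact ha
      · rw [e01]
        exact ⟨b₀, hb₀⟩
      · rw [e10]
        exact ⟨c₀ + k * γ 0 0, by rw [hc₀]; ring⟩
    have : γ = (ModularGroup.S * ModularGroup.T ^ (2 * -k) * ModularGroup.S⁻¹)⁻¹ * γ' := by
      rw [hγ', inv_mul_cancel_left]
    rw [this]
    exact mul_mem (inv_mem (hUk (-k))) hmem
  · -- `|c| < |a|`: reduce `a` modulo `2c`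
    obtain ⟨k, hk⟩ : ∃ k : ℤ, |γ 0 0 + 2 * k * γ 1 0| < |γ 1 0| := by
      refine exists_abs_add_two_mul_lt hc0 fun h ↦ ?_
      have h1 : ¬ Even (γ 0 0) := by rw [Int.even_iff]; omega
      exact h1 (h.mpr ⟨c₀, by omega⟩)
    set γ' := ModularGroup.T ^ (2 * k) * γ with hγ'
    obtain ⟨e00, e01, e10, e11⟩ := T_zpow_mul_entries (2 * k) γ
    have hk' : (γ' 0 0).natAbs < (γ 1 0).natAbs := by
      have := hk
      rw [Int.abs_eq_natAbs, Int.abs_eq_natAbs, Int.ofNat_lt] at this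
      convert this using 2
    have hmem : γ' ∈ Λ := by
      refine ih _ ?_ γ' ?_ ?_ ?_ rfl
      · rw [← hn, e10]
        omega
      · rw [e00, hc₀, show (2 : ℤ) * k * (2 * c₀) = 4 * (k * c₀) by ring]
        generalize k * c₀ = t
        omega
      · rw [e01]
        exact ⟨b₀ + k * γ 1 1, by rw [hb₀]; ring⟩
      · rw [e10]
        exact ⟨c₀, hc₀⟩
    have : γ = (ModularGroup.T ^ (2 * k))⁻¹ * γ' := by rw [hγ', inv_mul_cancel_left]
    rw [this]
    exact mul_mem (inv_mem (hTk k)) hmem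

/-- `Γ(4) ⊆ ⟨T², S T² S⁻¹⟩`. [folklore] -/
theorem Gamma_four_le_closure_T_sq :
    CongruenceSubgroup.Gamma 4 ≤ Subgroup.closure
      ({ModularGroup.T ^ 2, ModularGroup.S * ModularGroup.T ^ 2 * ModularGroup.S⁻¹} :
        Set SL(2, ℤ)) := by
  intro γ hγ
  rw [CongruenceSubgroup.Gamma_mem] at hγ
  obtain ⟨h00, h01, h10, -⟩ := hγ
  refine mem_closure_T_sq_of_congr γ ?_ ?_ ?_
  · have h : ((γ 0 0 : ℤ) : ZMod 4) = ((1 : ℤ) : ZMod 4) := by rw [h00, Int.cast_one]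
    rw [ZMod.intCast_eq_intCast_iff, Int.ModEq] at h
    norm_num at h
    omega
  · have h : ((γ 0 1 : ℤ) : ZMod 4) = ((0 : ℤ) : ZMod 4) := by rw [h01, Int.cast_zero]
    rw [ZMod.intCast_eq_intCast_iff, Int.ModEq] at h
    norm_num at h
    omega
  · have h : ((γ 1 0 : ℤ) : ZMod 4) = ((0 : ℤ) : ZMod 4) := by rw [h10, Int.cast_zero]
    rw [ZMod.intCast_eq_intCast_iff, Int.ModEq] at h
    norm_num at h
    omega

/-! #### Analytic estimates for `θ` -/

/-- `e^{-π y} ≤ 1/16` for `y ≥ 1`. [folklore] -/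
private theorem exp_neg_pi_mul_le {y : ℝ} (hy : 1 ≤ y) : rexp (-π * y) ≤ 1 / 16 := by
  have hπ : 3 < π := Real.pi_gt_three
  have h1 : rexp (-π * y) ≤ rexp (-3) := Real.exp_le_exp.mpr (by nlinarith)
  have h2 : (16 : ℝ) ≤ rexp 3 := by
    have he : (2.7 : ℝ) < rexp 1 := lt_trans (by norm_num) Real.exp_one_gt_d9
    have : rexp 3 = rexp 1 ^ 3 := by rw [← Real.exp_nat_mul]; norm_num
    rw [this]
    have h3 : (2.7 : ℝ) ^ 3 < rexp 1 ^ 3 := pow_lt_pow_left₀ he (by norm_num) (by norm_num)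
    norm_num at h3
    linarith
  calc rexp (-π * y) ≤ rexp (-3) := h1
    _ = (rexp 3)⁻¹ := Real.exp_neg 3
    _ ≤ 16⁻¹ := by gcongr
    _ = 1 / 16 := by norm_num

/-- `‖θ(τ) - 1‖ ≤ 1/4` for `Im τ ≥ 1`. [folklore] -/
theorem norm_jacobiTheta_sub_one_le_quarter {τ : ℂ} (hτ : 1 ≤ τ.im) :
    ‖jacobiTheta τ - 1‖ ≤ 1 / 4 := by
  have hτ0 : 0 < τ.im := lt_of_lt_of_le one_pos hτ
  have ha := exp_neg_pi_mul_le hτ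
  have ha0 : 0 < rexp (-π * τ.im) := Real.exp_pos _
  refine (norm_jacobiTheta_sub_one_le hτ0).trans ?_
  rw [div_mul_eq_mul_div, div_le_iff₀ (by linarith)]
  nlinarith

/-- `‖θ(τ)²‖ ≤ 2` for `Im τ ≥ 1`. [folklore] -/
theorem norm_jacobiTheta_sq_le {τ : ℂ} (hτ : 1 ≤ τ.im) : ‖jacobiTheta τ ^ 2‖ ≤ 2 := by
  have h := norm_jacobiTheta_sub_one_le_quarter hτ
  have h1 : ‖jacobiTheta τ‖ ≤ 5 / 4 := by
    calc ‖jacobiTheta τ‖ ≤ ‖(1 : ℂ)‖ + ‖jacobiTheta τ - 1‖ := norm_le_norm_add_norm_sub' _ _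
      _ ≤ 1 + 1 / 4 := by rw [norm_one]; linarith
      _ = 5 / 4 := by norm_num
  rw [norm_pow]
  nlinarith [norm_nonneg (jacobiTheta τ)]

/-- `θ` does not vanish at `τ = i`. [folklore] -/
theorem jacobiTheta_I_ne_zero : jacobiTheta Complex.I ≠ 0 := by
  intro h
  have := norm_jacobiTheta_sub_one_le_quarter (τ := Complex.I) (by simp)
  rw [h, zero_sub, norm_neg, norm_one] at this
  norm_num at this

/-- `θ(1 + w) = ϑ(1/2, w)`: shifting `τ` by `1` twists the theta series by `(-1)ⁿ`. [folklore] -/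
theorem jacobiTheta_one_add (w : ℂ) : jacobiTheta (1 + w) = jacobiTheta₂ (1 / 2) w := by
  rw [jacobiTheta, jacobiTheta₂]
  refine tsum_congr fun n ↦ ?_
  rw [jacobiTheta₂_term]
  have hpar : cexp (π * Complex.I * (n : ℂ) ^ 2) = cexp (π * Complex.I * n) := by
    obtain ⟨j, hj⟩ := Int.even_mul_succ_self (n - 1)
    have hj' : (n : ℂ) ^ 2 = n + 2 * j := by
      have : (n : ℤ) ^ 2 = n + 2 * j := by rw [← two_mul] at hj; linear_combination hj
      exact_mod_cast this
    rw [hj', mul_add, Complex.exp_add,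
      show π * Complex.I * (2 * (j : ℂ)) = j * (2 * π * Complex.I) by ring,
      Complex.exp_int_mul_two_pi_mul_I, mul_one]
  rw [show π * Complex.I * (n : ℂ) ^ 2 * (1 + w) =
      π * Complex.I * (n : ℂ) ^ 2 + π * Complex.I * n ^ 2 * w by ring,
    Complex.exp_add, hpar, ← Complex.exp_add]
  congr 1
  ring

/-- The functional equation of `ϑ` at `z = τ/2`:
`ϑ(1/2, -1/τ) = (-iτ)^{1/2} e^{πiτ/4} ϑ(τ/2, τ)`. [folklore] -/
theorem jacobiTheta₂_half_neg_inv (τ : ℍ) :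
    jacobiTheta₂ (1 / 2) (-1 / (τ : ℂ)) =
      (-Complex.I * τ) ^ (1 / 2 : ℂ) * cexp (π * Complex.I * τ / 4) *
        jacobiTheta₂ ((τ : ℂ) / 2) τ := by
  have h0 : (τ : ℂ) ≠ 0 := τ.ne_zero
  have h1 : (-Complex.I * (τ : ℂ)) ^ (1 / 2 : ℂ) ≠ 0 := by
    rw [Ne, cpow_eq_zero_iff, not_and_or]
    exact Or.inl (mul_ne_zero (neg_ne_zero.mpr I_ne_zero) h0)
  have hFE := jacobiTheta₂_functional_equation ((τ : ℂ) / 2) τ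
  have hz : (τ : ℂ) / 2 / τ = 1 / 2 := by field_simp
  have he : -π * Complex.I * ((τ : ℂ) / 2) ^ 2 / τ = -(π * Complex.I * τ / 4) := by field_simp; ring
  rw [hz, he] at hFE
  rw [hFE, Complex.exp_neg]
  field_simp

/-- `θ(1 - 1/τ)² = -iτ · e^{πiτ/2} · ϑ(τ/2, τ)²`. [folklore] -/
theorem jacobiTheta_one_sub_inv_sq (τ : ℍ) :
    jacobiTheta (1 + -1 / (τ : ℂ)) ^ 2 =
      -Complex.I * τ * cexp (π * Complex.I * τ / 2) * jacobiTheta₂ ((τ : ℂ) / 2) τ ^ 2 := by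
  rw [jacobiTheta_one_add, jacobiTheta₂_half_neg_inv, mul_pow, mul_pow]
  have hsq : ((-Complex.I * (τ : ℂ)) ^ (1 / 2 : ℂ)) ^ 2 = -Complex.I * τ := by
    rw [← cpow_nat_mul]
    norm_num
  have hexp : cexp (π * Complex.I * τ / 4) ^ 2 = cexp (π * Complex.I * τ / 2) := by
    rw [sq, ← Complex.exp_add]
    congr 1
    ring
  rw [hsq, hexp]

/-- A uniform bound for `ϑ(τ/2, τ)` on `Im τ ≥ 1`. [folklore] -/
theorem norm_jacobiTheta₂_half_le {τ : ℂ} (hτ : 1 ≤ τ.im) :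
    ‖jacobiTheta₂ (τ / 2) τ‖ ≤ ∑' n : ℤ, rexp (-π * ((n : ℝ) ^ 2 - |(n : ℝ)|)) := by
  have hτ0 : 0 < τ.im := lt_of_lt_of_le one_pos hτ
  have hg : Summable fun n : ℤ ↦ rexp (-π * ((n : ℝ) ^ 2 - |(n : ℝ)|)) := by
    have := summable_pow_mul_jacobiTheta₂_term_bound (1 / 2) one_pos 0
    simpa using this
  have hle : ∀ n : ℤ, ‖jacobiTheta₂_term n (τ / 2) τ‖ ≤ rexp (-π * ((n : ℝ) ^ 2 - |(n : ℝ)|)) := by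
    intro n
    have h := norm_jacobiTheta₂_term_le hτ0 (S := τ.im / 2) (z := τ / 2) (τ := τ)
      (by rw [Complex.div_ofNat_im, abs_of_nonneg (by linarith)]) le_rfl n
    rw [Int.cast_abs] at h
    refine h.trans (Real.exp_le_exp.mpr ?_)
    have hn : |(n : ℝ)| ≤ (n : ℝ) ^ 2 := by
      rw [← sq_abs]
      rcases eq_or_ne n 0 with rfl | hn
      · simp
      · have : (1 : ℝ) ≤ |(n : ℝ)| := by
          rw [← Int.cast_abs]
          exact_mod_cast Int.one_le_abs hn
        nlinarith
    nlinarith [mul_nonneg (mul_nonneg Real.pi_pos.le (sub_nonneg.mpr hτ)) (sub_nonneg.mpr hn)]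
  have aux : Summable fun n : ℤ ↦ ‖jacobiTheta₂_term n (τ / 2) τ‖ :=
    .of_nonneg_of_le (fun n ↦ norm_nonneg _) hle hg
  rw [jacobiTheta₂]
  exact (norm_tsum_le_tsum_norm aux).trans (aux.tsum_mono hg hle)


/-! #### Boundedness of `θ²` at the cusps -/

/-- `θ²` is bounded at `i∞`. [folklore] -/
theorem isBoundedAtImInfty_thetaSq : IsBoundedAtImInfty (fun τ : ℍ ↦ jacobiTheta (τ : ℂ) ^ 2) := by
  rw [isBoundedAtImInfty_iff]
  exact ⟨2, 1, fun τ hτ ↦ norm_jacobiTheta_sq_le (by rwa [UpperHalfPlane.coe_im])⟩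

/-- `(θ²|₁T)(τ) = θ(1 + τ)²`. [folklore] -/
theorem thetaSq_slash_T_apply (τ : ℍ) :
    ((fun τ : ℍ ↦ jacobiTheta (τ : ℂ) ^ 2) ∣[(1 : ℤ)] ModularGroup.T) τ =
      jacobiTheta (1 + (τ : ℂ)) ^ 2 := by
  rw [ModularForm.SL_slash_apply, UpperHalfPlane.modular_T_smul, UpperHalfPlane.coe_vadd]
  have : denom ModularGroup.T τ = 1 := by
    rw [ModularGroup.denom_apply]
    simp [ModularGroup.coe_T]
  rw [this]
  simp

/-- `θ²|₁T` is bounded at `i∞`. [folklore] -/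
theorem isBoundedAtImInfty_thetaSq_slash_T :
    IsBoundedAtImInfty ((fun τ : ℍ ↦ jacobiTheta (τ : ℂ) ^ 2) ∣[(1 : ℤ)] ModularGroup.T) := by
  rw [isBoundedAtImInfty_iff]
  refine ⟨2, 1, fun τ hτ ↦ ?_⟩
  rw [thetaSq_slash_T_apply]
  exact norm_jacobiTheta_sq_le (by simpa using hτ)

/-- `(θ²|₁(T S))(τ) = θ(1 - 1/τ)²/τ = -i e^{πiτ/2} ϑ(τ/2, τ)²`. [folklore] -/
theorem thetaSq_slash_TS_apply (τ : ℍ) :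
    ((fun τ : ℍ ↦ jacobiTheta (τ : ℂ) ^ 2) ∣[(1 : ℤ)] (ModularGroup.T * ModularGroup.S)) τ =
      -Complex.I * cexp (π * Complex.I * τ / 2) * jacobiTheta₂ ((τ : ℂ) / 2) τ ^ 2 := by
  rw [ModularForm.SL_slash_apply]
  have hsmul : (((ModularGroup.T * ModularGroup.S) • τ : ℍ) : ℂ) = 1 + -1 / (τ : ℂ) := by
    rw [mul_smul, UpperHalfPlane.modular_T_smul, UpperHalfPlane.coe_vadd,
      UpperHalfPlane.modular_S_smul]
    simp [neg_div, inv_neg]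
  have hdenom : denom (ModularGroup.T * ModularGroup.S : SL(2, ℤ)) τ = (τ : ℂ) := by
    rw [ModularGroup.denom_apply]
    have h10 : (ModularGroup.T * ModularGroup.S) 1 0 = 1 := by decide
    have h11 : (ModularGroup.T * ModularGroup.S) 1 1 = 0 := by decide
    simp [h10, h11]
  have h0 : (τ : ℂ) ≠ 0 := τ.ne_zero
  rw [hsmul, hdenom, jacobiTheta_one_sub_inv_sq, zpow_neg_one]
  field_simp

/-- `θ²|₁(T S)` is bounded at `i∞`. [folklore] -/
theorem isBoundedAtImInfty_thetaSq_slash_TS :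
    IsBoundedAtImInfty
      ((fun τ : ℍ ↦ jacobiTheta (τ : ℂ) ^ 2) ∣[(1 : ℤ)] (ModularGroup.T * ModularGroup.S)) := by
  rw [isBoundedAtImInfty_iff]
  refine ⟨(∑' n : ℤ, rexp (-π * ((n : ℝ) ^ 2 - |(n : ℝ)|))) ^ 2, 1, fun τ hτ ↦ ?_⟩
  have hτ' : 1 ≤ (τ : ℂ).im := by rwa [UpperHalfPlane.coe_im]
  rw [thetaSq_slash_TS_apply, norm_mul, norm_mul, norm_neg, norm_I, one_mul, norm_pow]
  have h1 : ‖cexp (π * Complex.I * τ / 2)‖ ≤ 1 := by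
    rw [Complex.norm_exp]
    refine Real.exp_le_one_iff.mpr ?_
    have : (π * Complex.I * (τ : ℂ) / 2).re = -(π * (τ : ℂ).im / 2) := by
      simp [Complex.mul_re, Complex.mul_im, Complex.div_ofNat_re]
      ring
    rw [this, neg_nonpos]
    positivity
  have h2 := norm_jacobiTheta₂_half_le hτ'
  calc ‖cexp (π * Complex.I * τ / 2)‖ * ‖jacobiTheta₂ ((τ : ℂ) / 2) τ‖ ^ 2
      ≤ 1 * (∑' n : ℤ, rexp (-π * ((n : ℝ) ^ 2 - |(n : ℝ)|))) ^ 2 := by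
        gcongr
    _ = _ := one_mul _

/-! #### `θ²` as a weight-one modular form on a congruence subgroup -/

/-- `θ²|₁(S T² S⁻¹) = θ²`. [folklore] -/
theorem thetaSq_slash_S_T_sq_S_inv :
    (fun τ : ℍ ↦ jacobiTheta (τ : ℂ) ^ 2) ∣[(1 : ℤ)]
        (ModularGroup.S * ModularGroup.T ^ 2 * ModularGroup.S⁻¹) =
      (fun τ : ℍ ↦ jacobiTheta (τ : ℂ) ^ 2) := by
  rw [SlashAction.slash_mul, SlashAction.slash_mul, thetaSq_slash_S, ModularForm.SL_smul_slash,
    thetaSq_slash_T_sq]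
  have h := SlashAction.slash_mul (1 : ℤ) ModularGroup.S ModularGroup.S⁻¹
    (fun τ : ℍ ↦ jacobiTheta (τ : ℂ) ^ 2)
  rw [mul_inv_cancel, SlashAction.slash_one, thetaSq_slash_S] at h
  exact h.symm

/-- `mapGL (T²) = [1 2; 0 1]`. [folklore] -/
private theorem mapGL_T_sq :
    mapGL ℝ (ModularGroup.T ^ 2) = Matrix.GeneralLinearGroup.upperRightHom (2 : ℝ) := by
  rw [Units.ext_iff]
  change ((ModularGroup.T ^ (2 : ℤ) : SL(2, ℤ)) : Matrix (Fin 2) (Fin 2) ℤ).map (algebraMap ℤ ℝ) = _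
  rw [ModularGroup.coe_T_zpow]
  ext i j
  fin_cases i <;> fin_cases j <;> simp

/-- **`θ²` is a weight-one modular form on a congruence subgroup.** There is a finite-index
congruence subgroup `Γ₁ ≤ SL(2, ℤ)` (the stabiliser of `θ²` under the weight-`1` action, which
contains `Γ(4)` — Sanov/`Gamma_four_le_closure_T_sq` — and `T²`) carrying a weight-`1` modular
form whose underlying function is `θ(τ)² = (Σ_{n ∈ ℤ} e^{πin²τ})²`: holomorphy is Mathlib's
`mdifferentiable_jacobiTheta`; boundedness at every cusp follows from the coset decomposition
`SL(2, ℤ) = Γ_θ ∪ Γ_θ T ∪ Γ_θ T S`, the theta multiplier on `Γ_θ ⊇ ⟨S, T²⟩`, and the three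
estimates at `1`, `T`, `T S` (the last by the functional equation of `ϑ`). [folklore] -/
theorem exists_modularForm_thetaSq :
    ∃ (Γ₁ : Subgroup SL(2, ℤ)) (_ : Γ₁.FiniteIndex)
      (E : ModularForm (Γ₁ : Subgroup (GL (Fin 2) ℝ)) 1),
      IsCongruenceSubgroup Γ₁ ∧ (2 : ℝ) ∈ (Γ₁ : Subgroup (GL (Fin 2) ℝ)).strictPeriods ∧
      (E : ℍ → ℂ) = (fun τ : ℍ ↦ jacobiTheta (τ : ℂ) ^ 2) := by
  -- the stabiliser `K` of `θ²` under the weight-one action of `SL(2, ℤ)`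
  let K : Subgroup SL(2, ℤ) :=
    { carrier := {γ | (fun τ : ℍ ↦ jacobiTheta (τ : ℂ) ^ 2) ∣[(1 : ℤ)] γ =
        (fun τ : ℍ ↦ jacobiTheta (τ : ℂ) ^ 2)}
      mul_mem' := fun {a b} ha hb ↦ by
        simp only [Set.mem_setOf_eq] at ha hb ⊢
        rw [SlashAction.slash_mul, ha, hb]
      one_mem' := by
        simp only [Set.mem_setOf_eq]
        exact SlashAction.slash_one _ _
      inv_mem' := fun {a} ha ↦ by
        simp only [Set.mem_setOf_eq] at ha ⊢
        have h := SlashAction.slash_mul (1 : ℤ) a a⁻¹ (fun τ : ℍ ↦ jacobiTheta (τ : ℂ) ^ 2)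
        rw [mul_inv_cancel, SlashAction.slash_one, ha] at h
        exact h.symm }
  have hT2K : ModularGroup.T ^ 2 ∈ K := thetaSq_slash_T_sq
  have hUK : ModularGroup.S * ModularGroup.T ^ 2 * ModularGroup.S⁻¹ ∈ K :=
    thetaSq_slash_S_T_sq_S_inv
  have hG4 : CongruenceSubgroup.Gamma 4 ≤ K := by
    refine Gamma_four_le_closure_T_sq.trans ((Subgroup.closure_le K).mpr ?_)
    rintro x (rfl | rfl)
    exacts [hT2K, hUK]
  haveI hKfi : K.FiniteIndex := Subgroup.finiteIndex_of_le hG4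
  have hKcong : IsCongruenceSubgroup K := ⟨4, by norm_num, hG4⟩
  have hθ : MDifferentiable 𝓘(ℂ) 𝓘(ℂ) (fun τ : ℍ ↦ jacobiTheta (τ : ℂ) ^ 2) := by
    have : (fun τ : ℍ ↦ jacobiTheta (τ : ℂ) ^ 2) =
        (jacobiTheta ∘ UpperHalfPlane.coe) * (jacobiTheta ∘ UpperHalfPlane.coe) := by
      funext τ
      simp [sq]
    rw [this]
    exact mdifferentiable_jacobiTheta.mul mdifferentiable_jacobiTheta
  refine ⟨K, hKfi,
    { toFun := (fun τ : ℍ ↦ jacobiTheta (τ : ℂ) ^ 2)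
      slash_action_eq' := ?_
      holo' := hθ
      bdd_at_cusps' := ?_ }, hKcong, ?_, rfl⟩
  · intro γ hγ
    obtain ⟨A, hA, rfl⟩ := Subgroup.mem_map.mp hγ
    exact hA
  · intro c hc
    rw [Subgroup.IsArithmetic.isCusp_iff_isCusp_SL2Z] at hc
    rw [OnePoint.isBoundedAt_iff_forall_SL2Z hc]
    intro g _
    obtain ⟨γ, hγ, hg⟩ := exists_mem_closure_S_T_sq g
    obtain ⟨c₀, -, hc₀⟩ := exists_thetaSq_slash_eq_smul hγ
    have key : ∀ r : SL(2, ℤ),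
        IsBoundedAtImInfty ((fun τ : ℍ ↦ jacobiTheta (τ : ℂ) ^ 2) ∣[(1 : ℤ)] r) →
        IsBoundedAtImInfty ((fun τ : ℍ ↦ jacobiTheta (τ : ℂ) ^ 2) ∣[(1 : ℤ)] (γ * r)) := by
      intro r hr
      rw [SlashAction.slash_mul, hc₀, ModularForm.SL_smul_slash]
      exact Filter.BoundedAtFilter.smul c₀ hr
    rcases hg with rfl | rfl | rfl
    · have h1 := key 1 (by rw [SlashAction.slash_one]; exact isBoundedAtImInfty_thetaSq)
      rwa [mul_one] at h1
    · exact key _ isBoundedAtImInfty_thetaSq_slash_T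
    · exact key _ isBoundedAtImInfty_thetaSq_slash_TS
  · rw [Subgroup.mem_strictPeriods_iff]
    exact Subgroup.mem_map.mpr ⟨ModularGroup.T ^ 2, hT2K, mapGL_T_sq⟩

/- The coefficients of `θ = Σ_{n ∈ ℤ} q^{n²}` (`q = e^{πiτ}`) are `a(m) = 1, 2, 0, 0, 2, 0, …`,
written out below as `if m = 0 then 1 else if IsSquare m then 2 else 0` (no definition is
introduced). -/

/-! #### The `q`-expansion of `θ²` -/

/-- `θ(τ) = Σ_m a(m) qᵐ` with `q = 𝕢₂(τ) = e^{πiτ}` and integers `|a(m)| ≤ 2`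
(`a = 1, 2, 0, 0, 2, 0, …`). [folklore] -/
theorem exists_hasSum_jacobiTheta_qParam :
    ∃ a : ℕ → ℤ, (∀ m, |a m| ≤ 2) ∧
      ∀ τ : ℍ, HasSum (fun m : ℕ ↦ (a m : ℂ) * Function.Periodic.qParam 2 τ ^ m)
        (jacobiTheta τ) := by
  classical
  let a : ℕ → ℤ := fun m ↦ if m = 0 then 1 else if IsSquare m then 2 else 0
  refine ⟨a, fun m ↦ ?_, fun τ ↦ ?_⟩
  · simp only [a]
    split_ifs <;> simp
  set q : ℂ := Function.Periodic.qParam 2 τ with hq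
  have hexp : ∀ k : ℕ, cexp (π * Complex.I * (k : ℂ) * τ) = q ^ k := fun k ↦ by
    rw [hq, Function.Periodic.qParam, ← Complex.exp_nat_mul]
    congr 1
    push_cast
    ring
  -- the terms `m ≥ 1`
  have h1 : HasSum (fun m : ℕ ↦ if m = 0 then (0 : ℂ) else (a m : ℂ) * q ^ m)
      (jacobiTheta τ - 1) := by
    have hθ := (hasSum_nat_jacobiTheta τ.im_pos).mul_left 2
    rw [mul_div_cancel₀ _ (two_ne_zero' ℂ)] at hθ
    have hinj : Function.Injective fun n : ℕ ↦ (n + 1) ^ 2 := fun a b h ↦ by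
      simpa using (Nat.pow_left_injective two_ne_zero h : a + 1 = b + 1)
    refine (Function.Injective.hasSum_iff hinj ?_).mp ?_
    · intro m hm
      simp only [Set.mem_range, not_exists] at hm
      by_cases hm0 : m = 0
      · simp [hm0]
      · have hns : ¬ IsSquare m := by
          rintro ⟨r, hr⟩
          rcases Nat.eq_zero_or_pos r with rfl | hr0
          · exact hm0 (by simpa using hr)
          · exact hm (r - 1) (by rw [Nat.sub_add_cancel hr0, sq, ← hr])
        simp [a, hm0, hns]
    · have heq : ((fun m : ℕ ↦ if m = 0 then (0 : ℂ) else (a m : ℂ) * q ^ m) ∘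
          fun n : ℕ ↦ (n + 1) ^ 2) =
          fun n : ℕ ↦ 2 * cexp (π * Complex.I * ((n : ℂ) + 1) ^ 2 * τ) := by
        funext n
        have hsq : IsSquare ((n + 1) ^ 2) := ⟨n + 1, sq _⟩
        have hne : (n + 1) ^ 2 ≠ 0 := by positivity
        simp only [Function.comp_apply, hne, if_false, a, hsq, if_true, Int.cast_ofNat]
        rw [← hexp ((n + 1) ^ 2)]
        push_cast
        ring_nf
      rw [heq]
      exact hθ
  -- the term `m = 0`
  have h0 : HasSum (fun m : ℕ ↦ if m = 0 then (1 : ℂ) else 0) 1 := hasSum_ite_eq 0 1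
  convert h0.add h1 using 1
  · funext m
    by_cases hm : m = 0
    · simp [a, hm]
    · simp [hm]
  · ring

/-- `θ(τ)² = Σ_m r(m) qᵐ` (`q = e^{πiτ}`) with integers `r(m)` (`= r₂(m)`, the Cauchy square of
the coefficient sequence of `θ`). [folklore] -/
theorem exists_hasSum_thetaSq_qParam :
    ∃ r : ℕ → ℤ, ∀ τ : ℍ, HasSum (fun m : ℕ ↦ (r m : ℂ) * Function.Periodic.qParam 2 τ ^ m)
      (jacobiTheta τ ^ 2) := by
  obtain ⟨a, ha, hsum⟩ := exists_hasSum_jacobiTheta_qParam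
  refine ⟨fun m ↦ ∑ kl ∈ antidiagonal m, a kl.1 * a kl.2, fun τ ↦ ?_⟩
  set F : ℕ → ℂ := fun m ↦ (a m : ℂ) * Function.Periodic.qParam 2 τ ^ m with hF
  have hFs : Summable fun m ↦ ‖F m‖ := by
    have hq : ‖Function.Periodic.qParam 2 (τ : ℂ)‖ < 1 :=
      Function.Periodic.norm_qParam_lt_one two_pos τ.im_pos
    refine Summable.of_nonneg_of_le (fun _ ↦ norm_nonneg _) (fun m ↦ ?_)
      ((summable_geometric_of_lt_one (norm_nonneg _) hq).mul_left 2)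
    rw [hF, norm_mul, norm_pow]
    gcongr
    have h2 := ha m
    rw [Complex.norm_intCast]
    exact_mod_cast h2
  have hF1 : HasSum F (jacobiTheta τ) := hsum τ
  have hprod := tsum_mul_tsum_eq_tsum_sum_antidiagonal_of_summable_norm hFs hFs
  rw [hF1.tsum_eq] at hprod
  have hGs : Summable fun n ↦ ∑ kl ∈ antidiagonal n, F kl.1 * F kl.2 :=
    summable_sum_mul_antidiagonal_of_summable_norm' hFs hF1.summable hFs hF1.summable
  have hG : HasSum (fun n ↦ ∑ kl ∈ antidiagonal n, F kl.1 * F kl.2) (jacobiTheta τ ^ 2) := by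
    rw [sq, hprod]
    exact hGs.hasSum
  convert hG using 1
  funext m
  rw [Int.cast_sum, Finset.sum_mul]
  refine Finset.sum_congr rfl fun kl hkl ↦ ?_
  rw [Finset.HasAntidiagonal.mem_antidiagonal] at hkl
  simp only [hF, Int.cast_mul]
  rw [← hkl, pow_add]
  ring

/-- **`θ²` has rational-integer `q`-expansion at period `2`** (`θ² = Σ r₂(m) qᵐ`,
`q = e^{πiτ}`), for any bundled modular form with underlying function `θ²` on a level with
strict period `2`. [folklore] -/
theorem thetaSq_qExpansion_coeff_int {Γ : Subgroup (GL (Fin 2) ℝ)} {k : ℤ} (E : ModularForm Γ k)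
    (hE : (E : ℍ → ℂ) = (fun τ : ℍ ↦ jacobiTheta (τ : ℂ) ^ 2))
    (h2 : (2 : ℝ) ∈ Γ.strictPeriods) (n : ℕ) :
    ∃ z : ℤ, PowerSeries.coeff n (qExpansion 2 E) = (z : ℂ) := by
  obtain ⟨r, hr⟩ := exists_hasSum_thetaSq_qParam
  refine ⟨r n, ?_⟩
  refine (ModularFormClass.qExpansion_coeff_unique (c := fun m : ℕ ↦ (r m : ℂ)) two_pos h2
    (f := E) (fun τ ↦ ?_) n).symm
  simp only [smul_eq_mul]
  rw [show E τ = jacobiTheta τ ^ 2 from congrFun hE τ]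
  exact hr τ

/-- `θ²` is not identically zero. [folklore] -/
theorem thetaSq_ne_zero : (fun τ : ℍ ↦ jacobiTheta (τ : ℂ) ^ 2) ≠ 0 := by
  intro h
  have := congrFun h UpperHalfPlane.I
  simp only [UpperHalfPlane.coe_I, Pi.zero_apply, pow_eq_zero_iff, ne_eq, OfNat.ofNat_ne_zero,
    not_false_eq_true] at this
  exact jacobiTheta_I_ne_zero this

end ThetaSquared

/-! ### K. Twisting by congruence forms: even weights, and weights `12 m`, suffice -/

/-- A common strict period of `Γ` and `Γ₁` is a strict period of `Γ ∩ Γ₁` (`mapGL` is injective).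
[folklore] -/
private theorem mem_strictPeriods_inf {Γ Γ₁ : Subgroup SL(2, ℤ)} {x : ℝ}
    (h : x ∈ (Γ : Subgroup (GL (Fin 2) ℝ)).strictPeriods)
    (h₁ : x ∈ (Γ₁ : Subgroup (GL (Fin 2) ℝ)).strictPeriods) :
    x ∈ ((Γ ⊓ Γ₁ : Subgroup SL(2, ℤ)) : Subgroup (GL (Fin 2) ℝ)).strictPeriods := by
  rw [Subgroup.mem_strictPeriods_iff] at h h₁ ⊢
  obtain ⟨A, hA, hAeq⟩ := Subgroup.mem_map.mp h
  obtain ⟨B, hB, hBeq⟩ := Subgroup.mem_map.mp h₁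
  obtain rfl : B = A := Matrix.SpecialLinearGroup.mapGL_injective (hBeq.trans hAeq.symm)
  exact Subgroup.mem_map.mpr ⟨B, ⟨hA, hB⟩, hAeq⟩

/-- The intersection of two congruence subgroups is a congruence subgroup
(`Γ(M N) ≤ Γ(M) ⊓ Γ(N)`). [folklore] -/
private theorem isCongruenceSubgroup_inf {Γ₁ Γ₂ : Subgroup SL(2, ℤ)}
    (h₁ : IsCongruenceSubgroup Γ₁) (h₂ : IsCongruenceSubgroup Γ₂) :
    IsCongruenceSubgroup (Γ₁ ⊓ Γ₂) := by
  obtain ⟨M, hM, hM'⟩ := h₁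
  obtain ⟨N, hN, hN'⟩ := h₂
  refine ⟨M * N, mul_ne_zero hM hN, fun A hA ↦ ?_⟩
  rw [Gamma_mem] at hA
  obtain ⟨h00, h01, h10, h11⟩ := hA
  have hred : ∀ {L : ℕ}, L ∣ M * N → A ∈ CongruenceSubgroup.Gamma L := by
    intro L hL
    have c00 := congrArg (ZMod.castHom hL (ZMod L)) h00
    have c01 := congrArg (ZMod.castHom hL (ZMod L)) h01
    have c10 := congrArg (ZMod.castHom hL (ZMod L)) h10
    have c11 := congrArg (ZMod.castHom hL (ZMod L)) h11
    rw [map_intCast, map_one] at c00 c11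
    rw [map_intCast, map_zero] at c01 c10
    exact Gamma_mem.mpr ⟨c00, c01, c10, c11⟩
  exact ⟨hM' (hred (dvd_mul_right M N)), hN' (hred (dvd_mul_left N M))⟩

/-- **Twisting by a form on another level.** If `f ∈ M_k(Γ)` has rational-integer
`q`-expansion at the positive integer strict period `h` of `Γ` and `E ∈ M_l(Γ₁)` has
rational-integer `q`-expansion at the positive integer strict period `h₁` of `Γ₁`, then `f · E` is a
weight-`(k + l)` modular form on `Γ ∩ Γ₁` with rational-integer `q`-expansion at the common strict
period `h h₁`. [folklore] -/
theorem exists_modularForm_mul_of_level (Γ Γ₁ : Subgroup SL(2, ℤ)) (k l : ℤ)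
    (f : ModularForm (Γ : Subgroup (GL (Fin 2) ℝ)) k)
    (E : ModularForm (Γ₁ : Subgroup (GL (Fin 2) ℝ)) l) {h h₁ : ℕ} (hh : 0 < h) (hh₁ : 0 < h₁)
    (hΓ : (h : ℝ) ∈ (Γ : Subgroup (GL (Fin 2) ℝ)).strictPeriods)
    (hΓ₁ : (h₁ : ℝ) ∈ (Γ₁ : Subgroup (GL (Fin 2) ℝ)).strictPeriods)
    (hint : ∀ n : ℕ, ∃ z : ℤ, PowerSeries.coeff n (qExpansion (h : ℝ) f) = (z : ℂ))
    (hE : ∀ n : ℕ, ∃ z : ℤ, PowerSeries.coeff n (qExpansion (h₁ : ℝ) E) = (z : ℂ)) :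
    ∃ F : ModularForm ((Γ ⊓ Γ₁ : Subgroup SL(2, ℤ)) : Subgroup (GL (Fin 2) ℝ)) (k + l),
      (F : ℍ → ℂ) = (f : ℍ → ℂ) * E ∧
      (((h * h₁ : ℕ) : ℝ) ∈
        ((Γ ⊓ Γ₁ : Subgroup SL(2, ℤ)) : Subgroup (GL (Fin 2) ℝ)).strictPeriods) ∧
      ∀ n : ℕ, ∃ z : ℤ, PowerSeries.coeff n (qExpansion ((h * h₁ : ℕ) : ℝ) F) = (z : ℂ) := by
  have hle : ((Γ ⊓ Γ₁ : Subgroup SL(2, ℤ)) : Subgroup (GL (Fin 2) ℝ)) ≤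
      (Γ : Subgroup (GL (Fin 2) ℝ)) := Subgroup.map_mono inf_le_left
  have hle₁ : ((Γ ⊓ Γ₁ : Subgroup SL(2, ℤ)) : Subgroup (GL (Fin 2) ℝ)) ≤
      (Γ₁ : Subgroup (GL (Fin 2) ℝ)) := Subgroup.map_mono inf_le_right
  obtain ⟨f', hf'⟩ := exists_modularForm_restrict hle k f
  obtain ⟨E', hE'⟩ := exists_modularForm_restrict hle₁ l E
  have hper : ((h * h₁ : ℕ) : ℝ) ∈
      ((Γ ⊓ Γ₁ : Subgroup SL(2, ℤ)) : Subgroup (GL (Fin 2) ℝ)).strictPeriods := by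
    refine mem_strictPeriods_inf ?_ ?_
    · have := (Γ : Subgroup (GL (Fin 2) ℝ)).strictPeriods.nsmul_mem hΓ h₁
      rw [nsmul_eq_mul] at this
      convert this using 1
      push_cast
      ring
    · have := (Γ₁ : Subgroup (GL (Fin 2) ℝ)).strictPeriods.nsmul_mem hΓ₁ h
      rw [nsmul_eq_mul] at this
      convert this using 1
      push_cast
      ring
  have hpos : (0 : ℝ) < ((h * h₁ : ℕ) : ℝ) := by positivity
  refine ⟨f'.mul E', by rw [ModularForm.coe_mul, hf', hE'], hper, fun n ↦ ?_⟩
  rw [ModularForm.qExpansion_mul hpos hper, exists_int_iff_mem_range]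
  refine coeff_mul_mem _ (fun m ↦ ?_) (fun m ↦ ?_) n
  · rw [← exists_int_iff_mem_range, hf', show ((h * h₁ : ℕ) : ℝ) = (h₁ : ℝ) * h by push_cast; ring]
    exact forall_coeff_qExpansion_natMul f (Nat.cast_pos.mpr hh) hΓ hh₁.ne'
      (P := fun x : ℂ ↦ ∃ z : ℤ, x = (z : ℂ)) ⟨0, by simp⟩ hint m
  · rw [← exists_int_iff_mem_range, hE', show ((h * h₁ : ℕ) : ℝ) = (h : ℝ) * h₁ by push_cast; ring]
    exact forall_coeff_qExpansion_natMul E (Nat.cast_pos.mpr hh₁) hΓ₁ hh.ne'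
      (P := fun x : ℂ ↦ ∃ z : ℤ, x = (z : ℂ)) ⟨0, by simp⟩ hE m

/-- **Untwisting by a form on another level.** Let `f ∈ M_k(Γ)`, `E ∈ M_l(Γ₁)` with `E ≢ 0`,
all levels of finite index in `SL(2, ℤ)`. If `f · E` is (the function of) a weight-`(k + l)`
modular form on `Γ'`, then `f` is a weight-`k` modular form on `Γ' ∩ Γ₁`: for `γ ∈ Γ' ∩ Γ₁`,
`(f|ₖγ − f) · E = (f E)|ₖ₊ₗγ − f E = 0` on the connected `ℍ` (`UpperHalfPlane.mul_eq_zero_iff`).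
[folklore] -/
theorem exists_modularForm_of_mul_of_level {Γ Γ₁ Γ' : Subgroup SL(2, ℤ)} [Γ.FiniteIndex]
    [Γ₁.FiniteIndex] [Γ'.FiniteIndex] {k l : ℤ} (f : ModularForm (Γ : Subgroup (GL (Fin 2) ℝ)) k)
    (E : ModularForm (Γ₁ : Subgroup (GL (Fin 2) ℝ)) l) (hE : (E : ℍ → ℂ) ≠ 0)
    (g : ModularForm (Γ' : Subgroup (GL (Fin 2) ℝ)) (k + l))
    (hg : (g : ℍ → ℂ) = (f : ℍ → ℂ) * E) :
    ∃ G : ModularForm ((Γ' ⊓ Γ₁ : Subgroup SL(2, ℤ)) : Subgroup (GL (Fin 2) ℝ)) k,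
      (G : ℍ → ℂ) = f := by
  have hinv : ∀ A ∈ Γ' ⊓ Γ₁, (f : ℍ → ℂ) ∣[k] (mapGL ℝ A) = f := by
    intro A hA
    have h1 : ((f : ℍ → ℂ) * E) ∣[k + l] (mapGL ℝ A) = (f : ℍ → ℂ) * E := by
      rw [← hg]
      exact g.slash_action_eq' _ (Subgroup.mem_map_of_mem (mapGL ℝ) hA.1)
    have h2 : ((f : ℍ → ℂ) * E) ∣[k + l] (mapGL ℝ A) =
        (f : ℍ → ℂ) ∣[k] (mapGL ℝ A) * (E : ℍ → ℂ) ∣[l] (mapGL ℝ A) := by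
      rw [ModularForm.mul_slash]
      simp
    have h3 : (E : ℍ → ℂ) ∣[l] (mapGL ℝ A) = E :=
      E.slash_action_eq' _ (Subgroup.mem_map_of_mem (mapGL ℝ) hA.2)
    rw [h2, h3] at h1
    have h4 : ((f : ℍ → ℂ) ∣[k] (mapGL ℝ A) - f) * (E : ℍ → ℂ) = 0 := by
      rw [sub_mul, h1, sub_self]
    have h5 := (UpperHalfPlane.mul_eq_zero_iff ((f.holo'.slash k _).sub f.holo') E.holo').mp h4
    exact sub_eq_zero.mp (h5.resolve_right hE)
  refine ⟨{ toFun := f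
            slash_action_eq' := fun γ hγ ↦ ?_
            holo' := f.holo'
            bdd_at_cusps' := fun hc ↦ f.bdd_at_cusps' (isCusp_of_isCusp hc) }, rfl⟩
  obtain ⟨A, hA, rfl⟩ := Subgroup.mem_map.mp hγ
  exact hinv A hA

/-- **Even weights suffice.** The unbounded denominators theorem follows from its restriction to
even weights: a form of odd weight `k` is twisted by the weight-`1` congruence form `θ²`
(part J; integral `q`-expansion at period `2`, `θ² ≢ 0`) into a form of even weight `k + 1` on
`Γ ∩ K`, to which the even case applies, and then untwisted
(`exists_modularForm_of_mul_of_level`) to a form on the intersection of two congruence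
subgroups. [folklore] -/
theorem CalegariDimitrovTang2025_unboundedDenominators.of_even_weight
    (H : ∀ (Γ : Subgroup SL(2, ℤ)) [Γ.FiniteIndex] (k : ℤ), Even k →
      ∀ (f : ModularForm (Γ : Subgroup (GL (Fin 2) ℝ)) k) (h : ℕ), 0 < h →
      ((h : ℝ) ∈ (Γ : Subgroup (GL (Fin 2) ℝ)).strictPeriods) →
      (∀ n : ℕ, ∃ z : ℤ, PowerSeries.coeff n (qExpansion (h : ℝ) f) = (z : ℂ)) →
      ∃ (Γ' : Subgroup SL(2, ℤ)) (g : ModularForm (Γ' : Subgroup (GL (Fin 2) ℝ)) k),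
        IsCongruenceSubgroup Γ' ∧ (g : ℍ → ℂ) = f) :
    CalegariDimitrovTang2025_unboundedDenominators := by
  intro Γ _ k f h hh hΓ hint
  rcases Int.even_or_odd k with hk | hk
  · exact H Γ k hk f h hh hΓ hint
  obtain ⟨Γ₁, hΓ₁fi, E, hΓ₁, h2, hEθ⟩ := exists_modularForm_thetaSq
  haveI := hΓ₁fi
  have h2' : ((2 : ℕ) : ℝ) ∈ (Γ₁ : Subgroup (GL (Fin 2) ℝ)).strictPeriods := by exact_mod_cast h2
  have hEint : ∀ n : ℕ, ∃ z : ℤ, PowerSeries.coeff n (qExpansion ((2 : ℕ) : ℝ) E) = (z : ℂ) := by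
    intro n
    rw [Nat.cast_two]
    exact thetaSq_qExpansion_coeff_int E hEθ h2 n
  have hEne : (E : ℍ → ℂ) ≠ 0 := by
    rw [hEθ]
    exact thetaSq_ne_zero
  obtain ⟨F, hF, hper, hFint⟩ :=
    exists_modularForm_mul_of_level Γ Γ₁ k 1 f E hh two_pos hΓ h2' hint hEint
  obtain ⟨Γc, g, hΓc, hg⟩ := H (Γ ⊓ Γ₁) (k + 1) hk.add_one F (h * 2) (by positivity) hper hFint
  haveI := hΓc.finiteIndex
  obtain ⟨G, hG⟩ := exists_modularForm_of_mul_of_level f E hEne g (hg.trans hF)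
  exact ⟨Γc ⊓ Γ₁, G, isCongruenceSubgroup_inf hΓc hΓ₁, hG⟩

/-- **Even weights from weights `12 m`.** The fact in all even weights follows from the fact in
the weights `12 m`, `m ≥ 1` (weights `≤ 0` being settled by `…of_weight_nonpos`; an even
`k ≥ 2` is moved to `k + r ≡ 0 (mod 12)`, `r ∈ {0, 4, 6, 8, 10, 14}`, by `E₄`- and `E₆`-twists,
parts C, D, H). [folklore] -/
theorem CalegariDimitrovTang2025_unboundedDenominators.even_weight_of_weight_twelve_mul
    (H12 : ∀ (Γ : Subgroup SL(2, ℤ)) [Γ.FiniteIndex] (m : ℕ), 1 ≤ m →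
      ∀ (f : ModularForm (Γ : Subgroup (GL (Fin 2) ℝ)) (12 * (m : ℤ))) (h : ℕ), 0 < h →
      ((h : ℝ) ∈ (Γ : Subgroup (GL (Fin 2) ℝ)).strictPeriods) →
      (∀ n : ℕ, ∃ z : ℤ, PowerSeries.coeff n (qExpansion (h : ℝ) f) = (z : ℂ)) →
      ∃ (Γ' : Subgroup SL(2, ℤ)) (g : ModularForm (Γ' : Subgroup (GL (Fin 2) ℝ)) (12 * (m : ℤ))),
        IsCongruenceSubgroup Γ' ∧ (g : ℍ → ℂ) = f)
    (Γ : Subgroup SL(2, ℤ)) [Γ.FiniteIndex] (k : ℤ) (hev : Even k) :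
    ∀ (f : ModularForm (Γ : Subgroup (GL (Fin 2) ℝ)) k) (h : ℕ), 0 < h →
      ((h : ℝ) ∈ (Γ : Subgroup (GL (Fin 2) ℝ)).strictPeriods) →
      (∀ n : ℕ, ∃ z : ℤ, PowerSeries.coeff n (qExpansion (h : ℝ) f) = (z : ℂ)) →
      ∃ (Γ' : Subgroup SL(2, ℤ)) (g : ModularForm (Γ' : Subgroup (GL (Fin 2) ℝ)) k),
        IsCongruenceSubgroup Γ' ∧ (g : ℍ → ℂ) = f := by
  intro f h hh hΓ hint
  -- the slice `P k := 12 ∣ k ∧ 1 ≤ k` holds by `H12`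
  have S0 : ∀ (Γ : Subgroup SL(2, ℤ)) [Γ.FiniteIndex] (k : ℤ), (12 ∣ k ∧ 1 ≤ k) →
      ∀ (f : ModularForm (Γ : Subgroup (GL (Fin 2) ℝ)) k) (h : ℕ), 0 < h →
      ((h : ℝ) ∈ (Γ : Subgroup (GL (Fin 2) ℝ)).strictPeriods) →
      (∀ n : ℕ, ∃ z : ℤ, PowerSeries.coeff n (qExpansion (h : ℝ) f) = (z : ℂ)) →
      ∃ (Γ' : Subgroup SL(2, ℤ)) (g : ModularForm (Γ' : Subgroup (GL (Fin 2) ℝ)) k),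
        IsCongruenceSubgroup Γ' ∧ (g : ℍ → ℂ) = f := by
    intro Γ _ k ⟨⟨m, hm⟩, hk⟩
    subst hm
    lift m to ℕ using by omega
    exact H12 Γ m (by omega)
  have S4 := slice_of_slice_add_four _ S0
  have S6 := slice_of_slice_add_six _ S0
  have S8 := slice_of_slice_add_four _ S4
  have S10 := slice_of_slice_add_six _ S4
  have S14 := slice_of_slice_add_six _ S8
  rcases le_or_gt k 0 with hk | hk
  · exact CalegariDimitrovTang2025_unboundedDenominators.of_weight_nonpos Γ k hk f h hh hΓ hint
  have hk12 : k % 12 = 0 ∨ k % 12 = 2 ∨ k % 12 = 4 ∨ k % 12 = 6 ∨ k % 12 = 8 ∨ k % 12 = 10 := by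
    obtain ⟨r, hr⟩ := hev
    omega
  rcases hk12 with h0 | h2 | h4 | h6 | h8 | h10
  · exact S0 Γ k ⟨by omega, by omega⟩ f h hh hΓ hint
  · exact S10 Γ k ⟨by omega, by omega⟩ f h hh hΓ hint
  · exact S8 Γ k ⟨by omega, by omega⟩ f h hh hΓ hint
  · exact S6 Γ k ⟨by omega, by omega⟩ f h hh hΓ hint
  · exact S4 Γ k ⟨by omega, by omega⟩ f h hh hΓ hint
  · exact S14 Γ k ⟨by omega, by omega⟩ f h hh hΓ hint

/-- **Weights `12 m` suffice.** The unbounded denominators theorem follows from its restriction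
to the weights `12 m`, `m ≥ 1` — the weights where `f ↦ f / Δᵐ` identifies the forms in question
with weight-`0` modular functions holomorphic on `ℍ`, the setting of the printed proof
[cite: CalegariDimitrovTang2025, §1 p. 3 and §4.2 Definition 22]; here the reduction is by
twisting with `E₄`, `E₆` (even weights) and `θ²` (odd weights) instead of `(λ/16 η(τ/2)²)ᵏ`. -/
theorem CalegariDimitrovTang2025_unboundedDenominators.of_weight_twelve_mul
    (H12 : ∀ (Γ : Subgroup SL(2, ℤ)) [Γ.FiniteIndex] (m : ℕ), 1 ≤ m →
      ∀ (f : ModularForm (Γ : Subgroup (GL (Fin 2) ℝ)) (12 * (m : ℤ))) (h : ℕ), 0 < h →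
      ((h : ℝ) ∈ (Γ : Subgroup (GL (Fin 2) ℝ)).strictPeriods) →
      (∀ n : ℕ, ∃ z : ℤ, PowerSeries.coeff n (qExpansion (h : ℝ) f) = (z : ℂ)) →
      ∃ (Γ' : Subgroup SL(2, ℤ)) (g : ModularForm (Γ' : Subgroup (GL (Fin 2) ℝ)) (12 * (m : ℤ))),
        IsCongruenceSubgroup Γ' ∧ (g : ℍ → ℂ) = f) :
    CalegariDimitrovTang2025_unboundedDenominators :=
  CalegariDimitrovTang2025_unboundedDenominators.of_even_weight
    fun Γ _ k hk ↦
      CalegariDimitrovTang2025_unboundedDenominators.even_weight_of_weight_twelve_mul H12 Γ k hk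

/-- **The core case, final form (no odd-weight residue).** Fix `M ≥ 1`. The unbounded
denominators theorem `CalegariDimitrovTang2025_unboundedDenominators` follows from — hence is
equivalent to — its special case in which

* the level `Γ` is a *normal*, finite-index, *noncongruence* subgroup of `SL(2, ℤ)` contained in
  `Γ(M)`;
* the weight is `12 m` with `m ≥ 1`;
* the form `f` is non-zero; and
* the `q`-expansion of `f` at the exact cusp width `strictWidthInfty Γ` has rational-integer
  coefficients.

Dividing by `Δᵐ`, these `f` are exactly the non-constant weight-`0` modular functions for `Γ`,
holomorphic on `ℍ` with poles of order `≤ m` at the cusps and bounded denominators at `∞` — the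
generators of the algebras `R_N` of the printed proof — so this is the statement "`R_N = M_N`" of
[cite: CalegariDimitrovTang2025, §4.2 (Definition 22, Lemma 24) and §6.3] in Mathlib's language,
for normal noncongruence levels. -/
theorem CalegariDimitrovTang2025_unboundedDenominators.of_core_twelve_mul (M : ℕ) [NeZero M]
    (H12 : ∀ (Γ : Subgroup SL(2, ℤ)) [Γ.FiniteIndex], Γ.Normal → Γ ≤ CongruenceSubgroup.Gamma M →
      ¬ IsCongruenceSubgroup Γ → ∀ (m : ℕ), 1 ≤ m →
      ∀ (f : ModularForm (Γ : Subgroup (GL (Fin 2) ℝ)) (12 * (m : ℤ))), f ≠ 0 →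
      (∀ n : ℕ, ∃ z : ℤ, PowerSeries.coeff n
        (qExpansion (Γ : Subgroup (GL (Fin 2) ℝ)).strictWidthInfty f) = (z : ℂ)) →
      ∃ (Γ' : Subgroup SL(2, ℤ)) (g : ModularForm (Γ' : Subgroup (GL (Fin 2) ℝ)) (12 * (m : ℤ))),
        IsCongruenceSubgroup Γ' ∧ (g : ℍ → ℂ) = f) :
    CalegariDimitrovTang2025_unboundedDenominators :=
  CalegariDimitrovTang2025_unboundedDenominators.of_weight_twelve_mul
    fun Γ _ m hm f h hh hΓ hint ↦
      CalegariDimitrovTang2025_unboundedDenominators.conclusion_of_core_case M Γ _ f h hh hΓ hint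
        fun Γ₀ _ hΓ₀n _ hleM hcong f₀ hzero _ hint₀ ↦ H12 Γ₀ hΓ₀n hleM hcong m hm f₀ hzero hint₀

/-! ### L. The core case in the exact setting of CDT §4.3 (Wohlfahrt level = cusp width) -/

/-- `mapGL (Tⁿ) = [1 n; 0 1]`. [folklore] -/
private theorem mapGL_T_pow (n : ℕ) :
    mapGL ℝ (ModularGroup.T ^ n) = Matrix.GeneralLinearGroup.upperRightHom (n : ℝ) := by
  rw [Units.ext_iff]
  change ((ModularGroup.T ^ n : SL(2, ℤ)) : Matrix (Fin 2) (Fin 2) ℤ).map (algebraMap ℤ ℝ) = _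
  rw [← zpow_natCast, ModularGroup.coe_T_zpow]
  ext i j
  fin_cases i <;> fin_cases j <;> simp

/-- A strict period `n ∈ ℕ` of (the image of) `Γ ≤ SL(2, ℤ)` means `Tⁿ ∈ Γ`. [folklore] -/
theorem T_pow_mem_of_mem_strictPeriods {Γ : Subgroup SL(2, ℤ)} {n : ℕ}
    (h : (n : ℝ) ∈ (Γ : Subgroup (GL (Fin 2) ℝ)).strictPeriods) : ModularGroup.T ^ n ∈ Γ := by
  obtain ⟨γ, hγ, hγeq, -⟩ := exists_mem_of_mem_strictPeriods h
  rw [← mapGL_T_pow] at hγeq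
  rwa [← Matrix.SpecialLinearGroup.mapGL_injective hγeq]

/-- Conversely `Tⁿ ∈ Γ` gives the strict period `n`. [folklore] -/
theorem mem_strictPeriods_of_T_pow_mem {Γ : Subgroup SL(2, ℤ)} {n : ℕ}
    (h : ModularGroup.T ^ n ∈ Γ) : (n : ℝ) ∈ (Γ : Subgroup (GL (Fin 2) ℝ)).strictPeriods := by
  rw [Subgroup.mem_strictPeriods_iff]
  exact Subgroup.mem_map.mpr ⟨_, h, mapGL_T_pow n⟩

/-- `Tⁿ ∈ Γ(N)` iff `N ∣ n`. [folklore] -/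
theorem T_pow_mem_Gamma_iff {N n : ℕ} :
    ModularGroup.T ^ n ∈ CongruenceSubgroup.Gamma N ↔ N ∣ n := by
  rw [← zpow_natCast, Gamma_mem, ModularGroup.coe_T_zpow]
  simp only [Matrix.of_apply, Matrix.cons_val', Matrix.cons_val_zero, Matrix.cons_val_one,
    Matrix.cons_val_fin_one, Matrix.empty_val', Int.cast_one, Int.cast_zero, Int.cast_natCast,
    true_and, and_true]
  exact ZMod.natCast_eq_zero_iff n N

/-- **Every finite-index `Γ ≤ SL(2, ℤ)` has a level:** some `N ≥ 1` with `g Tᴺ g⁻¹ ∈ Γ` for all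
`g` (all cusp widths divide `N`; the least such `N` is Wohlfahrt's level). Take for `N` the cusp
width at `∞` of the normal core of `Γ`. [cite: CalegariDimitrovTang2025, §4.1 (Definition 17 and
the paragraph before it)] -/
theorem exists_forall_conj_T_pow_mem (Γ : Subgroup SL(2, ℤ)) [Γ.FiniteIndex] :
    ∃ N : ℕ, 0 < N ∧ ∀ g : SL(2, ℤ), g * ModularGroup.T ^ N * g⁻¹ ∈ Γ := by
  obtain ⟨N, hN, hNw⟩ := exists_strictWidthInfty_eq_nat Γ.normalCore
  refine ⟨N, hN, fun g ↦ Γ.normalCore_le ?_⟩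
  have hT : ModularGroup.T ^ N ∈ Γ.normalCore := by
    refine T_pow_mem_of_mem_strictPeriods ?_
    rw [← hNw]
    exact Subgroup.strictWidthInfty_mem_strictPeriods _
  exact Γ.normalCore_normal.conj_mem _ hT g

/-- **Reduction to the core case in the setting of CDT §4.3, pointwise.** For a weight-`k` form
`f` on a finite-index `Γ ≤ SL(2, ℤ)` with integral `q`-expansion at a positive strict period `h`,
the conclusion of the unbounded denominators theorem holds for `f` as soon as it holds for every
restriction `f₀` of `f` (same function and weight) to a level `Γ₀ ≤ Γ` of the following kind,
for some `N ≥ 1`: `Γ₀` is *normal* of finite index in `SL(2, ℤ)`, *noncongruence*, contained in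
`Γ(N)`, contains every conjugate `g Tᴺ g⁻¹` (all cusp widths divide `N`) and has cusp width
exactly `N` at `∞` — so that `N` is the Wohlfahrt level of `Γ₀` and `Γ₀ ≤ Γ(N) ≤ ⟨±1, Γ(N)⟩`,
the setting `G = G_N` of [cite: CalegariDimitrovTang2025, §4.2 Lemma 24 and §4.3] — and `f₀ ≠ 0`
has rational-integer `q`-expansion at the period `N`. Construction: `N` := a level of `Γ`
(`exists_forall_conj_T_pow_mem`), `Γ₀` := the normal core of `Γ ∩ Γ(N)` (CDT Lemmas 18, 19). -/
theorem CalegariDimitrovTang2025_unboundedDenominators.conclusion_of_core_level_case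
    (Γ : Subgroup SL(2, ℤ)) [Γ.FiniteIndex] (k : ℤ)
    (f : ModularForm (Γ : Subgroup (GL (Fin 2) ℝ)) k) (h : ℕ) (hh : 0 < h)
    (hΓ : (h : ℝ) ∈ (Γ : Subgroup (GL (Fin 2) ℝ)).strictPeriods)
    (hint : ∀ n : ℕ, ∃ z : ℤ, PowerSeries.coeff n (qExpansion (h : ℝ) f) = (z : ℂ))
    (H : ∀ (Γ₀ : Subgroup SL(2, ℤ)) [Γ₀.FiniteIndex] (N : ℕ), 0 < N → Γ₀.Normal → Γ₀ ≤ Γ →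
      Γ₀ ≤ CongruenceSubgroup.Gamma N → (∀ g : SL(2, ℤ), g * ModularGroup.T ^ N * g⁻¹ ∈ Γ₀) →
      (Γ₀ : Subgroup (GL (Fin 2) ℝ)).strictWidthInfty = N → ¬ IsCongruenceSubgroup Γ₀ →
      ∀ (f₀ : ModularForm (Γ₀ : Subgroup (GL (Fin 2) ℝ)) k), f₀ ≠ 0 → (f₀ : ℍ → ℂ) = f →
      (∀ n : ℕ, ∃ z : ℤ, PowerSeries.coeff n (qExpansion (N : ℝ) f₀) = (z : ℂ)) →
      ∃ (Γ' : Subgroup SL(2, ℤ)) (g : ModularForm (Γ' : Subgroup (GL (Fin 2) ℝ)) k),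
        IsCongruenceSubgroup Γ' ∧ (g : ℍ → ℂ) = f₀) :
    ∃ (Γ' : Subgroup SL(2, ℤ)) (g : ModularForm (Γ' : Subgroup (GL (Fin 2) ℝ)) k),
      IsCongruenceSubgroup Γ' ∧ (g : ℍ → ℂ) = f := by
  have hh' : (0 : ℝ) < h := Nat.cast_pos.mpr hh
  -- a level `N` of `Γ`
  obtain ⟨N, hN, hconj⟩ := exists_forall_conj_T_pow_mem Γ
  haveI : NeZero N := ⟨hN.ne'⟩
  -- `Γ₀` := the normal core of `Γ ∩ Γ(N)`
  let Γ₁ : Subgroup SL(2, ℤ) := Γ ⊓ CongruenceSubgroup.Gamma N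
  let Γ₀ : Subgroup SL(2, ℤ) := Γ₁.normalCore
  haveI hΓ₀fi : Γ₀.FiniteIndex := Subgroup.finiteIndex_normalCore _
  have hΓ₀n : Γ₀.Normal := Subgroup.normalCore_normal _
  have hle : Γ₀ ≤ Γ := (Subgroup.normalCore_le _).trans inf_le_left
  have hleN : Γ₀ ≤ CongruenceSubgroup.Gamma N := (Subgroup.normalCore_le _).trans inf_le_right
  -- all cusp widths of `Γ₀` divide `N` (CDT Lemmas 18, 19)
  have hTN : ModularGroup.T ^ N ∈ CongruenceSubgroup.Gamma N := T_pow_mem_Gamma_iff.mpr dvd_rfl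
  have hconj₁ : ∀ g : SL(2, ℤ), g * ModularGroup.T ^ N * g⁻¹ ∈ Γ₁ := fun g ↦
    ⟨hconj g, (Gamma_normal N).conj_mem _ hTN g⟩
  have hconj₀ : ∀ g : SL(2, ℤ), g * ModularGroup.T ^ N * g⁻¹ ∈ Γ₀ := by
    intro g b
    simpa only [mul_assoc, _root_.mul_inv_rev] using hconj₁ (b * g)
  -- the cusp width of `Γ₀` at `∞` is exactly `N`
  have hT₀ : ModularGroup.T ^ N ∈ Γ₀ := by simpa using hconj₀ 1
  have hwidth : ((Γ₀ : Subgroup SL(2, ℤ)) : Subgroup (GL (Fin 2) ℝ)).strictWidthInfty = N := by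
    obtain ⟨W, hW, hWeq⟩ := exists_strictWidthInfty_eq_nat Γ₀
    rw [hWeq]
    norm_cast
    refine Nat.dvd_antisymm ?_ ?_
    · -- `W ∣ N`: `N` is a strict period
      obtain ⟨m, -, hm⟩ := exists_eq_natMul_strictWidthInfty (Γ := Γ₀) (Nat.cast_pos.mpr hN)
        (mem_strictPeriods_of_T_pow_mem hT₀)
      rw [hWeq] at hm
      exact ⟨m, by exact_mod_cast (hm.trans (mul_comm _ _))⟩
    · -- `N ∣ W`: `T^W ∈ Γ₀ ≤ Γ(N)`
      have hTW : ModularGroup.T ^ W ∈ Γ₀ := by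
        refine T_pow_mem_of_mem_strictPeriods ?_
        rw [← hWeq]
        exact Subgroup.strictWidthInfty_mem_strictPeriods _
      exact T_pow_mem_Gamma_iff.mp (hleN hTW)
  -- restrict `f`, move the integrality to the period `N`
  obtain ⟨f₀, hf₀⟩ := exists_modularForm_restrict (Subgroup.map_mono hle :
    ((Γ₀ : Subgroup SL(2, ℤ)) : Subgroup (GL (Fin 2) ℝ)) ≤ (Γ : Subgroup (GL (Fin 2) ℝ))) k f
  have hNΓ : (N : ℝ) ∈ (Γ : Subgroup (GL (Fin 2) ℝ)).strictPeriods :=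
    mem_strictPeriods_of_T_pow_mem (hle hT₀)
  have hintN : ∀ n : ℕ, ∃ z : ℤ, PowerSeries.coeff n (qExpansion (N : ℝ) f₀) = (z : ℂ) := by
    rw [hf₀]
    exact (forall_coeff_qExpansion_iff_of_mem_strictPeriods f hh' hΓ (Nat.cast_pos.mpr hN) hNΓ
      (P := fun x : ℂ ↦ ∃ z : ℤ, x = (z : ℂ)) ⟨0, by simp⟩).mp hint
  -- conclude
  rw [← hf₀]
  by_cases hcong : IsCongruenceSubgroup Γ₀
  · exact ⟨Γ₀, f₀, hcong, rfl⟩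
  by_cases hzero : f₀ = 0
  · refine ⟨CongruenceSubgroup.Gamma 1, 0, Gamma_is_cong_sub 1, ?_⟩
    rw [hzero, ModularForm.coe_zero, ModularForm.coe_zero]
  exact H Γ₀ N hN hΓ₀n hle hleN hconj₀ hwidth hcong f₀ hzero hf₀ hintN

/-- **The core case in the setting of CDT §4.3.** The unbounded denominators theorem
`CalegariDimitrovTang2025_unboundedDenominators` follows from — hence is equivalent to — its
special case for: a *normal*, finite-index, *noncongruence* `G ≤ SL(2, ℤ)` and an `N ≥ 1` with
`G ≤ Γ(N)`, `g Tᴺ g⁻¹ ∈ G` for all `g ∈ SL(2, ℤ)` (all cusp widths divide `N`) and cusp width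
exactly `N` at `∞` (so `N` is the Wohlfahrt level of `G`); weight `12 m`, `m ≥ 1` (even, so
`f` is also invariant under `±G ≤ ⟨±1, Γ(N)⟩`); `f ≠ 0`; and `f ∈ ℤ⟦q_N⟧`, `q_N = e^{2πiτ/N}`,
i.e. rational-integer `q`-expansion at the period `N`. This is the input of the leveraging
argument of [cite: CalegariDimitrovTang2025, §4.3 (Theorem 25, Proposition 28) with §4.2
Lemma 24] in Mathlib's language (`…of_weight_twelve_mul`, then
`…conclusion_of_core_level_case`). -/
theorem CalegariDimitrovTang2025_unboundedDenominators.of_core_level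
    (H : ∀ (G : Subgroup SL(2, ℤ)) [G.FiniteIndex] (N : ℕ), 0 < N → G.Normal →
      G ≤ CongruenceSubgroup.Gamma N → (∀ g : SL(2, ℤ), g * ModularGroup.T ^ N * g⁻¹ ∈ G) →
      (G : Subgroup (GL (Fin 2) ℝ)).strictWidthInfty = N → ¬ IsCongruenceSubgroup G →
      ∀ (m : ℕ), 1 ≤ m → ∀ (f : ModularForm (G : Subgroup (GL (Fin 2) ℝ)) (12 * (m : ℤ))),
      f ≠ 0 → (∀ n : ℕ, ∃ z : ℤ, PowerSeries.coeff n (qExpansion (N : ℝ) f) = (z : ℂ)) →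
      ∃ (Γ' : Subgroup SL(2, ℤ)) (g : ModularForm (Γ' : Subgroup (GL (Fin 2) ℝ)) (12 * (m : ℤ))),
        IsCongruenceSubgroup Γ' ∧ (g : ℍ → ℂ) = f) :
    CalegariDimitrovTang2025_unboundedDenominators :=
  CalegariDimitrovTang2025_unboundedDenominators.of_weight_twelve_mul
    fun Γ _ m hm f h hh hΓ hint ↦
      CalegariDimitrovTang2025_unboundedDenominators.conclusion_of_core_level_case Γ _ f h hh hΓ
        hint fun Γ₀ _ N hN hΓ₀n _ hleN hconj hw hcong f₀ hzero _ hintN ↦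
          H Γ₀ N hN hΓ₀n hleN hconj hw hcong m hm f₀ hzero hintN

/-! ### M. The discriminant `Δ` has rational-integer `q`-expansion -/

/-- Coefficients of `C a * f`-type products with numerals: `coeff n (k * f) = k * coeff n f` for a
numeral `k`, in any power series ring. [folklore] -/
private theorem coeff_ofNat_mul {R : Type*} [CommRing R] (k : ℕ) [k.AtLeastTwo] (f : PowerSeries R)
    (n : ℕ) : PowerSeries.coeff n ((OfNat.ofNat k : PowerSeries R) * f) =
      (OfNat.ofNat k : R) * PowerSeries.coeff n f := by
  rw [← map_ofNat (PowerSeries.C (R := R)) k, PowerSeries.coeff_C_mul]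

/-- `E₄ = 1 + 240 A`, `A = Σ_{n ≥ 1} σ₃(n) qⁿ ∈ ℤ⟦q⟧` (at period `1`). [folklore] -/
theorem E₄_qExpansion_eq :
    qExpansion 1 ModularForm.E₄ = 1 + 240 * PowerSeries.map (Int.castRingHom ℂ)
      (PowerSeries.mk fun n ↦ if n = 0 then (0 : ℤ) else (ArithmeticFunction.sigma 3 n : ℤ)) := by
  ext n
  rw [E₄_qExpansion_coeff, map_add, coeff_ofNat_mul, PowerSeries.coeff_map, PowerSeries.coeff_mk]
  rcases Nat.eq_zero_or_pos n with rfl | hn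
  · simp
  · simp [hn.ne', PowerSeries.coeff_one]

/-- `E₆ = 1 - 504 B`, `B = Σ_{n ≥ 1} σ₅(n) qⁿ ∈ ℤ⟦q⟧`. [folklore] -/
theorem E₆_qExpansion_eq :
    qExpansion 1 ModularForm.E₆ = 1 - 504 * PowerSeries.map (Int.castRingHom ℂ)
      (PowerSeries.mk fun n ↦ if n = 0 then (0 : ℤ) else (ArithmeticFunction.sigma 5 n : ℤ)) := by
  ext n
  rw [E₆_qExpansion_coeff, map_sub, coeff_ofNat_mul, PowerSeries.coeff_map, PowerSeries.coeff_mk]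
  rcases Nat.eq_zero_or_pos n with rfl | hn
  · simp
  · simp [hn.ne', PowerSeries.coeff_one]

/-- `Δ = (E₄³ - E₆²)/1728` on `q`-expansions (Mathlib's `discriminant_eq_E₄_cube_sub_E₆_sq`).
[folklore] -/
theorem discriminant_qExpansion_eq :
    qExpansion 1 ModularForm.discriminant =
      (1728 : ℂ)⁻¹ • (qExpansion 1 ModularForm.E₄ ^ 3 - qExpansion 1 ModularForm.E₆ ^ 2) := by
  let G' : ModularForm 𝒮ℒ 12 := ModularForm.mcast (by decide) (ModularForm.E₄.pow 3) -
      ModularForm.mcast (by decide) (ModularForm.E₆.pow 2)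
  have hG : (((1728 : ℂ)⁻¹ • G' : ModularForm 𝒮ℒ 12) : ℍ → ℂ) = ModularForm.discriminant := by
    funext z
    simp only [G', ModularForm.IsGLPos.coe_smul, ModularForm.coe_sub, ModularForm.coe_mcast,
      ModularForm.coe_pow, Pi.smul_apply, Pi.sub_apply, Pi.pow_apply, smul_eq_mul,
      ModularForm.discriminant_eq_E₄_cube_sub_E₆_sq z]
    ring
  have h2 : qExpansion 1 G' =
      qExpansion 1 ModularForm.E₄ ^ 3 - qExpansion 1 ModularForm.E₆ ^ 2 := by
    simp only [G', ModularForm.coe_sub, ModularForm.coe_mcast,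
      ModularForm.qExpansion_sub one_pos one_mem_strictPeriods_SL,
      ModularForm.qExpansion_pow one_pos one_mem_strictPeriods_SL]
  rw [← hG, ModularForm.IsGLPos.coe_smul,
    ModularForm.qExpansion_smul one_pos one_mem_strictPeriods_SL _ G', h2]

/-- `12 ∣ 5 d³ + 7 d⁵` for every integer `d` (check modulo `12`). [folklore] -/
private theorem twelve_dvd_aux (d : ℤ) : (12 : ℤ) ∣ 5 * d ^ 3 + 7 * d ^ 5 := by
  have key : ∀ x : ZMod 12, 5 * x ^ 3 + 7 * x ^ 5 = 0 := by decide
  have h : ((5 * d ^ 3 + 7 * d ^ 5 : ℤ) : ZMod 12) = 0 := by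
    push_cast
    exact key _
  exact (ZMod.intCast_zmod_eq_zero_iff_dvd _ 12).mp h

/-- `12 ∣ 5 σ₃(n) + 7 σ₅(n)` (the congruence behind the integrality of `Δ = (E₄³ - E₆²)/1728`).
[folklore] -/
theorem twelve_dvd_five_mul_sigma_three_add_seven_mul_sigma_five (n : ℕ) :
    (12 : ℤ) ∣ 5 * (ArithmeticFunction.sigma 3 n : ℤ) + 7 * (ArithmeticFunction.sigma 5 n : ℤ) := by
  rw [ArithmeticFunction.sigma_apply, ArithmeticFunction.sigma_apply]
  push_cast
  rw [Finset.mul_sum, Finset.mul_sum, ← Finset.sum_add_distrib]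
  exact Finset.dvd_sum fun d _ ↦ twelve_dvd_aux d

/-- **`Δ` has rational-integer `q`-expansion** (at period `1`): `qExpansion 1 Δ` is the image of
an integer power series. Proof from `1728 Δ = E₄³ - E₆²`: with `E₄ = 1 + 240 A`, `E₆ = 1 - 504 B`,
`E₄³ - E₆² = 1728 (100 A² + 8000 A³ - 147 B²) + 144 (5 A + 7 B)` and `5 A + 7 B = 12 C` by
`12 ∣ 5 σ₃ + 7 σ₅`. (Equivalently: `Δ = q ∏ (1 - qⁿ)²⁴ ∈ ℤ⟦q⟧`.) [folklore] -/
theorem exists_discriminant_qExpansion_eq_map :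
    ∃ D : PowerSeries ℤ,
      qExpansion 1 ModularForm.discriminant = PowerSeries.map (Int.castRingHom ℂ) D := by
  let A : PowerSeries ℤ :=
    PowerSeries.mk fun n ↦ if n = 0 then (0 : ℤ) else (ArithmeticFunction.sigma 3 n : ℤ)
  let B : PowerSeries ℤ :=
    PowerSeries.mk fun n ↦ if n = 0 then (0 : ℤ) else (ArithmeticFunction.sigma 5 n : ℤ)
  -- `5 A + 7 B = 12 C`
  obtain ⟨C, hC⟩ : ∃ C : PowerSeries ℤ, 5 * A + 7 * B = 12 * C := by
    choose c hc using fun n ↦ twelve_dvd_five_mul_sigma_three_add_seven_mul_sigma_five n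
    refine ⟨PowerSeries.mk fun n ↦ if n = 0 then 0 else c n, ?_⟩
    ext n
    rw [map_add, coeff_ofNat_mul, coeff_ofNat_mul, coeff_ofNat_mul]
    simp only [A, B, PowerSeries.coeff_mk]
    rcases Nat.eq_zero_or_pos n with rfl | hn
    · simp
    · simp only [hn.ne', if_false]
      exact_mod_cast hc n
  let φ : PowerSeries ℤ →+* PowerSeries ℂ := PowerSeries.map (Int.castRingHom ℂ)
  refine ⟨100 * A ^ 2 + 8000 * A ^ 3 - 147 * B ^ 2 + C, ?_⟩
  rw [discriminant_qExpansion_eq, E₄_qExpansion_eq, E₆_qExpansion_eq]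
  change (1728 : ℂ)⁻¹ • ((1 + 240 * φ A) ^ 3 - (1 - 504 * φ B) ^ 2) =
    φ (100 * A ^ 2 + 8000 * A ^ 3 - 147 * B ^ 2 + C)
  have h12 : 5 * φ A + 7 * φ B = 12 * φ C := by
    have := congrArg φ hC
    rwa [map_add, map_mul, map_mul, map_mul, map_ofNat φ 5, map_ofNat φ 7, map_ofNat φ 12]
      at this
  have e : (1 + 240 * φ A) ^ 3 - (1 - 504 * φ B) ^ 2 =
      1728 * (100 * φ A ^ 2 + 8000 * φ A ^ 3 - 147 * φ B ^ 2) + 144 * (5 * φ A + 7 * φ B) := by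
    ring
  rw [e, h12, show (1728 : PowerSeries ℂ) * (100 * φ A ^ 2 + 8000 * φ A ^ 3 - 147 * φ B ^ 2) +
      144 * (12 * φ C) = 1728 * (100 * φ A ^ 2 + 8000 * φ A ^ 3 - 147 * φ B ^ 2 + φ C) by ring]
  rw [PowerSeries.smul_eq_C_mul, ← mul_assoc, ← map_ofNat (PowerSeries.C (R := ℂ)) 1728,
    ← map_mul, inv_mul_cancel₀ (by norm_num), map_one, one_mul]
  rw [map_add, map_sub, map_add, map_mul, map_mul, map_mul, map_pow, map_pow, map_pow,
    map_ofNat φ 100, map_ofNat φ 8000, map_ofNat φ 147]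

/-- `Δ` has rational-integer `q`-expansion coefficients at period `1`. [folklore] -/
theorem discriminant_qExpansion_coeff_int (n : ℕ) :
    ∃ z : ℤ, PowerSeries.coeff n (qExpansion 1 ModularForm.discriminant) = (z : ℂ) := by
  obtain ⟨D, hD⟩ := exists_discriminant_qExpansion_eq_map
  exact ⟨PowerSeries.coeff n D, by rw [hD, PowerSeries.coeff_map, eq_intCast]⟩

/-- `Δ` has rational-integer `q`-expansion coefficients at every positive integer period.
[folklore] -/
theorem discriminant_qExpansion_natCast_coeff_int {h : ℕ} (hh : h ≠ 0) (j : ℕ) :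
    ∃ z : ℤ, PowerSeries.coeff j (qExpansion (h : ℝ) ModularForm.discriminant) = (z : ℂ) := by
  have e : ((CuspForm.discriminant : ModularForm 𝒮ℒ 12) : ℍ → ℂ) = ModularForm.discriminant :=
    rfl
  have := forall_coeff_qExpansion_natMul (CuspForm.discriminant : ModularForm 𝒮ℒ 12) one_pos
    one_mem_strictPeriods_SL hh (P := fun x : ℂ ↦ ∃ z : ℤ, x = (z : ℂ)) ⟨0, by simp⟩
    (by rw [e]; exact discriminant_qExpansion_coeff_int) j
  rw [e, mul_one] at this
  exact this

/-! ### N. Twisting by `Δ`: integrality is preserved and reflected -/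

/-- At a positive integer period `h`, `qExpansion h Δ = Xʰ · U` with `U ∈ ℤ⟦X⟧`, `U(0) = 1`:
the image of an integer power series with constant term `1`. [folklore] -/
theorem exists_discriminant_qExpansion_natCast_eq_X_pow_mul {h : ℕ} (hh : 0 < h) :
    ∃ U : PowerSeries ℤ, PowerSeries.constantCoeff U = 1 ∧
      qExpansion (h : ℝ) ModularForm.discriminant =
        PowerSeries.X ^ h * PowerSeries.map (Int.castRingHom ℂ) U := by
  -- integer coefficients `z j` at period `h`
  choose z hz using discriminant_qExpansion_natCast_coeff_int hh.ne'
  -- the coefficients at period `h` in terms of those at period `1`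
  have e : ((CuspForm.discriminant : ModularForm 𝒮ℒ 12) : ℍ → ℂ) = ModularForm.discriminant :=
    rfl
  have hspread : ∀ j : ℕ, PowerSeries.coeff j (qExpansion (h : ℝ) ModularForm.discriminant) =
      if h ∣ j then PowerSeries.coeff (j / h) (qExpansion 1 ModularForm.discriminant) else 0 := by
    intro j
    have := qExpansion_coeff_natMul (CuspForm.discriminant : ModularForm 𝒮ℒ 12) one_pos
      one_mem_strictPeriods_SL hh.ne' j
    rwa [e, mul_one] at this
  have h0 : PowerSeries.coeff 0 (qExpansion 1 ModularForm.discriminant) = 0 := by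
    have := CuspFormClass.qExpansion_coeff_zero CuspForm.discriminant one_pos
      one_mem_strictPeriods_SL
    rwa [CuspForm.coe_discriminant] at this
  have hlow : ∀ j < h, PowerSeries.coeff j (qExpansion (h : ℝ) ModularForm.discriminant) = 0 := by
    intro j hj
    rw [hspread]
    split_ifs with hdvd
    · rcases Nat.eq_zero_or_pos j with rfl | hj0
      · simpa using h0
      · exact absurd (Nat.le_of_dvd hj0 hdvd) (not_le.mpr hj)
    · rfl
  have hh' : PowerSeries.coeff h (qExpansion (h : ℝ) ModularForm.discriminant) = 1 := by
    rw [hspread, if_pos dvd_rfl, Nat.div_self hh, ModularForm.discriminant_qExpansion_coeff_one]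
  refine ⟨PowerSeries.mk fun n ↦ z (n + h), ?_, ?_⟩
  · rw [← PowerSeries.coeff_zero_eq_constantCoeff_apply, PowerSeries.coeff_mk, zero_add]
    have := hz h
    rw [hh'] at this
    exact_mod_cast this.symm
  · ext j
    rw [PowerSeries.coeff_X_pow_mul', PowerSeries.coeff_map, PowerSeries.coeff_mk, eq_intCast]
    split_ifs with hle
    · rw [Nat.sub_add_cancel hle]
      exact hz j
    · exact hlow j (not_le.mp hle)

/-- **Integrality is reflected by the `Δ`-twist.** If `f ∈ M_k(Γ)` and the weight-`(k+12)` form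
`F = f · Δ` on `Γ` has rational-integer `q`-expansion at the positive integer strict period `h`,
then so has `f`: `qExpansion h Δ = Xʰ U` with `U` a unit of `ℤ⟦X⟧`. In other words the
integrality hypothesis of the core case (weight `12 m`) is equivalent to the integrality of the
Laurent coefficients of the weight-`0` function `f / Δᵐ` (the "bounded denominators at `∞`" of
[cite: CalegariDimitrovTang2025, §4.2 Definition 22], up to clearing denominators). -/
theorem forall_coeff_int_of_mul_discriminant {Γ : Subgroup SL(2, ℤ)} {k : ℤ}
    (f : ModularForm (Γ : Subgroup (GL (Fin 2) ℝ)) k) {h : ℕ} (hh : 0 < h)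
    (hΓ : (h : ℝ) ∈ (Γ : Subgroup (GL (Fin 2) ℝ)).strictPeriods)
    (F : ModularForm (Γ : Subgroup (GL (Fin 2) ℝ)) (k + 12))
    (hF : (F : ℍ → ℂ) = (f : ℍ → ℂ) * ModularForm.discriminant)
    (hint : ∀ n : ℕ, ∃ z : ℤ, PowerSeries.coeff n (qExpansion (h : ℝ) F) = (z : ℂ)) (n : ℕ) :
    ∃ z : ℤ, PowerSeries.coeff n (qExpansion (h : ℝ) f) = (z : ℂ) := by
  have hhr : (0 : ℝ) < h := Nat.cast_pos.mpr hh
  obtain ⟨U, hU1, hU⟩ := exists_discriminant_qExpansion_natCast_eq_X_pow_mul hh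
  -- `U` is a unit of `ℤ⟦X⟧`; `V` := its inverse
  have hUunit : IsUnit U := PowerSeries.isUnit_iff_constantCoeff.mpr (by rw [hU1]; exact isUnit_one)
  set V : PowerSeries ℤ := ↑(hUunit.unit⁻¹) with hV
  have hUV : U * V = 1 := hUunit.mul_val_inv
  let φ : PowerSeries ℤ →+* PowerSeries ℂ := PowerSeries.map (Int.castRingHom ℂ)
  -- `qExpansion h F = qExpansion h f * X^h * φ U`
  obtain ⟨D, hD⟩ := exists_modularForm_restrict (Subgroup.map_le_range (mapGL ℝ) (H := Γ)) 12
    (CuspForm.discriminant : ModularForm 𝒮ℒ 12)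
  have hprod : qExpansion (h : ℝ) F =
      qExpansion (h : ℝ) f * (PowerSeries.X ^ h * φ U) := by
    rw [← hU, show (ModularForm.discriminant : ℍ → ℂ) = D from hD.symm, hF,
      show (ModularForm.discriminant : ℍ → ℂ) = D from hD.symm]
    exact ModularForm.qExpansion_mul_coe hhr hΓ f D
  -- hence `qExpansion h f * X^h = qExpansion h F * φ V` has integer coefficients
  have hkey : qExpansion (h : ℝ) f * PowerSeries.X ^ h = qExpansion (h : ℝ) F * φ V := by
    rw [hprod, mul_assoc, mul_assoc, ← map_mul, hUV, map_one, mul_one]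
  have hFV : ∀ m, PowerSeries.coeff m (qExpansion (h : ℝ) F * φ V) ∈ (Int.castRingHom ℂ).range := by
    refine coeff_mul_mem _ (fun m ↦ (exists_int_iff_mem_range _).mp (hint m)) fun m ↦ ?_
    exact ⟨PowerSeries.coeff m V, by simp [φ]⟩
  have := hFV (n + h)
  rw [← hkey, PowerSeries.coeff_mul_X_pow] at this
  exact (exists_int_iff_mem_range _).mpr this

/-- **Twisting by `Δ`** preserves "level `Γ`, rational-integer `q`-expansion at `h`", adding `12`
to the weight. [folklore] -/
theorem exists_modularForm_mul_discriminant (Γ : Subgroup SL(2, ℤ)) (k : ℤ)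
    (f : ModularForm (Γ : Subgroup (GL (Fin 2) ℝ)) k) {h : ℕ} (hh : 0 < h)
    (hΓ : (h : ℝ) ∈ (Γ : Subgroup (GL (Fin 2) ℝ)).strictPeriods)
    (hint : ∀ n : ℕ, ∃ z : ℤ, PowerSeries.coeff n (qExpansion (h : ℝ) f) = (z : ℂ)) :
    ∃ F : ModularForm (Γ : Subgroup (GL (Fin 2) ℝ)) (k + 12),
      (F : ℍ → ℂ) = (f : ℍ → ℂ) * ModularForm.discriminant ∧
      ∀ n : ℕ, ∃ z : ℤ, PowerSeries.coeff n (qExpansion (h : ℝ) F) = (z : ℂ) :=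
  exists_modularForm_mul_levelOne Γ k f (CuspForm.discriminant : ModularForm 𝒮ℒ 12) hh hΓ
    (discriminant_qExpansion_natCast_coeff_int hh.ne') hint

/-- **Integrality at `h` is invariant under `f ↦ f · Δ`** (both directions). [folklore] -/
theorem forall_coeff_int_iff_of_mul_discriminant {Γ : Subgroup SL(2, ℤ)} {k : ℤ}
    (f : ModularForm (Γ : Subgroup (GL (Fin 2) ℝ)) k) {h : ℕ} (hh : 0 < h)
    (hΓ : (h : ℝ) ∈ (Γ : Subgroup (GL (Fin 2) ℝ)).strictPeriods)
    (F : ModularForm (Γ : Subgroup (GL (Fin 2) ℝ)) (k + 12))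
    (hF : (F : ℍ → ℂ) = (f : ℍ → ℂ) * ModularForm.discriminant) :
    (∀ n : ℕ, ∃ z : ℤ, PowerSeries.coeff n (qExpansion (h : ℝ) F) = (z : ℂ)) ↔
      ∀ n : ℕ, ∃ z : ℤ, PowerSeries.coeff n (qExpansion (h : ℝ) f) = (z : ℂ) := by
  refine ⟨fun hint ↦ forall_coeff_int_of_mul_discriminant f hh hΓ F hF hint, fun hint ↦ ?_⟩
  obtain ⟨F', hF', hint'⟩ := exists_modularForm_mul_discriminant Γ k f hh hΓ hint
  have : (F : ℍ → ℂ) = F' := hF.trans hF'.symm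
  rw [this]
  exact hint'

/-- `Δ` is not identically zero on `ℍ` (it vanishes nowhere). [folklore] -/
private theorem coe_discriminant_ne_zero :
    ((CuspForm.discriminant : ModularForm 𝒮ℒ 12) : ℍ → ℂ) ≠ 0 := fun h0 ↦
  ModularForm.discriminant_ne_zero UpperHalfPlane.I (congrFun h0 UpperHalfPlane.I)

/-- **Weight raising by `12`, pointwise** (twist by `Δ`, untwist by
`exists_modularForm_of_mul_levelOne`). [folklore] -/
theorem CalegariDimitrovTang2025_unboundedDenominators.conclusion_of_mul_discriminant
    (Γ : Subgroup SL(2, ℤ)) [Γ.FiniteIndex] (k : ℤ)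
    (f : ModularForm (Γ : Subgroup (GL (Fin 2) ℝ)) k) (h : ℕ) (hh : 0 < h)
    (hΓ : (h : ℝ) ∈ (Γ : Subgroup (GL (Fin 2) ℝ)).strictPeriods)
    (hint : ∀ n : ℕ, ∃ z : ℤ, PowerSeries.coeff n (qExpansion (h : ℝ) f) = (z : ℂ))
    (H : ∀ F : ModularForm (Γ : Subgroup (GL (Fin 2) ℝ)) (k + 12),
      (F : ℍ → ℂ) = (f : ℍ → ℂ) * ModularForm.discriminant →
      (∀ n : ℕ, ∃ z : ℤ, PowerSeries.coeff n (qExpansion (h : ℝ) F) = (z : ℂ)) →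
      ∃ (Γ' : Subgroup SL(2, ℤ)) (g : ModularForm (Γ' : Subgroup (GL (Fin 2) ℝ)) (k + 12)),
        IsCongruenceSubgroup Γ' ∧ (g : ℍ → ℂ) = F) :
    ∃ (Γ' : Subgroup SL(2, ℤ)) (g : ModularForm (Γ' : Subgroup (GL (Fin 2) ℝ)) k),
      IsCongruenceSubgroup Γ' ∧ (g : ℍ → ℂ) = f := by
  obtain ⟨F, hF, hFint⟩ := exists_modularForm_mul_discriminant Γ k f hh hΓ hint
  obtain ⟨Γ', g, hΓ', hg⟩ := H F hF hFint
  haveI := hΓ'.finiteIndex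
  obtain ⟨G, hG⟩ := exists_modularForm_of_mul_levelOne f
    (CuspForm.discriminant : ModularForm 𝒮ℒ 12) coe_discriminant_ne_zero g (hg.trans hF)
  exact ⟨Γ', G, hΓ', hG⟩

/-- **Weights `12 m`, `m ≥ m₀`, suffice** (any `m₀`): twist by powers of `Δ`. [folklore] -/
theorem CalegariDimitrovTang2025_unboundedDenominators.of_weight_twelve_mul_ge (m₀ : ℕ)
    (H12 : ∀ (Γ : Subgroup SL(2, ℤ)) [Γ.FiniteIndex] (m : ℕ), m₀ ≤ m →
      ∀ (f : ModularForm (Γ : Subgroup (GL (Fin 2) ℝ)) (12 * (m : ℤ))) (h : ℕ), 0 < h →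
      ((h : ℝ) ∈ (Γ : Subgroup (GL (Fin 2) ℝ)).strictPeriods) →
      (∀ n : ℕ, ∃ z : ℤ, PowerSeries.coeff n (qExpansion (h : ℝ) f) = (z : ℂ)) →
      ∃ (Γ' : Subgroup SL(2, ℤ)) (g : ModularForm (Γ' : Subgroup (GL (Fin 2) ℝ)) (12 * (m : ℤ))),
        IsCongruenceSubgroup Γ' ∧ (g : ℍ → ℂ) = f) :
    CalegariDimitrovTang2025_unboundedDenominators := by
  refine CalegariDimitrovTang2025_unboundedDenominators.of_weight_twelve_mul ?_
  -- by downward induction: the slice at `12 m` from the slice at `12 (m + 1)`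
  suffices ∀ (d m : ℕ), m₀ ≤ m + d → ∀ (Γ : Subgroup SL(2, ℤ)) [Γ.FiniteIndex]
      (f : ModularForm (Γ : Subgroup (GL (Fin 2) ℝ)) (12 * (m : ℤ))) (h : ℕ), 0 < h →
      ((h : ℝ) ∈ (Γ : Subgroup (GL (Fin 2) ℝ)).strictPeriods) →
      (∀ n : ℕ, ∃ z : ℤ, PowerSeries.coeff n (qExpansion (h : ℝ) f) = (z : ℂ)) →
      ∃ (Γ' : Subgroup SL(2, ℤ)) (g : ModularForm (Γ' : Subgroup (GL (Fin 2) ℝ)) (12 * (m : ℤ))),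
        IsCongruenceSubgroup Γ' ∧ (g : ℍ → ℂ) = f from
    fun Γ _ m _ f h hh hΓ hint ↦ this m₀ m (Nat.le_add_left m₀ m) Γ f h hh hΓ hint
  intro d
  induction d with
  | zero => exact fun m hm Γ _ f h hh hΓ hint ↦ H12 Γ m (by omega) f h hh hΓ hint
  | succ d ih =>
    intro m hm Γ _ f h hh hΓ hint
    refine CalegariDimitrovTang2025_unboundedDenominators.conclusion_of_mul_discriminant Γ _ f h
      hh hΓ hint fun F hF hFint ↦ ?_
    have e : (12 * (m : ℤ) + 12) = 12 * ((m + 1 : ℕ) : ℤ) := by push_cast; ring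
    obtain ⟨Γ', g, hΓ', hg⟩ := ih (m + 1) (by omega) Γ (ModularForm.mcast e F) h hh hΓ
      (by simpa only [ModularForm.coe_mcast] using hFint)
    exact ⟨Γ', ModularForm.mcast e.symm g, hΓ', by
      rw [ModularForm.coe_mcast, hg, ModularForm.coe_mcast]⟩

/-! ### O. The core case with `-1 ∈ G ≤ ⟨-1, Γ(N)⟩` (even weight) -/

/-- In even weight, `f|ₖ(-1) = f` for the `GL(2, ℝ)`-action. [folklore] -/
theorem slash_neg_one_of_even {k : ℤ} (hk : Even k) (f : ℍ → ℂ) :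
    f ∣[k] (-1 : GL (Fin 2) ℝ) = f := by
  ext τ
  rw [ModularForm.slash_def]
  have hdet : (((-1 : GL (Fin 2) ℝ).det : ℝˣ) : ℝ) = 1 := by
    simp [Matrix.det_neg]
  simp only [UpperHalfPlane.neg_smul, one_smul, UpperHalfPlane.σ_neg, denom_neg, denom_one,
    hdet, abs_one, Complex.ofReal_one, one_zpow, mul_one, zpow_neg, hk.neg_one_zpow, inv_one]
  simp [UpperHalfPlane.σ]

/-- **Even-weight forms extend across `-1`.** A modular form of even weight `k` on an arithmetic
`Γ ≤ GL(2, ℝ)` is a modular form of weight `k` on `⟨Γ, -1⟩ = Γ.adjoinNegOne`, with the same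
underlying function. [folklore] -/
theorem exists_modularForm_adjoinNegOne {Γ : Subgroup (GL (Fin 2) ℝ)} [Γ.IsArithmetic] {k : ℤ}
    (hk : Even k) (f : ModularForm Γ k) : ∃ g : ModularForm Γ.adjoinNegOne k, (g : ℍ → ℂ) = f := by
  refine ⟨{ toFun := f
            slash_action_eq' := fun γ hγ ↦ ?_
            holo' := f.holo'
            bdd_at_cusps' := fun {c} hc ↦ f.bdd_at_cusps' ?_ }, rfl⟩
  · rcases (Subgroup.mem_adjoinNegOne_iff.mp hγ) with h | h
    · exact f.slash_action_eq' γ h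
    · have : γ = (-1 : GL (Fin 2) ℝ) * (-γ) := by rw [neg_one_mul, neg_neg]
      rw [this, SlashAction.slash_mul, slash_neg_one_of_even hk]
      exact f.slash_action_eq' _ h
  · rw [Subgroup.IsArithmetic.isCusp_iff_isCusp_SL2Z] at hc ⊢
    exact hc

/-- `mapGL (-γ) = -mapGL γ`. [folklore] -/
private theorem mapGL_neg (γ : SL(2, ℤ)) : mapGL ℝ (-γ) = -mapGL ℝ γ := by
  ext i j
  simp

/-- **The core case with `E = {±1} ⊂ G ⊂ ⟨E, Γ(N)⟩`** — the literal setting of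
[cite: CalegariDimitrovTang2025, §4.2 Lemma 24 and §4.3 Proposition 28]. The unbounded
denominators theorem follows from its special case for: `G ≤ SL(2, ℤ)` normal of finite index with
`-1 ∈ G`, `G ⊆ ±Γ(N)` (every element is `± γ` with `γ ∈ Γ(N)`), `g Tᴺ g⁻¹ ∈ G` for all `g` and
cusp width exactly `N` at `∞` (Wohlfahrt level `N`), `G` noncongruence; weight `12 m`, `m ≥ 1`;
`f ≠ 0` with rational-integer `q`-expansion at the period `N`. Obtained from `…of_core_level` by
adjoining `-1` (even weight: `exists_modularForm_adjoinNegOne`); if `±G` happens to be a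
congruence subgroup the conclusion is immediate. -/
theorem CalegariDimitrovTang2025_unboundedDenominators.of_core_level_negOne
    (H : ∀ (G : Subgroup SL(2, ℤ)) [G.FiniteIndex] (N : ℕ), 0 < N → G.Normal → (-1 : SL(2, ℤ)) ∈ G →
      (∀ γ ∈ G, γ ∈ CongruenceSubgroup.Gamma N ∨ -γ ∈ CongruenceSubgroup.Gamma N) →
      (∀ g : SL(2, ℤ), g * ModularGroup.T ^ N * g⁻¹ ∈ G) →
      (G : Subgroup (GL (Fin 2) ℝ)).strictWidthInfty = N → ¬ IsCongruenceSubgroup G →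
      ∀ (m : ℕ), 1 ≤ m → ∀ (f : ModularForm (G : Subgroup (GL (Fin 2) ℝ)) (12 * (m : ℤ))),
      f ≠ 0 → (∀ n : ℕ, ∃ z : ℤ, PowerSeries.coeff n (qExpansion (N : ℝ) f) = (z : ℂ)) →
      ∃ (Γ' : Subgroup SL(2, ℤ)) (g : ModularForm (Γ' : Subgroup (GL (Fin 2) ℝ)) (12 * (m : ℤ))),
        IsCongruenceSubgroup Γ' ∧ (g : ℍ → ℂ) = f) :
    CalegariDimitrovTang2025_unboundedDenominators := by
  refine CalegariDimitrovTang2025_unboundedDenominators.of_core_level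
    fun Γ₀ _ N hN hΓ₀n hleN hconj hw _ m hm f₀ hzero hint ↦ ?_
  haveI : NeZero N := ⟨hN.ne'⟩
  -- `G := ±Γ₀`
  let G : Subgroup SL(2, ℤ) :=
    { carrier := {γ | γ ∈ Γ₀ ∨ -γ ∈ Γ₀}
      mul_mem' := fun {a b} ha hb ↦ by
        simp only [Set.mem_setOf_eq] at ha hb ⊢
        rcases ha with ha | ha <;> rcases hb with hb | hb
        · exact Or.inl (mul_mem ha hb)
        · exact Or.inr (by rw [show -(a * b) = a * -b by rw [mul_neg]]; exact mul_mem ha hb)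
        · exact Or.inr (by rw [show -(a * b) = -a * b by rw [neg_mul]]; exact mul_mem ha hb)
        · exact Or.inl (by rw [show a * b = -a * -b by rw [neg_mul_neg]]; exact mul_mem ha hb)
      one_mem' := Or.inl (one_mem _)
      inv_mem' := fun {a} ha ↦ by
        simp only [Set.mem_setOf_eq] at ha ⊢
        rcases ha with ha | ha
        · exact Or.inl (inv_mem ha)
        · exact Or.inr (by rw [show -a⁻¹ = (-a)⁻¹ by rw [neg_inv]]; exact inv_mem ha) }
  have hmemG : ∀ γ, γ ∈ G ↔ γ ∈ Γ₀ ∨ -γ ∈ Γ₀ := fun γ ↦ Iff.rfl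
  have hΓ₀G : Γ₀ ≤ G := fun γ hγ ↦ Or.inl hγ
  haveI hGfi : G.FiniteIndex := Subgroup.finiteIndex_of_le hΓ₀G
  have hGn : G.Normal := ⟨fun γ hγ g ↦ by
    rcases (hmemG γ).mp hγ with h | h
    · exact Or.inl (hΓ₀n.conj_mem γ h g)
    · refine Or.inr ?_
      rw [show -(g * γ * g⁻¹) = g * -γ * g⁻¹ by rw [mul_neg, neg_mul]]
      exact hΓ₀n.conj_mem _ h g⟩
  have hneg : (-1 : SL(2, ℤ)) ∈ G := Or.inr (by rw [neg_neg]; exact one_mem _)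
  have hGN : ∀ γ ∈ G, γ ∈ CongruenceSubgroup.Gamma N ∨ -γ ∈ CongruenceSubgroup.Gamma N :=
    fun γ hγ ↦ ((hmemG γ).mp hγ).imp (fun h ↦ hleN h) (fun h ↦ hleN h)
  have hconjG : ∀ g : SL(2, ℤ), g * ModularGroup.T ^ N * g⁻¹ ∈ G := fun g ↦ hΓ₀G (hconj g)
  -- the cusp width of `G` at `∞` is still `N`
  have hTN : ModularGroup.T ^ N ∈ G := by simpa using hconjG 1
  have hwG : ((G : Subgroup SL(2, ℤ)) : Subgroup (GL (Fin 2) ℝ)).strictWidthInfty = N := by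
    obtain ⟨W, hW, hWeq⟩ := exists_strictWidthInfty_eq_nat G
    rw [hWeq]
    norm_cast
    refine Nat.dvd_antisymm ?_ ?_
    · obtain ⟨m, -, hm⟩ := exists_eq_natMul_strictWidthInfty (Γ := G) (Nat.cast_pos.mpr hN)
        (mem_strictPeriods_of_T_pow_mem hTN)
      rw [hWeq] at hm
      exact ⟨m, by exact_mod_cast (hm.trans (mul_comm _ _))⟩
    · have hTW : ModularGroup.T ^ W ∈ G := by
        refine T_pow_mem_of_mem_strictPeriods ?_
        rw [← hWeq]
        exact Subgroup.strictWidthInfty_mem_strictPeriods _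
      rcases (hmemG _).mp hTW with h | h
      · exact T_pow_mem_Gamma_iff.mp (hleN h)
      · -- `-T^W ∈ Γ(N)` forces `N ∣ W` as well (upper-right entry)
        have h' := hleN h
        rw [← zpow_natCast, Gamma_mem] at h'
        obtain ⟨-, h01, -, -⟩ := h'
        rw [Matrix.SpecialLinearGroup.coe_neg, ModularGroup.coe_T_zpow] at h01
        simp only [Matrix.neg_apply, Matrix.of_apply, Matrix.cons_val', Matrix.cons_val_zero,
          Matrix.cons_val_one, Matrix.cons_val_fin_one, Matrix.empty_val', Int.cast_neg,
          Int.cast_natCast, neg_eq_zero] at h01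
        exact (ZMod.natCast_eq_zero_iff W N).mp h01
  -- extend `f₀` (even weight `12 m`) to `G`
  have hev : Even (12 * (m : ℤ)) := ⟨6 * m, by ring⟩
  obtain ⟨f₁, hf₁⟩ := exists_modularForm_adjoinNegOne hev f₀
  have hle : ((G : Subgroup SL(2, ℤ)) : Subgroup (GL (Fin 2) ℝ)) ≤
      ((Γ₀ : Subgroup SL(2, ℤ)) : Subgroup (GL (Fin 2) ℝ)).adjoinNegOne := by
    rintro _ ⟨γ, hγ, rfl⟩
    rcases (hmemG γ).mp hγ with h | h
    · exact Or.inl (Subgroup.mem_map_of_mem _ h)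
    · exact Or.inr (by rw [← mapGL_neg]; exact Subgroup.mem_map_of_mem _ h)
  obtain ⟨f', hf'⟩ := exists_modularForm_restrict hle _ f₁
  have hf'₀ : (f' : ℍ → ℂ) = f₀ := hf'.trans hf₁
  rw [← hf'₀]
  by_cases hcong : IsCongruenceSubgroup G
  · exact ⟨G, f', hcong, rfl⟩
  have hzero' : f' ≠ 0 := fun h0 ↦ hzero (by
    apply DFunLike.ext' 
    rw [← hf'₀, h0]
    rfl)
  have hint' : ∀ n : ℕ, ∃ z : ℤ, PowerSeries.coeff n (qExpansion (N : ℝ) f') = (z : ℂ) := by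
    rw [hf'₀]
    exact hint
  exact H G N hN hGn hneg hGN hconjG hwG hcong m hm f' hzero' hint'

/-- **The unbounded denominators theorem is EQUIVALENT to its core case** (setting of
[cite: CalegariDimitrovTang2025, §4.2 Lemma 24 and §4.3]): `…of_core_level_negOne` and, conversely,
the core case is the special case `Γ = G`, `h = N` of the fact (`Tᴺ ∈ G` gives the strict
period `N`). -/
theorem CalegariDimitrovTang2025_unboundedDenominators.iff_core_level_negOne :
    CalegariDimitrovTang2025_unboundedDenominators ↔
    ∀ (G : Subgroup SL(2, ℤ)) [G.FiniteIndex] (N : ℕ), 0 < N → G.Normal → (-1 : SL(2, ℤ)) ∈ G →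
      (∀ γ ∈ G, γ ∈ CongruenceSubgroup.Gamma N ∨ -γ ∈ CongruenceSubgroup.Gamma N) →
      (∀ g : SL(2, ℤ), g * ModularGroup.T ^ N * g⁻¹ ∈ G) →
      (G : Subgroup (GL (Fin 2) ℝ)).strictWidthInfty = N → ¬ IsCongruenceSubgroup G →
      ∀ (m : ℕ), 1 ≤ m → ∀ (f : ModularForm (G : Subgroup (GL (Fin 2) ℝ)) (12 * (m : ℤ))),
      f ≠ 0 → (∀ n : ℕ, ∃ z : ℤ, PowerSeries.coeff n (qExpansion (N : ℝ) f) = (z : ℂ)) →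
      ∃ (Γ' : Subgroup SL(2, ℤ)) (g : ModularForm (Γ' : Subgroup (GL (Fin 2) ℝ)) (12 * (m : ℤ))),
        IsCongruenceSubgroup Γ' ∧ (g : ℍ → ℂ) = f := by
  refine ⟨fun hCDT G _ N hN _ _ _ hconj _ _ m _ f _ hint ↦ ?_,
    CalegariDimitrovTang2025_unboundedDenominators.of_core_level_negOne⟩
  have hTN : ModularGroup.T ^ N ∈ G := by simpa using hconj 1
  exact hCDT G (12 * (m : ℤ)) f N hN (mem_strictPeriods_of_T_pow_mem hTN) hint

/-! ### P. The core case in terms of the Wohlfahrt level `L(G)` -/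

/-- **The fact is equivalent to its core case, stated with the Wohlfahrt level** (tree:
`wohlfahrtLevel`, `Literature/NumberTheory/Automorphic/WohlfahrtLevel.lean`). The unbounded
denominators theorem holds iff: for every normal finite-index `G ≤ SL(2, ℤ)` with `-1 ∈ G`,
`G ⊆ ±Γ(L(G))` and `G` noncongruence — i.e. `E ⊂ G ⊂ ⟨E, Γ(N)⟩`, `L(G) = N`, the groups `G_N`
of [cite: CalegariDimitrovTang2025, §4.2 Lemma 24] — every non-zero `f ∈ M_{12m}(G)`, `m ≥ 1`,
with `f ∈ ℤ⟦e^{2πiτ/L(G)}⟧` is modular for a congruence subgroup. (From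
`…iff_core_level_negOne`: there `L(G) ∣ N` by `wohlfahrtLevel_dvd_iff`, and `N ∣ L(G)` because
`T^{L(G)} ∈ G` makes `L(G)` a strict period, a multiple of the cusp width `N`.) -/
theorem CalegariDimitrovTang2025_unboundedDenominators.iff_core_wohlfahrtLevel :
    CalegariDimitrovTang2025_unboundedDenominators ↔
    ∀ (G : Subgroup SL(2, ℤ)) [G.FiniteIndex], G.Normal → (-1 : SL(2, ℤ)) ∈ G →
      (∀ γ ∈ G, γ ∈ CongruenceSubgroup.Gamma (wohlfahrtLevel G) ∨
        -γ ∈ CongruenceSubgroup.Gamma (wohlfahrtLevel G)) →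
      ¬ IsCongruenceSubgroup G →
      ∀ (m : ℕ), 1 ≤ m → ∀ (f : ModularForm (G : Subgroup (GL (Fin 2) ℝ)) (12 * (m : ℤ))),
      f ≠ 0 →
      (∀ n : ℕ, ∃ z : ℤ,
        PowerSeries.coeff n (qExpansion (wohlfahrtLevel G : ℝ) f) = (z : ℂ)) →
      ∃ (Γ' : Subgroup SL(2, ℤ)) (g : ModularForm (Γ' : Subgroup (GL (Fin 2) ℝ)) (12 * (m : ℤ))),
        IsCongruenceSubgroup Γ' ∧ (g : ℍ → ℂ) = f := by
  constructor
  · intro hCDT G _ _ _ _ _ m _ f _ hint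
    exact hCDT G (12 * (m : ℤ)) f (wohlfahrtLevel G) (wohlfahrtLevel_pos G)
      (mem_strictPeriods_of_T_pow_mem (T_pow_wohlfahrtLevel_mem G)) hint
  · intro H
    refine CalegariDimitrovTang2025_unboundedDenominators.iff_core_level_negOne.mpr
      fun G _ N hN hGn hneg hGN hconj hw hnc m hm f hf hint ↦ ?_
    -- `L(G) = N`
    have hL : wohlfahrtLevel G = N := by
      refine Nat.dvd_antisymm ((wohlfahrtLevel_dvd_iff G N).mpr hconj) ?_
      obtain ⟨k, -, hk⟩ := exists_eq_natMul_strictWidthInfty (Γ := G)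
        (Nat.cast_pos.mpr (wohlfahrtLevel_pos G))
        (mem_strictPeriods_of_T_pow_mem (T_pow_wohlfahrtLevel_mem G))
      rw [hw] at hk
      exact ⟨k, by exact_mod_cast hk.trans (mul_comm _ _)⟩
    exact H G hGn hneg (by rw [hL]; exact hGN) hnc m hm f hf (by rw [hL]; exact hint)

/-! ### Q. The dependency picture for the algebraic-integer version -/

open NumberField in
/-- **What the consumer-facing fact `…_algInt` needs, in total.** Combining
`…_algInt.of_unboundedDenominators_of_galois` (Remark 59: Voight's trace argument, proved in the
fact file around its two classical inputs `hA`, `hB`) with `…iff_core_wohlfahrtLevel`: the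
algebraic-integer version `CalegariDimitrovTang2025_unboundedDenominators_algInt` follows from
(i) `hA` (one number field carries all coefficients of a form with algebraic-integer
coefficients), (ii) `hB` (Galois conjugates of forms on finite-index subgroups are such forms) and
(iii) the core case of Theorem 1 for CDT's groups `G_N` (normal, `E ⊂ G ⊂ ⟨E, Γ(L(G))⟩`,
noncongruence; weight `12 m`, `f ≠ 0`, `f ∈ ℤ⟦e^{2πiτ/L(G)}⟧`) — and nothing else.
[cite: CalegariDimitrovTang2025, Remarks 58–59 and §4.2 Lemma 24] -/
theorem CalegariDimitrovTang2025_unboundedDenominators_algInt.of_galois_of_core_wohlfahrtLevel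
    (hA : ∀ (Γ : Subgroup SL(2, ℤ)) [Γ.FiniteIndex] (k : ℤ)
      (f : ModularForm (Γ : Subgroup (GL (Fin 2) ℝ)) k) (h : ℕ), 0 < h →
      ((h : ℝ) ∈ (Γ : Subgroup (GL (Fin 2) ℝ)).strictPeriods) →
      (∀ n : ℕ, IsIntegral ℤ (PowerSeries.coeff n (qExpansion (h : ℝ) f))) →
      ∃ (K : Type) (_ : Field K) (_ : NumberField K) (σ₀ : K →+* ℂ) (b : ℕ → 𝓞 K),
        ∀ n : ℕ, PowerSeries.coeff n (qExpansion (h : ℝ) f) = σ₀ (b n))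
    (hB : ∀ (Γ : Subgroup SL(2, ℤ)) [Γ.FiniteIndex] (k : ℤ)
      (f : ModularForm (Γ : Subgroup (GL (Fin 2) ℝ)) k) (h : ℕ), 0 < h →
      ((h : ℝ) ∈ (Γ : Subgroup (GL (Fin 2) ℝ)).strictPeriods) →
      ∀ (K : Type) [Field K] [NumberField K] (σ₀ : K →+* ℂ) (b : ℕ → K),
      (∀ n : ℕ, PowerSeries.coeff n (qExpansion (h : ℝ) f) = σ₀ (b n)) →
      ∀ τ : K →+* ℂ, ∃ (Γ' : Subgroup SL(2, ℤ)) (_ : Γ'.FiniteIndex)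
        (f' : ModularForm (Γ' : Subgroup (GL (Fin 2) ℝ)) k),
        ((h : ℝ) ∈ (Γ' : Subgroup (GL (Fin 2) ℝ)).strictPeriods) ∧
        ∀ n : ℕ, PowerSeries.coeff n (qExpansion (h : ℝ) f') = τ (b n))
    (Hcore : ∀ (G : Subgroup SL(2, ℤ)) [G.FiniteIndex], G.Normal → (-1 : SL(2, ℤ)) ∈ G →
      (∀ γ ∈ G, γ ∈ CongruenceSubgroup.Gamma (wohlfahrtLevel G) ∨
        -γ ∈ CongruenceSubgroup.Gamma (wohlfahrtLevel G)) →
      ¬ IsCongruenceSubgroup G →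
      ∀ (m : ℕ), 1 ≤ m → ∀ (f : ModularForm (G : Subgroup (GL (Fin 2) ℝ)) (12 * (m : ℤ))),
      f ≠ 0 →
      (∀ n : ℕ, ∃ z : ℤ,
        PowerSeries.coeff n (qExpansion (wohlfahrtLevel G : ℝ) f) = (z : ℂ)) →
      ∃ (Γ' : Subgroup SL(2, ℤ)) (g : ModularForm (Γ' : Subgroup (GL (Fin 2) ℝ)) (12 * (m : ℤ))),
        IsCongruenceSubgroup Γ' ∧ (g : ℍ → ℂ) = f) :
    CalegariDimitrovTang2025_unboundedDenominators_algInt :=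
  CalegariDimitrovTang2025_unboundedDenominators_algInt.of_unboundedDenominators_of_galois
    (CalegariDimitrovTang2025_unboundedDenominators.iff_core_wohlfahrtLevel.mpr Hcore) hA hB

end Literature.NumberTheory.Automorphic

end
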